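import Literature.Analysis.FluidPDE.EllipticalInstabilityFloquet
import HarnessLib

/-!
# Waleffe's `9/16`: the lower half of the `9/16`-law for the elliptical instability, as a theorem

HONEST FRAMING (cell `ns-blowup`, seat `lit3`; D-0074): a statement about the LINEARISED MODEL
problem — the Floquet asymptotics, as the strain `ε → 0⁺`, of the short-wave (Kelvin-mode) system
(Saffman (12.4.4)–(12.4.5)) of Bayly's strained vortex. WHAT THIS IS NOT: not a statement about the
Navier–Stokes regularity problem (the Kelvin modes concerned generate infinite-energy exact
solutions, `KelvinModeFloquet.lean` §4); nothing here is evidence of blow-up or of regularity.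

## What is proved

`EllipticalInstability.NineSixteenthsLaw` (file `EllipticalInstability.lean`; Waleffe 1990, Cambon
(3.2), Kerswell 2002 §2: "`σ_max/ε → 9/16` as `ε → 0⁺`") is the tree's one unproved named fact of the
elliptical-instability cluster. It is the conjunction, for every `γ > 0`, `δ > 0` and all
sufficiently small `ε > 0`, of an UPPER clause (every inviscid Kelvin mode of `gradMatrix γ ε` grows
at most like `e^{(9/16+δ)εt}`) and a LOWER clause (some mode grows at least like
`e^{(9/16−δ)εt}`). This file PROVES THE LOWER CLAUSE:

* **`nineSixteenths_exists_half`**: `∀ γ > 0, ∀ δ > 0, ∃ ε₀ > 0, ∀ ε ∈ (0, ε₀)`, there are `k v`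
  with `IsKelvinMode (gradMatrix γ ε) 0 k v`, `k 0 ≠ 0` and `c e^{(9/16 − δ) ε t} ≤ ‖v t‖` for all
  `t ≥ 0` (`c > 0`).

Together with the proved strain-rate ceiling (`IsKelvinMode.norm_le_exp`,
`kelvinFloquetExponent_le_strain`: every mode grows at most like `e^{εt}`) this places the maximal
inviscid growth rate of the strained vortex, for small strain, in the KERNEL-certified window
`(9/16 − δ) ε ≤ σ_max(γ, ε) ≤ ε` — the `ns-blowup` rate table's row R3 "a level-`k` structure in an
elliptical host passes the linear stage with `σ = Θ(ε)`", two-sided. The upper clause with the sharp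
constant `9/16` (uniform Floquet perturbation theory over all inclinations, including the `O(ε)`
resonance band and the higher tongues) is NOT proved here.

## The printed argument and how it is followed

Waleffe's derivation (Waleffe 1990 §III, primary not held; reproduced in Huerre–Rossi, *Hydrodynamic
instabilities in open flows*, §8.4 of Godrèche–Manneville (eds.), *Hydrodynamics and Nonlinear
Instabilities* (CUP 1998), eqs. (8.60)–(8.103) [held: `lit read
book:claude-godreche-editnd-hydrodynamics-nonlinear-instabilities`, text chunks 228–237]) reduces the
Kelvin-mode system on the strained vortex EXACTLY to the Hill equation (8.92)
`[1 − a cos 2Ω₀t] (k²w̃)'' + Ω₀²[c − 4a cos 2Ω₀t] k²w̃ = 0`, `a = −(2ε/Ω) k₀²/(k₀²+q₀²)`,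
`c = 4q₀²/(k₀²+q₀²)`, which for small `a` is the Mathieu equation (8.95) with forcing amplitude
`a(4 − c)`; the principal SUBHARMONIC resonance sits at `c = 1`, i.e. at the inclination
`cos θ_c = 1/2`, `θ_c = π/3` ((8.101)–(8.103): the inertial wave of frequency `Ω/2` in a vortex of
vorticity `Ω` is destabilised first), and the textbook growth rate of the principal Mathieu tongue
(`s = hω/4` for `ẍ + ω²(1 + h cos 2ωt) x = 0`, the classical parametric-resonance formula, e.g.
Landau–Lifshitz *Mechanics* §27 — context only, not used below) with `ω = Ω₀`,
`h = 3|a| = (9/4)(ε/γ)` at `c = 1` gives `σ = (9/16) ε` (`γ = Ω/2` the rotation rate, Saffman's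
normalisation; the value `9/16` is Waleffe's, quoted by Cambon (3.2) and in the docstring of
`NineSixteenthsLaw`). What is formal in print is the averaging step; this file replaces it by a
rigorous FIRST-ORDER PERTURBATION OF THE MONODROMY with explicit remainders, organised as follows.

* §1 **Orbital time.** With `α = aspect γ ε`, `Ω = orbitFrequency γ ε` one has
  `gradMatrix γ ε = Ω • nsGrad α`, `nsGrad α = [[0, −α, 0], [1/α, 0, 0], [0, 0, 0]]`
  (`gradMatrix_eq_smul_nsGrad`), and in the time `s = Ωt` Saffman's orbit has period exactly `2π`.
  The whole analysis is done for the system `v' = ampOp (nsGrad α) 0 (κ_α s) v` along the **tuned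
  resonant orbit** `κ_α(s) = (h cos s, α h sin s, 1/2)`, `h = (√3/4)(3 − α)` (`tunedOrbit`), which
  solves `κ' = −(nsGrad α)ᵀ κ` (`hasDerivAt_tunedOrbit`) — so it is an instance of the tree's
  `IsKelvinMode` framework and ALL of `KelvinModeFloquet.lean` §6–§9 (determinant `1`, the
  multiplier `1`, the trace criterion and `|ρ| = (|τ| + √(τ²−4))/2`) applies verbatim. At `α = 1`
  the orbit is the unit vector at the resonant inclination `θ = π/3`; the tuning `h(α)` follows the
  centre of the resonance band to first order (`cos²θ = (α²+1)/(α²+7) + O((α−1)²)`, Waleffe's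
  `c = 1`): at FIXED `θ = π/3` a first-order detuning survives and the rate is only
  `(√45/16) ε ≈ 0.42 ε`; on the tuned family it is `(9/16) ε · 2α/(α+1) ≥ (9/16) ε`.
* §2–§3 **The resonant base problem is explicitly solvable** (`α = 1`: inertial waves in a frame
  rotating with the vortex, Huerre–Rossi (8.65)–(8.77)): the base monodromy over `[0, 2π]` is the
  IDENTITY (`baseSol₁/₂/₃` through the orthonormal frame `p₁ = ŷ`, `p₂ = (½, 0, −√3/2)`,
  `k̂ = (√3/2, 0, ½)` return to their data), and the ADJOINT base system has the explicit solutions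
  `adjSol₁/₂` through `p₁`, `p₂`.
* §4–§5 **First-order coefficient and remainders.** `firstOrderOp s` is `∂_α` of the coefficient
  operator at `α = 1`; `‖C_α − C₁ − (α−1) D‖ ≤ K (α−1)²` and `‖C_α − C₁‖ ≤ K (α−1)` pointwise
  (`norm_ampRHS_sub_sub_le`, `norm_ampRHS_sub_le`), elementary.
* §6 **One Grönwall inequality**: the true solutions through `p₁, p₂, k̂` stay `O(α−1)`-close to the
  base solutions on `[0, 2π]`.
* §7 **Adjoint pairing** (no Duhamel formula needed): `d/ds ⟪ψ_a, y⟫ = ⟪ψ_a, (C_α − C₁) y⟫`, so by the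
  fundamental theorem of calculus `⟪p_a, M(α) p_b⟫ = δ_ab + (α−1) β_ab + O((α−1)²)` with
  `β_ab = ∫₀^{2π} ⟪ψ_a, D x_b⟫`; the two integrands needed collapse to
  `−(7/2)cos⁴ + (17/4)cos² − 1/4` and `−(7/2)cos⁴ + (9/4)cos³ + (11/4)cos² − (9/8)cos + 1/2`, both of
  mean `9/16`: **`β₁₂ = β₂₁ = 9π/8`** (this is where Waleffe's number appears; `9π/8 · Ω/(2π) · `
  `(α−1) = (9/16) ε · 2α/(α+1)`).
* §8 **The `k̂`-row is second order** by conservation of `⟪κ_α, v⟫`.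
* §9 **First-order data give the second-order trace.** With `det M = 1` and the multiplier `1`
  (`KelvinModeFloquet` §6) the `3 × 3` invariants satisfy `e₂(M − I) = −tr(M − I)`; feeding the
  expansions gives `tr β = 0` and `tr M − 3 ≥ (α−1)² ((9π/8)² − C(α−1))`.
* §10 **Assembly**: `exists_multiplier_of_trace_abs_eq` ⇒ `|ρ| ≥ 1 + (α−1)(9π/8 − o(1))`, the
  growing Kelvin mode of `exists_kelvinMode_of_multiplier`, transport back to physical time
  (`σ_t = σ_s Ω`, `(α−1)Ω = ε · 2α/(α+1) ≥ ε`), `ε₀(γ, δ)` explicit in the constants.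

The leading-order numbers of §7 were cross-checked symbolically (sympy) and the second-order trace
law numerically (RK4: `(tr M − 3)/((α−1)²(9π/8)²) = 0.990` at `α − 1 = 0.01`,
`log ρ/(α−1) = 3.517 → 9π/8 = 3.534`) before typing (kit jobs j253848/j253933 of the seat); the
kernel proofs below do not depend on those computations.

## References

* F. Waleffe, *On the three-dimensional instability of strained vortices*, Phys. Fluids A 2 (1990)
  76–80, §III. [`Waleffe1990`] (primary; cite-only, acq-07005)
* P. Huerre, M. Rossi, *Hydrodynamic instabilities in open flows*, in C. Godrèche, P. Manneville
  (eds.), *Hydrodynamics and Nonlinear Instabilities*, CUP 1998, §8.4 eqs. (8.60)–(8.103),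
  Figs. 8.15–8.18. [`GodrecheManneville1998`] (held; locators are equation numbers — the held text
  is chunked, chunks 225–238 cover §8.4)
* P. G. Saffman, *Vortex Dynamics*, CUP 1992, §12.4 eqs. (1)–(9), Fig. 12.4-1. [`Saffman1992`]
* B. J. Bayly, Phys. Rev. Lett. 57 (1986) 2160. [`Bayly1986`] (cite-only, acq-06974)
* C. Cambon, ch. 13 of Hunt–Vassilicos (eds.), *Turbulence Structure and Vortex Dynamics*, CUP 2000,
  §3.2 eq. (3.2). [`Cambon2000RotatingFrameVortexStability`]
* C. Chicone, *Ordinary Differential Equations with Applications*, 2nd ed., §2.4. [`Chicone2006`]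
-/

noncomputable section

open Real Set Function InnerProductSpace Filter MeasureTheory intervalIntegral
open scoped RealInnerProductSpace Topology ContDiff

namespace Literature.Analysis.FluidPDE

namespace EllipticalInstability

open RotatingStrain KelvinMode Literature.Analysis.ODE

/-! ### §0 Coordinates on `ℝ³` -/

/-- `⟪x, y⟫` on `ℝ³` in coordinates. [folklore] -/
private theorem inner_three (x y : EuclideanSpace ℝ (Fin 3)) :
    ⟪x, y⟫ = x 0 * y 0 + x 1 * y 1 + x 2 * y 2 := by
  simp only [PiLp.inner_apply, Fin.sum_univ_three, RCLike.inner_apply, conj_trivial]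
  ring

/-- `‖x‖²` on `ℝ³` in coordinates. [folklore] -/
private theorem norm_sq_three (x : EuclideanSpace ℝ (Fin 3)) :
    ‖x‖ ^ 2 = x 0 ^ 2 + x 1 ^ 2 + x 2 ^ 2 := by
  rw [EuclideanSpace.real_norm_sq_eq, Fin.sum_univ_three]

/-- A coordinate bound: `|x i| ≤ ‖x‖`. [folklore] -/
private theorem abs_apply_le_norm (x : EuclideanSpace ℝ (Fin 3)) (i : Fin 3) : |x i| ≤ ‖x‖ := by
  have h := norm_sq_three x
  have hi : x i ^ 2 ≤ ‖x‖ ^ 2 := by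
    rw [h]
    fin_cases i <;> simp <;> nlinarith [sq_nonneg (x 0), sq_nonneg (x 1), sq_nonneg (x 2)]
  exact abs_le_of_sq_le_sq hi (norm_nonneg x)

/-- The norm is at most the `ℓ¹` sum of the coordinates. [folklore] -/
private theorem norm_le_abs_add (x : EuclideanSpace ℝ (Fin 3)) :
    ‖x‖ ≤ |x 0| + |x 1| + |x 2| := by
  have h := norm_sq_three x
  have h0 : 0 ≤ |x 0| + |x 1| + |x 2| := by positivity
  have hsq : ‖x‖ ^ 2 ≤ (|x 0| + |x 1| + |x 2|) ^ 2 := by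
    rw [h]
    nlinarith [abs_nonneg (x 0), abs_nonneg (x 1), abs_nonneg (x 2), sq_abs (x 0), sq_abs (x 1),
      sq_abs (x 2)]
  have := abs_le_of_sq_le_sq hsq h0
  rwa [abs_norm] at this

/-- Equality of explicit vectors from equality of coordinates. [folklore] -/
private theorem vec3_eq {a b c a' b' c' : ℝ} (h0 : a = a') (h1 : b = b') (h2 : c = c') :
    (!₂[a, b, c] : EuclideanSpace ℝ (Fin 3)) = !₂[a', b', c'] := by
  rw [h0, h1, h2]

/-- The norm of an explicit vector from a bound on the sum of squares. [folklore] -/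
private theorem norm_vec3_le {a b c K : ℝ} (hK : 0 ≤ K) (h : a ^ 2 + b ^ 2 + c ^ 2 ≤ K ^ 2) :
    ‖(!₂[a, b, c] : EuclideanSpace ℝ (Fin 3))‖ ≤ K := by
  have e : ‖(!₂[a, b, c] : EuclideanSpace ℝ (Fin 3))‖ ^ 2 = a ^ 2 + b ^ 2 + c ^ 2 := by
    rw [norm_sq_three]; simp
  have := abs_le_of_sq_le_sq (e ▸ h) hK
  rwa [abs_norm] at this

/-- Derivative of an explicit curve in `ℝ³` from the derivatives of its three coordinates.
[folklore] -/
private theorem hasDerivAt_vec3 {f g h : ℝ → ℝ} {f' g' h' s : ℝ} (hf : HasDerivAt f f' s)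
    (hg : HasDerivAt g g' s) (hh : HasDerivAt h h' s) :
    HasDerivAt (fun s => !₂[f s, g s, h s]) !₂[f', g', h'] s := by
  have e : (fun s => (!₂[f s, g s, h s] : EuclideanSpace ℝ (Fin 3))) = fun s =>
      f s • EuclideanSpace.single (0 : Fin 3) (1 : ℝ) + g s • EuclideanSpace.single (1 : Fin 3) (1 : ℝ)
        + h s • EuclideanSpace.single (2 : Fin 3) (1 : ℝ) := by
    funext s; ext i; fin_cases i <;> simp
  rw [e]
  refine (((hf.smul_const _).add (hg.smul_const _)).add (hh.smul_const _)).congr_deriv ?_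
  ext i; fin_cases i <;> simp

/-! ### §1 Orbital time: the normalised velocity gradient and the tuned resonant orbit -/

/-- **The normalised velocity gradient** `N_α = Ω⁻¹ A = [[0, −α, 0], [1/α, 0, 0], [0, 0, 0]]` of the
strained vortex in orbital time `s = Ωt` (`α = √((γ+ε)/(γ−ε))` Saffman's aspect ratio (12.4.7):
`(γ+ε)/Ω = α`, `(γ−ε)/Ω = 1/α`). [cite: Saffman1992, §12.4 eqs. (2), (7)] -/
def nsGrad (α : ℝ) : Matrix (Fin 3) (Fin 3) ℝ := !![0, -α, 0; α⁻¹, 0, 0; 0, 0, 0]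

/-- The normalised gradient is trace-free (incompressible base flow). [cite: Saffman1992, §12.4 eq. (2)] -/
theorem nsGrad_trace (α : ℝ) : (nsGrad α).trace = 0 := by
  simp [nsGrad, Matrix.trace_fin_three]

/-- `N_α v` in coordinates: `(−α v₁, v₀/α, 0)`. [cite: Saffman1992, §12.4 eq. (2)] -/
theorem lin_nsGrad_apply (α : ℝ) (v : EuclideanSpace ℝ (Fin 3)) :
    lin (nsGrad α) v 0 = -α * v 1 ∧ lin (nsGrad α) v 1 = α⁻¹ * v 0 ∧ lin (nsGrad α) v 2 = 0 := by
  refine ⟨?_, ?_, ?_⟩ <;> simp [lin_apply, nsGrad, Fin.sum_univ_three]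

/-- `N_αᵀ w` in coordinates: `(w₁/α, −α w₀, 0)`. [cite: Saffman1992, §12.4 eq. (4)] -/
theorem lin_nsGrad_transpose_apply (α : ℝ) (w : EuclideanSpace ℝ (Fin 3)) :
    lin (nsGrad α).transpose w 0 = α⁻¹ * w 1 ∧ lin (nsGrad α).transpose w 1 = -α * w 0 ∧
      lin (nsGrad α).transpose w 2 = 0 := by
  refine ⟨?_, ?_, ?_⟩ <;> simp [lin_apply, nsGrad, Matrix.transpose_apply, Fin.sum_univ_three]

/-- **Orbital time**: for `|ε| < γ`, `gradMatrix γ ε = Ω • nsGrad α` with `α = aspect γ ε`,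
`Ω = orbitFrequency γ ε` (Saffman (12.4.7): `αΩ = γ + ε`, `(γ − ε)α = Ω`).
[cite: Saffman1992, §12.4 eqs. (2), (7)] -/
theorem gradMatrix_eq_smul_nsGrad {γ ε : ℝ} (hε : |ε| < γ) :
    gradMatrix γ ε = orbitFrequency γ ε • nsGrad (aspect γ ε) := by
  have hα : 0 < aspect γ ε := aspect_pos hε
  have e1 : (γ - ε) * aspect γ ε = orbitFrequency γ ε := sub_mul_aspect hε
  have e2 : aspect γ ε * orbitFrequency γ ε = γ + ε := aspect_mul_orbitFrequency hε
  have e3 : orbitFrequency γ ε * (aspect γ ε)⁻¹ = γ - ε := by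
    rw [← e1]; field_simp
  ext i j
  fin_cases i <;> fin_cases j <;> simp [gradMatrix, nsGrad, Matrix.smul_apply]
  · linarith [e2, mul_comm (aspect γ ε) (orbitFrequency γ ε)]
  · rw [e3]

/-- **The tuned horizontal amplitude** `h(α) = (√3/4)(3 − α)` of the resonant orbit: `h(1) = √3/2 =
sin(π/3)` (Waleffe's critical inclination `θ_c = π/3`, Huerre–Rossi (8.103)), and to first order in
`α − 1` the tuning keeps Waleffe's resonance parameter `c` of (8.93b) equal to `1`.
[cite: GodrecheManneville1998, §8.4 eqs. (8.93), (8.103)] -/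
def tunedAmp (α : ℝ) : ℝ := Real.sqrt 3 / 4 * (3 - α)

/-- **The tuned resonant orbit** `κ_α(s) = (h(α) cos s, α h(α) sin s, 1/2)` — Saffman's orbit
(12.4.6) in orbital time (`k₀ sin θ = h(α)`, `k₀ cos θ = 1/2`), period `2π`.
[cite: Saffman1992, §12.4 eq. (6)] -/
def tunedOrbit (α s : ℝ) : EuclideanSpace ℝ (Fin 3) :=
  !₂[tunedAmp α * cos s, α * tunedAmp α * sin s, 1 / 2]

/-- Component read-out (plumbing). [folklore] -/
@[simp] private theorem tunedOrbit_apply_zero (α s : ℝ) : tunedOrbit α s 0 = tunedAmp α * cos s := by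
  simp [tunedOrbit]

/-- Component read-out (plumbing). [folklore] -/
@[simp] private theorem tunedOrbit_apply_one (α s : ℝ) : tunedOrbit α s 1 = α * tunedAmp α * sin s := by
  simp [tunedOrbit]

/-- Component read-out (plumbing). [folklore] -/
@[simp] private theorem tunedOrbit_apply_two (α s : ℝ) : tunedOrbit α s 2 = 1 / 2 := by
  simp [tunedOrbit]

/-- The tuned orbit never vanishes (its axial component is `1/2`). [cite: Saffman1992, §12.4 eq. (6)] -/
theorem tunedOrbit_ne_zero (α s : ℝ) : tunedOrbit α s ≠ 0 := by
  intro h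
  have := congrFun (congrArg (fun v : EuclideanSpace ℝ (Fin 3) => (v : Fin 3 → ℝ)) h) 2
  simp at this

/-- **The tuned orbit solves the wave-vector equation** `κ' = −N_αᵀ κ` (Saffman (12.4.4) in orbital
time; `α ≠ 0`). [cite: Saffman1992, §12.4 eqs. (4), (6)] -/
theorem hasDerivAt_tunedOrbit {α : ℝ} (hα : α ≠ 0) (s : ℝ) :
    HasDerivAt (tunedOrbit α) (-(lin (nsGrad α).transpose (tunedOrbit α s))) s := by
  have hd : HasDerivAt (tunedOrbit α)
      !₂[tunedAmp α * -sin s, α * tunedAmp α * cos s, 0] s := by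
    have h := hasDerivAt_vec3 ((hasDerivAt_cos s).const_mul (tunedAmp α))
      ((hasDerivAt_sin s).const_mul (α * tunedAmp α)) (hasDerivAt_const s (1 / 2 : ℝ))
    exact h
  refine hd.congr_deriv ?_
  obtain ⟨h0, h1, h2⟩ := lin_nsGrad_transpose_apply α (tunedOrbit α s)
  ext i
  fin_cases i
  · simp [h0]; field_simp
  · simp [h1]; ring
  · simp [h2]

/-- The tuned orbit is smooth. [cite: Saffman1992, §12.4 eq. (6)] -/
theorem contDiff_tunedOrbit (α : ℝ) : ContDiff ℝ ∞ (tunedOrbit α) := by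
  have e : tunedOrbit α = fun s => (tunedAmp α * cos s) • EuclideanSpace.single (0 : Fin 3) (1 : ℝ)
      + (α * tunedAmp α * sin s) • EuclideanSpace.single (1 : Fin 3) (1 : ℝ)
      + (1 / 2 : ℝ) • EuclideanSpace.single (2 : Fin 3) (1 : ℝ) := by
    funext s; ext i; fin_cases i <;> simp [tunedOrbit]
  rw [e]
  exact (((contDiff_const.mul contDiff_cos).smul contDiff_const).add
    ((contDiff_const.mul contDiff_sin).smul contDiff_const)).add contDiff_const

/-- The tuned orbit is continuous. [cite: Saffman1992, §12.4 eq. (6)] -/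
theorem continuous_tunedOrbit (α : ℝ) : Continuous (tunedOrbit α) :=
  (contDiff_tunedOrbit α).continuous

/-- The tuned orbit has period `2π` in orbital time. [cite: Saffman1992, §12.4 eqs. (6)–(8)] -/
theorem tunedOrbit_periodic (α : ℝ) : Function.Periodic (tunedOrbit α) (2 * π) := fun s => by
  ext i; fin_cases i <;> simp [tunedOrbit, cos_add_two_pi, sin_add_two_pi]

/-- `κ_α(2π) = κ_α(0)`. [cite: Saffman1992, §12.4 eqs. (6)–(8)] -/
theorem tunedOrbit_two_pi (α : ℝ) : tunedOrbit α (2 * π) = tunedOrbit α 0 := by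
  simpa using tunedOrbit_periodic α 0

/-- The data of the tuned orbit: `κ_α(0) = (h(α), 0, 1/2)`. [cite: Saffman1992, §12.4 eq. (6)] -/
theorem tunedOrbit_zero (α : ℝ) : tunedOrbit α 0 = !₂[tunedAmp α, 0, 1 / 2] := by
  ext i; fin_cases i <;> simp [tunedOrbit]

/-- `√3 · √3 = 3`. [folklore] -/
private theorem sqrt3_mul_self : Real.sqrt 3 * Real.sqrt 3 = 3 :=
  Real.mul_self_sqrt (by norm_num)

/-- `0 < √3`. [folklore] -/
private theorem sqrt3_pos : 0 < Real.sqrt 3 := Real.sqrt_pos.mpr (by norm_num)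

/-- `√3 < 2`. [folklore] -/
private theorem sqrt3_lt_two : Real.sqrt 3 < 2 := by
  rw [show (2 : ℝ) = Real.sqrt 4 by rw [show (4 : ℝ) = 2 ^ 2 by norm_num, Real.sqrt_sq (by norm_num)]]
  exact Real.sqrt_lt_sqrt (by norm_num) (by norm_num)

/-- **At `α = 1` the orbit is the unit vector at the resonant inclination `θ = π/3` carried round by
the rotation**: `κ₁(s) = ((√3/2) cos s, (√3/2) sin s, 1/2)`, `‖κ₁(s)‖ = 1`.
[cite: GodrecheManneville1998, §8.4 eqs. (8.68), (8.103)] -/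
theorem tunedOrbit_one (s : ℝ) :
    tunedOrbit 1 s = !₂[Real.sqrt 3 / 2 * cos s, Real.sqrt 3 / 2 * sin s, 1 / 2] := by
  have h : tunedAmp 1 = Real.sqrt 3 / 2 := by unfold tunedAmp; ring
  rw [tunedOrbit, h, one_mul]

/-- `‖κ₁(s)‖² = 1`. [cite: GodrecheManneville1998, §8.4 eq. (8.68)] -/
theorem norm_tunedOrbit_one_sq (s : ℝ) : ‖tunedOrbit 1 s‖ ^ 2 = 1 := by
  rw [norm_sq_three, tunedOrbit_one]
  simp
  linear_combination (3 / 4 : ℝ) * sin_sq_add_cos_sq s + (cos s ^ 2 / 4 + sin s ^ 2 / 4) * sqrt3_mul_self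

/-- `‖κ₁(s)‖ = 1`. [cite: GodrecheManneville1998, §8.4 eq. (8.68)] -/
theorem norm_tunedOrbit_one (s : ℝ) : ‖tunedOrbit 1 s‖ = 1 := by
  have h := norm_tunedOrbit_one_sq s
  nlinarith [norm_nonneg (tunedOrbit 1 s)]

/-! ### §2 The resonant base problem (`α = 1`): coefficient operator and explicit base solutions

At `α = 1` the base flow is solid-body rotation and the Kelvin modes are neutral inertial waves
(Huerre–Rossi (8.65)–(8.77)); at the resonant inclination `cos θ = 1/2` the wave of frequency `Ω/2`
makes the monodromy over one orbital period the identity. The three explicit solutions below are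
the inertial waves through the orthonormal frame `p₁ = (0, 1, 0)`, `p₂ = (1/2, 0, −√3/2)`,
`k̂ = κ₁(0) = (√3/2, 0, 1/2)`, written in the non-rotating frame. -/

/-- **The base coefficient operator** `C₁(s) v = 2⟪κ₁(s), J v⟫ κ₁(s) − J v` (`J = nsGrad 1` the
rotation generator; `‖κ₁‖ = 1` removes the denominator of (12.4.5)).
[cite: Saffman1992, §12.4 eq. (5)] -/
theorem ampRHS_one_eq (s : ℝ) (v : EuclideanSpace ℝ (Fin 3)) :
    ampRHS (nsGrad 1) 0 (tunedOrbit 1 s) v =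
      (2 * ⟪tunedOrbit 1 s, lin (nsGrad 1) v⟫) • tunedOrbit 1 s - lin (nsGrad 1) v := by
  rw [ampRHS, norm_tunedOrbit_one_sq, div_one, zero_mul, zero_smul, sub_zero]

/-- `J v = (−v₁, v₀, 0)` (`J = nsGrad 1`). [cite: Saffman1992, §12.4 eq. (2)] -/
theorem lin_nsGrad_one (v : EuclideanSpace ℝ (Fin 3)) :
    lin (nsGrad 1) v = !₂[-v 1, v 0, 0] := by
  obtain ⟨h0, h1, h2⟩ := lin_nsGrad_apply 1 v
  ext i; fin_cases i
  · simp [h0]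
  · simp [h1]
  · simp [h2]

/-- `⟪κ₁(s), J v⟫ = (√3/2)(−cos s · v₁ + sin s · v₀)`. [cite: Saffman1992, §12.4 eq. (5)] -/
theorem inner_tunedOrbit_one_lin (s : ℝ) (v : EuclideanSpace ℝ (Fin 3)) :
    ⟪tunedOrbit 1 s, lin (nsGrad 1) v⟫ = Real.sqrt 3 / 2 * (-(cos s * v 1) + sin s * v 0) := by
  rw [inner_three, lin_nsGrad_one, tunedOrbit_one]
  simp
  ring

/-- The base coefficient operator in coordinates. [cite: Saffman1992, §12.4 eq. (5)] -/
theorem ampRHS_one_apply (s : ℝ) (v : EuclideanSpace ℝ (Fin 3)) :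
    ampRHS (nsGrad 1) 0 (tunedOrbit 1 s) v =
      !₂[2 * (Real.sqrt 3 / 2 * (-(cos s * v 1) + sin s * v 0)) * (Real.sqrt 3 / 2 * cos s) + v 1,
        2 * (Real.sqrt 3 / 2 * (-(cos s * v 1) + sin s * v 0)) * (Real.sqrt 3 / 2 * sin s) - v 0,
        2 * (Real.sqrt 3 / 2 * (-(cos s * v 1) + sin s * v 0)) * (1 / 2)] := by
  rw [ampRHS_one_eq, inner_tunedOrbit_one_lin, tunedOrbit_one, lin_nsGrad_one]
  ext i; fin_cases i <;> simp

/-- A bound on the base coefficient operator: `‖C₁(s) v‖ ≤ 3‖v‖`. [cite: Saffman1992, §12.4 eq. (5)] -/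
theorem norm_ampRHS_one_le (s : ℝ) (v : EuclideanSpace ℝ (Fin 3)) :
    ‖ampRHS (nsGrad 1) 0 (tunedOrbit 1 s) v‖ ≤ 3 * ‖v‖ := by
  rw [ampRHS_one_eq]
  have hJ : ‖lin (nsGrad 1) v‖ ≤ ‖v‖ := by
    have h2 := norm_sq_three v
    rw [lin_nsGrad_one]
    exact norm_vec3_le (norm_nonneg v) (by rw [h2]; nlinarith [sq_nonneg (v 2)])
  have hin : |⟪tunedOrbit 1 s, lin (nsGrad 1) v⟫| ≤ ‖v‖ :=
    (abs_real_inner_le_norm _ _).trans (by rw [norm_tunedOrbit_one, one_mul]; exact hJ)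
  calc ‖(2 * ⟪tunedOrbit 1 s, lin (nsGrad 1) v⟫) • tunedOrbit 1 s - lin (nsGrad 1) v‖
      ≤ ‖(2 * ⟪tunedOrbit 1 s, lin (nsGrad 1) v⟫) • tunedOrbit 1 s‖ + ‖lin (nsGrad 1) v‖ :=
        norm_sub_le _ _
    _ ≤ 2 * ‖v‖ + ‖v‖ := by
        rw [norm_smul, norm_tunedOrbit_one, mul_one, Real.norm_eq_abs, abs_mul,
          abs_of_pos (by norm_num : (0:ℝ) < 2)]
        exact add_le_add (by linarith) hJ
    _ = 3 * ‖v‖ := by ring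

/-- **Base solution through `p₁ = (0, 1, 0)`** (the inertial wave at the resonant inclination, in the
non-rotating frame). [cite: GodrecheManneville1998, §8.4 eqs. (8.70), (8.77), (8.103)] -/
def baseSol₁ (s : ℝ) : EuclideanSpace ℝ (Fin 3) :=
  !₂[-(1 / 2) * (sin s * cos s), 1 / 2 * sin s ^ 2 + cos s ^ 2, -(Real.sqrt 3 / 2) * sin s]

/-- **Base solution through `p₂ = (1/2, 0, −√3/2)`**. [cite: GodrecheManneville1998, §8.4 eqs. (8.70),
(8.77), (8.103)] -/
def baseSol₂ (s : ℝ) : EuclideanSpace ℝ (Fin 3) :=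
  !₂[1 / 2 * cos s ^ 2 + sin s ^ 2, -(1 / 2) * (sin s * cos s), -(Real.sqrt 3 / 2) * cos s]

/-- **Base solution through `k̂ = (√3/2, 0, 1/2)`**. [cite: GodrecheManneville1998, §8.4 eqs. (8.70),
(8.77), (8.103)] -/
def baseSol₃ (s : ℝ) : EuclideanSpace ℝ (Fin 3) :=
  !₂[Real.sqrt 3 / 2 * cos s ^ 2 + Real.sqrt 3 * sin s ^ 2, -(Real.sqrt 3 / 2) * (sin s * cos s),
    2 - 3 / 2 * cos s]

/-- Component read-out (plumbing). [folklore] -/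
@[simp] private theorem baseSol₁_apply_zero (s : ℝ) : baseSol₁ s 0 = -(1 / 2) * (sin s * cos s) := by
  simp [baseSol₁]
/-- Component read-out (plumbing). [folklore] -/
@[simp] private theorem baseSol₁_apply_one (s : ℝ) : baseSol₁ s 1 = 1 / 2 * sin s ^ 2 + cos s ^ 2 := by
  simp [baseSol₁]
/-- Component read-out (plumbing). [folklore] -/
@[simp] private theorem baseSol₁_apply_two (s : ℝ) : baseSol₁ s 2 = -(Real.sqrt 3 / 2) * sin s := by
  simp [baseSol₁]
/-- Component read-out (plumbing). [folklore] -/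
@[simp] private theorem baseSol₂_apply_zero (s : ℝ) : baseSol₂ s 0 = 1 / 2 * cos s ^ 2 + sin s ^ 2 := by
  simp [baseSol₂]
/-- Component read-out (plumbing). [folklore] -/
@[simp] private theorem baseSol₂_apply_one (s : ℝ) : baseSol₂ s 1 = -(1 / 2) * (sin s * cos s) := by
  simp [baseSol₂]
/-- Component read-out (plumbing). [folklore] -/
@[simp] private theorem baseSol₂_apply_two (s : ℝ) : baseSol₂ s 2 = -(Real.sqrt 3 / 2) * cos s := by
  simp [baseSol₂]
/-- Component read-out (plumbing). [folklore] -/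
@[simp] private theorem baseSol₃_apply_zero (s : ℝ) :
    baseSol₃ s 0 = Real.sqrt 3 / 2 * cos s ^ 2 + Real.sqrt 3 * sin s ^ 2 := by
  simp [baseSol₃]
/-- Component read-out (plumbing). [folklore] -/
@[simp] private theorem baseSol₃_apply_one (s : ℝ) :
    baseSol₃ s 1 = -(Real.sqrt 3 / 2) * (sin s * cos s) := by
  simp [baseSol₃]
/-- Component read-out (plumbing). [folklore] -/
@[simp] private theorem baseSol₃_apply_two (s : ℝ) : baseSol₃ s 2 = 2 - 3 / 2 * cos s := by
  simp [baseSol₃]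

/-- `x₁` solves the base system `x' = C₁(s) x`. [cite: GodrecheManneville1998, §8.4 eqs. (8.70)–(8.77)] -/
theorem hasDerivAt_baseSol₁ (s : ℝ) :
    HasDerivAt baseSol₁ (ampRHS (nsGrad 1) 0 (tunedOrbit 1 s) (baseSol₁ s)) s := by
  have hd : HasDerivAt baseSol₁ _ s :=
    hasDerivAt_vec3 (((hasDerivAt_sin s).mul (hasDerivAt_cos s)).const_mul (-(1 / 2 : ℝ)))
      ((((hasDerivAt_sin s).pow 2).const_mul (1 / 2 : ℝ)).add ((hasDerivAt_cos s).pow 2))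
      ((hasDerivAt_sin s).const_mul (-(Real.sqrt 3 / 2)))
  refine hd.congr_deriv ?_
  rw [ampRHS_one_apply]
  have h1 := sin_sq_add_cos_sq s
  have h3 := sqrt3_mul_self
  ext i; fin_cases i <;> simp
  · linear_combination (cos s ^ 2 * Real.sqrt 3 ^ 2 / 2) * h1 + (cos s ^ 2 / 2) * h3
  · linear_combination (cos s * Real.sqrt 3 ^ 2 * sin s / 2) * h1 + (cos s * sin s / 2) * h3
  · linear_combination (cos s * Real.sqrt 3 / 2) * h1

/-- `x₂` solves the base system. [cite: GodrecheManneville1998, §8.4 eqs. (8.70)–(8.77)] -/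
theorem hasDerivAt_baseSol₂ (s : ℝ) :
    HasDerivAt baseSol₂ (ampRHS (nsGrad 1) 0 (tunedOrbit 1 s) (baseSol₂ s)) s := by
  have hd : HasDerivAt baseSol₂ _ s :=
    hasDerivAt_vec3 ((((hasDerivAt_cos s).pow 2).const_mul (1 / 2 : ℝ)).add ((hasDerivAt_sin s).pow 2))
      (((hasDerivAt_sin s).mul (hasDerivAt_cos s)).const_mul (-(1 / 2 : ℝ)))
      ((hasDerivAt_cos s).const_mul (-(Real.sqrt 3 / 2)))
  refine hd.congr_deriv ?_
  rw [ampRHS_one_apply]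
  have h1 := sin_sq_add_cos_sq s
  have h3 := sqrt3_mul_self
  ext i; fin_cases i <;> simp
  · linear_combination (-(cos s * Real.sqrt 3 ^ 2 * sin s / 2)) * h1 + (-(cos s * sin s / 2)) * h3
  · linear_combination (-(Real.sqrt 3 ^ 2 * sin s ^ 2 / 2) - Real.sqrt 3 ^ 2 / 2 + 3 / 2) * h1
      + (cos s ^ 2 / 2 - 1 / 2) * h3
  · linear_combination (-(Real.sqrt 3 * sin s / 2)) * h1

/-- `x₃` solves the base system. [cite: GodrecheManneville1998, §8.4 eqs. (8.70)–(8.77)] -/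
theorem hasDerivAt_baseSol₃ (s : ℝ) :
    HasDerivAt baseSol₃ (ampRHS (nsGrad 1) 0 (tunedOrbit 1 s) (baseSol₃ s)) s := by
  have hd : HasDerivAt baseSol₃ _ s :=
    hasDerivAt_vec3 ((((hasDerivAt_cos s).pow 2).const_mul (Real.sqrt 3 / 2)).add
        (((hasDerivAt_sin s).pow 2).const_mul (Real.sqrt 3)))
      (((hasDerivAt_sin s).mul (hasDerivAt_cos s)).const_mul (-(Real.sqrt 3 / 2)))
      (((hasDerivAt_cos s).const_mul (3 / 2 : ℝ)).const_sub 2)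
  refine hd.congr_deriv ?_
  rw [ampRHS_one_apply]
  have h1 := sin_sq_add_cos_sq s
  have h3 := sqrt3_mul_self
  ext i; fin_cases i <;> simp
  · linear_combination (-(cos s * Real.sqrt 3 ^ 3 * sin s / 2)) * h1
      + (-(cos s * Real.sqrt 3 * sin s / 2)) * h3
  · linear_combination (-(Real.sqrt 3 ^ 3 * sin s ^ 2 / 2) - Real.sqrt 3 ^ 3 / 2
      + 3 * Real.sqrt 3 / 2) * h1 + (cos s ^ 2 * Real.sqrt 3 / 2 - Real.sqrt 3 / 2) * h3
  · linear_combination (-(Real.sqrt 3 ^ 2 * sin s / 2)) * h1 + (-(sin s / 2)) * h3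

/-- The base solutions start at the frame: `x₁(0) = p₁`, `x₂(0) = p₂`, `x₃(0) = k̂`, and return to it
after one period (the base monodromy is the identity). [cite: GodrecheManneville1998, §8.4 eqs.
(8.101)–(8.103)] -/
theorem baseSol_zero_two_pi :
    baseSol₁ 0 = !₂[0, 1, 0] ∧ baseSol₁ (2 * π) = !₂[0, 1, 0] ∧
    baseSol₂ 0 = !₂[1 / 2, 0, -(Real.sqrt 3 / 2)] ∧ baseSol₂ (2 * π) = !₂[1 / 2, 0, -(Real.sqrt 3 / 2)] ∧
    baseSol₃ 0 = !₂[Real.sqrt 3 / 2, 0, 1 / 2] ∧ baseSol₃ (2 * π) = !₂[Real.sqrt 3 / 2, 0, 1 / 2] := by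
  refine ⟨?_, ?_, ?_, ?_, ?_, ?_⟩ <;> ext i <;> fin_cases i <;> simp [baseSol₁, baseSol₂, baseSol₃]
    <;> norm_num

/-- Sup bounds: `‖x₁(s)‖ = ‖x₂(s)‖ = 1`, `‖x₃(s)‖ ≤ 4`. [cite: GodrecheManneville1998, §8.4 eq. (8.70)] -/
theorem norm_baseSol_le (s : ℝ) : ‖baseSol₁ s‖ ≤ 1 ∧ ‖baseSol₂ s‖ ≤ 1 ∧ ‖baseSol₃ s‖ ≤ 4 := by
  have h1 := sin_sq_add_cos_sq s
  have h3 := sqrt3_mul_self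
  have hc := cos_le_one s
  have hc' := neg_one_le_cos s
  have e1 : ‖baseSol₁ s‖ ^ 2 = 1 := by
    rw [norm_sq_three]; simp
    linear_combination (cos s ^ 2 + Real.sqrt 3 ^ 2 / 4 + sin s ^ 2 / 4 + 1 / 4) * h1
      + (1 / 4 - cos s ^ 2 / 4) * h3
  have e2 : ‖baseSol₂ s‖ ^ 2 = 1 := by
    rw [norm_sq_three]; simp
    linear_combination (cos s ^ 2 / 4 + sin s ^ 2 + 1) * h1 + (cos s ^ 2 / 4) * h3
  have e3 : ‖baseSol₃ s‖ ^ 2 = 7 - 6 * cos s := by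
    rw [norm_sq_three]; simp
    linear_combination (cos s ^ 2 * Real.sqrt 3 ^ 2 / 4 + Real.sqrt 3 ^ 2 * sin s ^ 2
      + Real.sqrt 3 ^ 2) * h1 + (1 - 3 * cos s ^ 2 / 4) * h3
  have n1 := norm_nonneg (baseSol₁ s)
  have n2 := norm_nonneg (baseSol₂ s)
  have n3 := norm_nonneg (baseSol₃ s)
  refine ⟨by nlinarith, by nlinarith, by nlinarith⟩

/-! ### §3 The adjoint base problem: explicit solutions through `p₁`, `p₂` -/

/-- **Adjoint base solution through `p₁`**: `ψ₁(s) = (sin s cos s, 1 + sin² s, 0)`; it satisfies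
`ψ₁' = −C₁(s)ᵀ ψ₁` and `ψ₁(0) = ψ₁(2π) = p₁`. [cite: Chicone2006, §2.4 (adjoint system /
fundamental matrix inverse transpose)] -/
def adjSol₁ (s : ℝ) : EuclideanSpace ℝ (Fin 3) := !₂[sin s * cos s, 1 + sin s ^ 2, 0]

/-- **Adjoint base solution through `p₂`**: `ψ₂(s) = (1 + cos² s − (3/2) cos s, sin s cos s −
(3/2) sin s, −√3/2)`. [cite: Chicone2006, §2.4] -/
def adjSol₂ (s : ℝ) : EuclideanSpace ℝ (Fin 3) :=
  !₂[1 + cos s ^ 2 - 3 / 2 * cos s, sin s * cos s - 3 / 2 * sin s, -(Real.sqrt 3 / 2)]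

/-- Component read-out (plumbing). [folklore] -/
@[simp] private theorem adjSol₁_apply_zero (s : ℝ) : adjSol₁ s 0 = sin s * cos s := by simp [adjSol₁]
/-- Component read-out (plumbing). [folklore] -/
@[simp] private theorem adjSol₁_apply_one (s : ℝ) : adjSol₁ s 1 = 1 + sin s ^ 2 := by simp [adjSol₁]
/-- Component read-out (plumbing). [folklore] -/
@[simp] private theorem adjSol₁_apply_two (s : ℝ) : adjSol₁ s 2 = 0 := by simp [adjSol₁]
/-- Component read-out (plumbing). [folklore] -/
@[simp] private theorem adjSol₂_apply_zero (s : ℝ) : adjSol₂ s 0 = 1 + cos s ^ 2 - 3 / 2 * cos s := by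
  simp [adjSol₂]
/-- Component read-out (plumbing). [folklore] -/
@[simp] private theorem adjSol₂_apply_one (s : ℝ) : adjSol₂ s 1 = sin s * cos s - 3 / 2 * sin s := by
  simp [adjSol₂]
/-- Component read-out (plumbing). [folklore] -/
@[simp] private theorem adjSol₂_apply_two (s : ℝ) : adjSol₂ s 2 = -(Real.sqrt 3 / 2) := by simp [adjSol₂]

/-- The derivative of `ψ₁`. [cite: Chicone2006, §2.4] -/
theorem hasDerivAt_adjSol₁ (s : ℝ) :
    HasDerivAt adjSol₁ !₂[cos s * cos s + sin s * -sin s, 2 * sin s * cos s, 0] s := by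
  have hd : HasDerivAt adjSol₁ _ s :=
    hasDerivAt_vec3 ((hasDerivAt_sin s).mul (hasDerivAt_cos s))
      (((hasDerivAt_sin s).pow 2).const_add 1) (hasDerivAt_const s (0 : ℝ))
  refine hd.congr_deriv ?_
  ext i; fin_cases i <;> simp

/-- The derivative of `ψ₂`. [cite: Chicone2006, §2.4] -/
theorem hasDerivAt_adjSol₂ (s : ℝ) :
    HasDerivAt adjSol₂ !₂[2 * cos s * -sin s - 3 / 2 * -sin s,
      cos s * cos s + sin s * -sin s - 3 / 2 * cos s, 0] s := by
  have hd : HasDerivAt adjSol₂ _ s :=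
    hasDerivAt_vec3 ((((hasDerivAt_cos s).pow 2).const_add 1).sub
        ((hasDerivAt_cos s).const_mul (3 / 2 : ℝ)))
      (((hasDerivAt_sin s).mul (hasDerivAt_cos s)).sub ((hasDerivAt_sin s).const_mul (3 / 2 : ℝ)))
      (hasDerivAt_const s (-(Real.sqrt 3 / 2)))
  refine hd.congr_deriv ?_
  ext i; fin_cases i <;> simp

/-- **`ψ₁` solves the adjoint base system**: `⟪ψ₁'(s), v⟫ + ⟪ψ₁(s), C₁(s) v⟫ = 0` for every `v`.
[cite: Chicone2006, §2.4] -/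
theorem adjSol₁_adjoint (s : ℝ) (v : EuclideanSpace ℝ (Fin 3)) :
    ⟪(!₂[cos s * cos s + sin s * -sin s, 2 * sin s * cos s, 0] : EuclideanSpace ℝ (Fin 3)), v⟫ +
      ⟪adjSol₁ s, ampRHS (nsGrad 1) 0 (tunedOrbit 1 s) v⟫ = 0 := by
  rw [ampRHS_one_apply, inner_three, inner_three]
  have h1 := sin_sq_add_cos_sq s
  have h3 := sqrt3_mul_self
  simp
  linear_combination (-(cos s * Real.sqrt 3 ^ 2 * sin s * v 1 / 2) + Real.sqrt 3 ^ 2 * sin s ^ 2 *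
    v 0 / 2 + Real.sqrt 3 ^ 2 * v 0 - 2 * v 0) * h1 + (-(cos s ^ 2 * v 0) - cos s * sin s * v 1 +
    v 0) * h3

/-- **`ψ₂` solves the adjoint base system.** [cite: Chicone2006, §2.4] -/
theorem adjSol₂_adjoint (s : ℝ) (v : EuclideanSpace ℝ (Fin 3)) :
    ⟪(!₂[2 * cos s * -sin s - 3 / 2 * -sin s, cos s * cos s + sin s * -sin s - 3 / 2 * cos s, 0] :
        EuclideanSpace ℝ (Fin 3)), v⟫ + ⟪adjSol₂ s, ampRHS (nsGrad 1) 0 (tunedOrbit 1 s) v⟫ = 0 := by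
  rw [ampRHS_one_apply, inner_three, inner_three]
  have h1 := sin_sq_add_cos_sq s
  have h3 := sqrt3_mul_self
  simp
  linear_combination (-(cos s ^ 2 * Real.sqrt 3 ^ 2 * v 1 / 2) + cos s * Real.sqrt 3 ^ 2 * sin s *
    v 0 / 2 + 3 * cos s * Real.sqrt 3 ^ 2 * v 1 / 4 - 3 * Real.sqrt 3 ^ 2 * sin s * v 0 / 4 - v 1) * h1
    + (-(cos s ^ 2 * v 1) + cos s * sin s * v 0 + cos s * v 1 - sin s * v 0) * h3

/-- Values and bounds of the adjoint solutions: `ψ_a(0) = ψ_a(2π) = p_a`, `‖ψ₁‖ ≤ 2`, `‖ψ₂‖ ≤ 4`.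
[cite: Chicone2006, §2.4] -/
theorem adjSol_zero_two_pi :
    adjSol₁ 0 = !₂[0, 1, 0] ∧ adjSol₁ (2 * π) = !₂[0, 1, 0] ∧
    adjSol₂ 0 = !₂[1 / 2, 0, -(Real.sqrt 3 / 2)] ∧ adjSol₂ (2 * π) = !₂[1 / 2, 0, -(Real.sqrt 3 / 2)] := by
  refine ⟨?_, ?_, ?_, ?_⟩ <;> ext i <;> fin_cases i <;> simp [adjSol₁, adjSol₂] <;> norm_num

/-- Sup bounds for the adjoint solutions. [cite: Chicone2006, §2.4] -/
theorem norm_adjSol_le (s : ℝ) : ‖adjSol₁ s‖ ≤ 2 ∧ ‖adjSol₂ s‖ ≤ 4 := by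
  have h1 := sin_sq_add_cos_sq s
  have h3 := sqrt3_mul_self
  have hc := cos_le_one s
  have hc' := neg_one_le_cos s
  have hs := sin_sq_le_one s
  have e1 : ‖adjSol₁ s‖ ^ 2 = 1 + 3 * sin s ^ 2 := by
    rw [norm_sq_three]; simp
    linear_combination (sin s ^ 2) * h1
  have e2 : ‖adjSol₂ s‖ ^ 2 = 7 - 6 * cos s - 3 * sin s ^ 2 := by
    rw [norm_sq_three]; simp
    linear_combination (cos s ^ 2 - 3 * cos s + 21 / 4) * h1 + (1 / 4) * h3
  have n1 := norm_nonneg (adjSol₁ s)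
  have n2 := norm_nonneg (adjSol₂ s)
  refine ⟨by nlinarith [sq_nonneg (sin s)], by nlinarith [sq_nonneg (sin s)]⟩

/-! ### §4 The first-order coefficient operator `D(s) = ∂_α C_α(s)|_{α=1}` -/

/-- `N' = ∂_α N_α` at `α = 1`: the strain direction `[[0, −1, 0], [−1, 0, 0], [0, 0, 0]]`.
[cite: Saffman1992, §12.4 eqs. (2), (7)] -/
def nsGradDeriv : Matrix (Fin 3) (Fin 3) ℝ := !![0, -1, 0; -1, 0, 0; 0, 0, 0]

/-- `N' v = (−v₁, −v₀, 0)`. [cite: Saffman1992, §12.4 eq. (2)] -/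
theorem lin_nsGradDeriv (v : EuclideanSpace ℝ (Fin 3)) : lin nsGradDeriv v = !₂[-v 1, -v 0, 0] := by
  ext i; fin_cases i <;> simp [lin_apply, nsGradDeriv, Fin.sum_univ_three]

/-- `κ' = ∂_α κ_α` at `α = 1`: `κ'(s) = (√3/4)(−cos s, sin s, 0)` (the first-order deformation AND
tilt of the tuned orbit). [cite: Saffman1992, §12.4 eq. (6)] -/
def tunedOrbitDeriv (s : ℝ) : EuclideanSpace ℝ (Fin 3) :=
  !₂[-(Real.sqrt 3 / 4) * cos s, Real.sqrt 3 / 4 * sin s, 0]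

/-- `κ'' `: the exact second-order coefficient, `κ_α = κ₁ + (α−1)κ' + (α−1)²κ''`,
`κ''(s) = (0, −(√3/4) sin s, 0)`. [cite: Saffman1992, §12.4 eq. (6)] -/
def tunedOrbitDeriv₂ (s : ℝ) : EuclideanSpace ℝ (Fin 3) := !₂[0, -(Real.sqrt 3 / 4) * sin s, 0]

/-- Component read-out (plumbing). [folklore] -/
@[simp] private theorem tunedOrbitDeriv_apply_zero (s : ℝ) :
    tunedOrbitDeriv s 0 = -(Real.sqrt 3 / 4) * cos s := by simp [tunedOrbitDeriv]
/-- Component read-out (plumbing). [folklore] -/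
@[simp] private theorem tunedOrbitDeriv_apply_one (s : ℝ) :
    tunedOrbitDeriv s 1 = Real.sqrt 3 / 4 * sin s := by simp [tunedOrbitDeriv]
/-- Component read-out (plumbing). [folklore] -/
@[simp] private theorem tunedOrbitDeriv_apply_two (s : ℝ) : tunedOrbitDeriv s 2 = 0 := by
  simp [tunedOrbitDeriv]

/-- **Exact expansion of the tuned orbit in `η = α − 1`**: `κ_α = κ₁ + η κ' + η² κ''`.
[cite: Saffman1992, §12.4 eq. (6)] -/
theorem tunedOrbit_expand (α s : ℝ) :
    tunedOrbit α s = tunedOrbit 1 s + (α - 1) • tunedOrbitDeriv s + (α - 1) ^ 2 • tunedOrbitDeriv₂ s := by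
  rw [tunedOrbit_one]
  ext i; fin_cases i <;> simp [tunedOrbit, tunedAmp, tunedOrbitDeriv, tunedOrbitDeriv₂] <;> ring

/-- **Exact expansion of the normalised gradient in `η = α − 1`**:
`N_α v = J v + η N' v + (0, (η²/α) v₀, 0)` (`α ≠ 0`). [cite: Saffman1992, §12.4 eqs. (2), (7)] -/
theorem lin_nsGrad_expand {α : ℝ} (hα : α ≠ 0) (v : EuclideanSpace ℝ (Fin 3)) :
    lin (nsGrad α) v = lin (nsGrad 1) v + (α - 1) • lin nsGradDeriv v +
      !₂[0, (α - 1) ^ 2 / α * v 0, 0] := by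
  obtain ⟨h0, h1, h2⟩ := lin_nsGrad_apply α v
  rw [lin_nsGrad_one, lin_nsGradDeriv]
  ext i; fin_cases i
  · simp [h0]; ring
  · simp [h1]; field_simp; ring
  · simp [h2]

/-- **The first-order coefficient operator** `D(s) v = ∂_α|_{α=1} [ampRHS (nsGrad α) 0 (κ_α s) v]`:
`D v = −N'v + 2[⟪κ', Jv⟫ + ⟪κ₁, N'v⟫ − 2⟪κ₁, κ'⟫⟪κ₁, Jv⟫] κ₁ + 2⟪κ₁, Jv⟫ κ'` (product rule on
`(2⟪κ, Nv⟫/|κ|²) κ − Nv` at `|κ₁| = 1`). [cite: Saffman1992, §12.4 eq. (5)] -/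
def firstOrderOp (s : ℝ) (v : EuclideanSpace ℝ (Fin 3)) : EuclideanSpace ℝ (Fin 3) :=
  -lin nsGradDeriv v +
    (2 * (⟪tunedOrbitDeriv s, lin (nsGrad 1) v⟫ + ⟪tunedOrbit 1 s, lin nsGradDeriv v⟫ -
      2 * ⟪tunedOrbit 1 s, tunedOrbitDeriv s⟫ * ⟪tunedOrbit 1 s, lin (nsGrad 1) v⟫)) • tunedOrbit 1 s +
    (2 * ⟪tunedOrbit 1 s, lin (nsGrad 1) v⟫) • tunedOrbitDeriv s

/-- `⟪κ₁, κ'⟫ = −(3/8)(cos² s − sin² s)` (half the first-order variation of `|κ_α|²`).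
[cite: Saffman1992, §12.4 eq. (6)] -/
theorem inner_tunedOrbit_one_deriv (s : ℝ) :
    ⟪tunedOrbit 1 s, tunedOrbitDeriv s⟫ = -(3 / 8) * (cos s ^ 2 - sin s ^ 2) := by
  rw [inner_three, tunedOrbit_one]
  have h3 := sqrt3_mul_self
  have h1 := sin_sq_add_cos_sq s
  simp
  linear_combination (Real.sqrt 3 ^ 2 / 8 - 3 / 8) * h1 + (1 / 8 - cos s ^ 2 / 4) * h3

/-- `⟪κ', J v⟫` in coordinates. [cite: Saffman1992, §12.4 eq. (5)] -/
theorem inner_tunedOrbitDeriv_lin (s : ℝ) (v : EuclideanSpace ℝ (Fin 3)) :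
    ⟪tunedOrbitDeriv s, lin (nsGrad 1) v⟫ = Real.sqrt 3 / 4 * (cos s * v 1 + sin s * v 0) := by
  rw [inner_three, lin_nsGrad_one]
  simp
  ring

/-- `⟪κ₁, N' v⟫` in coordinates. [cite: Saffman1992, §12.4 eq. (5)] -/
theorem inner_tunedOrbit_one_linDeriv (s : ℝ) (v : EuclideanSpace ℝ (Fin 3)) :
    ⟪tunedOrbit 1 s, lin nsGradDeriv v⟫ = -(Real.sqrt 3 / 2) * (cos s * v 1 + sin s * v 0) := by
  rw [inner_three, lin_nsGradDeriv, tunedOrbit_one]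
  simp
  ring

/-- **The first-order operator in coordinates** (all `√3·√3` reduced):
`D v = ( −(9/4)c⁴v₁ + (9/4)c³s v₀ + (9/8)c²v₁ − (21/8)cs v₀ + v₁,`
`       −(9/4)c⁴v₀ − (9/4)c³s v₁ + (27/8)c²v₀ − (3/8)cs v₁ − v₀/8,`
`       √3 (−(3/4)c³v₁ + (3/4)c²s v₀ + (1/8)c v₁ − (5/8)s v₀) )` with `c = cos s`, `s = sin s`.
[cite: Saffman1992, §12.4 eq. (5)] -/
theorem firstOrderOp_apply (s : ℝ) (v : EuclideanSpace ℝ (Fin 3)) :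
    firstOrderOp s v =
      !₂[-(9 / 4) * cos s ^ 4 * v 1 + 9 / 4 * cos s ^ 3 * sin s * v 0 + 9 / 8 * cos s ^ 2 * v 1 -
          21 / 8 * cos s * sin s * v 0 + v 1,
        -(9 / 4) * cos s ^ 4 * v 0 - 9 / 4 * cos s ^ 3 * sin s * v 1 + 27 / 8 * cos s ^ 2 * v 0 -
          3 / 8 * cos s * sin s * v 1 - v 0 / 8,
        Real.sqrt 3 * (-(3 / 4) * cos s ^ 3 * v 1 + 3 / 4 * cos s ^ 2 * sin s * v 0 +
          1 / 8 * cos s * v 1 - 5 / 8 * sin s * v 0)] := by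
  rw [firstOrderOp, inner_tunedOrbit_one_deriv, inner_tunedOrbitDeriv_lin,
    inner_tunedOrbit_one_linDeriv, inner_tunedOrbit_one_lin, lin_nsGradDeriv, tunedOrbit_one]
  have h1 := sin_sq_add_cos_sq s
  have h3 := sqrt3_mul_self
  ext i; fin_cases i <;> simp [tunedOrbitDeriv]
  · linear_combination (cos s ^ 2 * Real.sqrt 3 ^ 4 * v 1 / 8 - cos s * Real.sqrt 3 ^ 4 * sin s *
      v 0 / 8) * h1 + (-(cos s ^ 4 * Real.sqrt 3 ^ 2 * v 1 / 4) - 3 * cos s ^ 4 * v 1 / 4 + cos s ^ 3 *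
      Real.sqrt 3 ^ 2 * sin s * v 0 / 4 + 3 * cos s ^ 3 * sin s * v 0 / 4 + cos s ^ 2 * Real.sqrt 3 ^ 2
      * v 1 / 8 + 3 * cos s ^ 2 * v 1 / 8 - cos s * Real.sqrt 3 ^ 2 * sin s * v 0 / 8 - 7 * cos s *
      sin s * v 0 / 8 + Real.sqrt 3 ^ 2 / 8 * (v 1 * cos s ^ 4 - v 1 * cos s ^ 2 * sin s ^ 2 -
      v 0 * cos s ^ 3 * sin s + v 0 * cos s * sin s ^ 3)) * h3
  · linear_combination (cos s ^ 2 * Real.sqrt 3 ^ 4 * v 0 / 4 + cos s * Real.sqrt 3 ^ 4 * sin s * v 1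
      / 8 - Real.sqrt 3 ^ 4 * sin s ^ 2 * v 0 / 8 - Real.sqrt 3 ^ 4 * v 0 / 8) * h1 + (-(cos s ^ 4 *
      Real.sqrt 3 ^ 2 * v 0 / 4) - 3 * cos s ^ 4 * v 0 / 4 - cos s ^ 3 * Real.sqrt 3 ^ 2 * sin s * v 1
      / 4 - 3 * cos s ^ 3 * sin s * v 1 / 4 + 3 * cos s ^ 2 * Real.sqrt 3 ^ 2 * v 0 / 8 + 9 * cos s ^ 2
      * v 0 / 8 + cos s * Real.sqrt 3 ^ 2 * sin s * v 1 / 8 - cos s * sin s * v 1 / 8 - Real.sqrt 3 ^ 2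
      * v 0 / 8 - 3 * v 0 / 8 + Real.sqrt 3 ^ 2 / 8 * (-(v 0 * cos s ^ 2 * sin s ^ 2) + v 0 * sin s ^ 4
      - cos s * v 1 * sin s ^ 3 + cos s ^ 3 * v 1 * sin s)) * h3
  · linear_combination (cos s * Real.sqrt 3 ^ 3 * v 1 / 8 - Real.sqrt 3 ^ 3 * sin s * v 0 / 8) * h1 +
      (-(cos s ^ 3 * Real.sqrt 3 * v 1 / 4) + cos s ^ 2 * Real.sqrt 3 * sin s * v 0 / 4 + cos s *
      Real.sqrt 3 * v 1 / 8 - Real.sqrt 3 * sin s * v 0 / 8 + Real.sqrt 3 / 8 * (-(cos s * v 1 *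
      sin s ^ 2) - cos s ^ 2 * sin s * v 0 + cos s ^ 3 * v 1 + sin s ^ 3 * v 0)) * h3

/-! ### §5 Expansion of the coefficient operator to first order in `η = α − 1`, with remainders -/

section Expansion

variable {E : Type*} [NormedAddCommGroup E] [InnerProductSpace ℝ E]

/-- **First-order expansion of an inner product** (bilinear bookkeeping). [folklore] -/
private theorem inner_expand {w w₀ w₁ n n₀ n₁ : E} {η W₀ W₁ W₂ N N₁ N₂ : ℝ} (hη : 0 ≤ η) (hη1 : η ≤ 1)
    (hw : ‖w - w₀ - η • w₁‖ ≤ W₂ * η ^ 2) (hn : ‖n - n₀ - η • n₁‖ ≤ N₂ * η ^ 2)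
    (hW₀ : ‖w₀‖ ≤ W₀) (hW₁ : ‖w₁‖ ≤ W₁) (hN : ‖n‖ ≤ N) (hN₁ : ‖n₁‖ ≤ N₁) :
    |⟪w, n⟫ - ⟪w₀, n₀⟫ - η * (⟪w₁, n₀⟫ + ⟪w₀, n₁⟫)| ≤ (W₂ * N + (W₀ + W₁) * N₂ + W₁ * N₁) * η ^ 2 := by
  have e : ⟪w, n⟫ - ⟪w₀, n₀⟫ - η * (⟪w₁, n₀⟫ + ⟪w₀, n₁⟫) =
      ⟪w - w₀ - η • w₁, n⟫ + ⟪w₀ + η • w₁, n - n₀ - η • n₁⟫ + η ^ 2 * ⟪w₁, n₁⟫ := by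
    simp only [inner_sub_left, inner_sub_right, inner_add_left, inner_smul_left, inner_smul_right,
      RCLike.conj_to_real]
    ring
  rw [e]
  have hW₀' : 0 ≤ W₀ := (norm_nonneg _).trans hW₀
  have hW₁' : 0 ≤ W₁ := (norm_nonneg _).trans hW₁
  have hN' : 0 ≤ N := (norm_nonneg _).trans hN
  have hN₁' : 0 ≤ N₁ := (norm_nonneg _).trans hN₁
  have h1 : |⟪w - w₀ - η • w₁, n⟫| ≤ W₂ * η ^ 2 * N :=
    (abs_real_inner_le_norm _ _).trans (mul_le_mul hw hN (norm_nonneg _)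
      ((norm_nonneg _).trans hw))
  have h2 : |⟪w₀ + η • w₁, n - n₀ - η • n₁⟫| ≤ (W₀ + W₁) * (N₂ * η ^ 2) := by
    refine (abs_real_inner_le_norm _ _).trans (mul_le_mul ?_ hn (norm_nonneg _) (by positivity))
    calc ‖w₀ + η • w₁‖ ≤ ‖w₀‖ + ‖η • w₁‖ := norm_add_le _ _
      _ ≤ W₀ + W₁ := by
        rw [norm_smul, Real.norm_eq_abs, abs_of_nonneg hη]
        nlinarith [norm_nonneg w₁]
  have h3 : |η ^ 2 * ⟪w₁, n₁⟫| ≤ η ^ 2 * (W₁ * N₁) := by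
    rw [abs_mul, abs_of_nonneg (sq_nonneg η)]
    exact mul_le_mul_of_nonneg_left ((abs_real_inner_le_norm _ _).trans
      (mul_le_mul hW₁ hN₁ (norm_nonneg _) hW₁')) (sq_nonneg η)
  calc _ ≤ |⟪w - w₀ - η • w₁, n⟫| + |⟪w₀ + η • w₁, n - n₀ - η • n₁⟫| + |η ^ 2 * ⟪w₁, n₁⟫| :=
        (abs_add_le _ _).trans (add_le_add (abs_add_le _ _) le_rfl)
    _ ≤ W₂ * η ^ 2 * N + (W₀ + W₁) * (N₂ * η ^ 2) + η ^ 2 * (W₁ * N₁) := add_le_add (add_le_add h1 h2) h3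
    _ = (W₂ * N + (W₀ + W₁) * N₂ + W₁ * N₁) * η ^ 2 := by ring

/-- **First-order expansion of a product of reals.** [folklore] -/
private theorem mul_expand {x x₀ x₁ y y₀ y₁ η X₀ X₁ X₂ Y Y₁ Y₂ : ℝ} (hη : 0 ≤ η) (hη1 : η ≤ 1)
    (hx : |x - x₀ - η * x₁| ≤ X₂ * η ^ 2) (hy : |y - y₀ - η * y₁| ≤ Y₂ * η ^ 2)
    (hX₀ : |x₀| ≤ X₀) (hX₁ : |x₁| ≤ X₁) (hY : |y| ≤ Y) (hY₁ : |y₁| ≤ Y₁) :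
    |x * y - x₀ * y₀ - η * (x₁ * y₀ + x₀ * y₁)| ≤ (X₂ * Y + (X₀ + X₁) * Y₂ + X₁ * Y₁) * η ^ 2 := by
  have e : x * y - x₀ * y₀ - η * (x₁ * y₀ + x₀ * y₁) =
      (x - x₀ - η * x₁) * y + (x₀ + η * x₁) * (y - y₀ - η * y₁) + η ^ 2 * (x₁ * y₁) := by ring
  rw [e]
  have hX₀' : 0 ≤ X₀ := (abs_nonneg _).trans hX₀
  have hX₁' : 0 ≤ X₁ := (abs_nonneg _).trans hX₁
  have hY' : 0 ≤ Y := (abs_nonneg _).trans hY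
  have h1 : |(x - x₀ - η * x₁) * y| ≤ X₂ * η ^ 2 * Y := by
    rw [abs_mul]; exact mul_le_mul hx hY (abs_nonneg _) ((abs_nonneg _).trans hx)
  have h2 : |(x₀ + η * x₁) * (y - y₀ - η * y₁)| ≤ (X₀ + X₁) * (Y₂ * η ^ 2) := by
    rw [abs_mul]
    refine mul_le_mul ?_ hy (abs_nonneg _) (by positivity)
    calc |x₀ + η * x₁| ≤ |x₀| + |η * x₁| := abs_add_le _ _
      _ ≤ X₀ + X₁ := by rw [abs_mul, abs_of_nonneg hη]; nlinarith [abs_nonneg x₁]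
  have h3 : |η ^ 2 * (x₁ * y₁)| ≤ η ^ 2 * (X₁ * Y₁) := by
    rw [abs_mul, abs_of_nonneg (sq_nonneg η), abs_mul]
    exact mul_le_mul_of_nonneg_left (mul_le_mul hX₁ hY₁ (abs_nonneg _) hX₁') (sq_nonneg η)
  calc _ ≤ |(x - x₀ - η * x₁) * y| + |(x₀ + η * x₁) * (y - y₀ - η * y₁)| + |η ^ 2 * (x₁ * y₁)| :=
        (abs_add_le _ _).trans (add_le_add (abs_add_le _ _) le_rfl)
    _ ≤ X₂ * η ^ 2 * Y + (X₀ + X₁) * (Y₂ * η ^ 2) + η ^ 2 * (X₁ * Y₁) := add_le_add (add_le_add h1 h2) h3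
    _ = (X₂ * Y + (X₀ + X₁) * Y₂ + X₁ * Y₁) * η ^ 2 := by ring

/-- **First-order expansion of a scalar multiple.** [folklore] -/
private theorem smul_expand {g g₀ g₁ η G₀ G₁ G₂ W W₁ W₂ : ℝ} {w w₀ w₁ : E} (hη : 0 ≤ η) (hη1 : η ≤ 1)
    (hg : |g - g₀ - η * g₁| ≤ G₂ * η ^ 2) (hw : ‖w - w₀ - η • w₁‖ ≤ W₂ * η ^ 2)
    (hG₀ : |g₀| ≤ G₀) (hG₁ : |g₁| ≤ G₁) (hW : ‖w‖ ≤ W) (hW₁ : ‖w₁‖ ≤ W₁) :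
    ‖g • w - g₀ • w₀ - η • (g₁ • w₀ + g₀ • w₁)‖ ≤ (G₂ * W + (G₀ + G₁) * W₂ + G₁ * W₁) * η ^ 2 := by
  have e : g • w - g₀ • w₀ - η • (g₁ • w₀ + g₀ • w₁) =
      (g - g₀ - η * g₁) • w + (g₀ + η * g₁) • (w - w₀ - η • w₁) + (η ^ 2 * g₁) • w₁ := by
    module
  rw [e]
  have hG₀' : 0 ≤ G₀ := (abs_nonneg _).trans hG₀
  have hG₁' : 0 ≤ G₁ := (abs_nonneg _).trans hG₁
  have hW' : 0 ≤ W := (norm_nonneg _).trans hW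
  have h1 : ‖(g - g₀ - η * g₁) • w‖ ≤ G₂ * η ^ 2 * W := by
    rw [norm_smul, Real.norm_eq_abs]
    exact mul_le_mul hg hW (norm_nonneg _) ((abs_nonneg _).trans hg)
  have h2 : ‖(g₀ + η * g₁) • (w - w₀ - η • w₁)‖ ≤ (G₀ + G₁) * (W₂ * η ^ 2) := by
    rw [norm_smul, Real.norm_eq_abs]
    refine mul_le_mul ?_ hw (norm_nonneg _) (by positivity)
    calc |g₀ + η * g₁| ≤ |g₀| + |η * g₁| := abs_add_le _ _
      _ ≤ G₀ + G₁ := by rw [abs_mul, abs_of_nonneg hη]; nlinarith [abs_nonneg g₁]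
  have h3 : ‖(η ^ 2 * g₁) • w₁‖ ≤ η ^ 2 * (G₁ * W₁) := by
    rw [norm_smul, Real.norm_eq_abs, abs_mul, abs_of_nonneg (sq_nonneg η), mul_assoc]
    exact mul_le_mul_of_nonneg_left (mul_le_mul hG₁ hW₁ (norm_nonneg _) hG₁') (sq_nonneg η)
  calc _ ≤ ‖(g - g₀ - η * g₁) • w‖ + ‖(g₀ + η * g₁) • (w - w₀ - η • w₁)‖ + ‖(η ^ 2 * g₁) • w₁‖ :=
        (norm_add_le _ _).trans (add_le_add (norm_add_le _ _) le_rfl)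
    _ ≤ G₂ * η ^ 2 * W + (G₀ + G₁) * (W₂ * η ^ 2) + η ^ 2 * (G₁ * W₁) := add_le_add (add_le_add h1 h2) h3
    _ = (G₂ * W + (G₀ + G₁) * W₂ + G₁ * W₁) * η ^ 2 := by ring

/-- **First-order expansion of a reciprocal** near `1`: if `Q ≥ m > 0`, `|Q − 1 − η q₁| ≤ Q₂ η²`,
`|q₁| ≤ Q₁`, `Q₂ ≥ 0` (`0 ≤ η ≤ 1`) then `|Q⁻¹ − 1 + η q₁| ≤ (Q₂ + Q₁ (Q₁ + Q₂)) η² / m`. [folklore] -/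
private theorem inv_expand {Q q₁ η m Q₁ Q₂ : ℝ} (hη : 0 ≤ η) (hη1 : η ≤ 1) (hm : 0 < m) (hQm : m ≤ Q)
    (hQ : |Q - 1 - η * q₁| ≤ Q₂ * η ^ 2) (hQ₁ : |q₁| ≤ Q₁) (hQ₂ : 0 ≤ Q₂) :
    |Q⁻¹ - 1 - η * (-q₁)| ≤ (Q₂ + Q₁ * (Q₁ + Q₂)) / m * η ^ 2 := by
  have hQpos : 0 < Q := hm.trans_le hQm
  have hQ0 : Q ≠ 0 := hQpos.ne'
  have hQ₁' : 0 ≤ Q₁ := (abs_nonneg _).trans hQ₁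
  have e : Q⁻¹ - 1 - η * (-q₁) = (-(Q - 1 - η * q₁) + η * q₁ * (Q - 1)) / Q := by
    field_simp
    ring
  have hη2 : η ^ 2 ≤ η := by nlinarith
  have hQ1 : |Q - 1| ≤ (Q₁ + Q₂) * η := by
    have h' : Q - 1 = (Q - 1 - η * q₁) + η * q₁ := by ring
    rw [h']
    refine (abs_add_le _ _).trans ?_
    rw [abs_mul, abs_of_nonneg hη]
    have h2 := mul_le_mul_of_nonneg_left hQ₁ hη
    have h3 := mul_le_mul_of_nonneg_left hη2 hQ₂
    linarith
  have hnum : |-(Q - 1 - η * q₁) + η * q₁ * (Q - 1)| ≤ (Q₂ + Q₁ * (Q₁ + Q₂)) * η ^ 2 := by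
    calc |-(Q - 1 - η * q₁) + η * q₁ * (Q - 1)|
        ≤ |Q - 1 - η * q₁| + |η * q₁| * |Q - 1| := by
          refine (abs_add_le _ _).trans ?_
          rw [abs_neg, abs_mul (η * q₁)]
      _ ≤ Q₂ * η ^ 2 + (η * Q₁) * ((Q₁ + Q₂) * η) := by
          refine add_le_add hQ (mul_le_mul ?_ hQ1 (abs_nonneg _) (by positivity))
          rw [abs_mul, abs_of_nonneg hη]; exact mul_le_mul_of_nonneg_left hQ₁ hη
      _ = (Q₂ + Q₁ * (Q₁ + Q₂)) * η ^ 2 := by ring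
  rw [e, abs_div, abs_of_pos hQpos, div_le_iff₀ hQpos]
  calc |-(Q - 1 - η * q₁) + η * q₁ * (Q - 1)| ≤ (Q₂ + Q₁ * (Q₁ + Q₂)) * η ^ 2 := hnum
    _ = (Q₂ + Q₁ * (Q₁ + Q₂)) / m * η ^ 2 * m := by field_simp
    _ ≤ (Q₂ + Q₁ * (Q₁ + Q₂)) / m * η ^ 2 * Q := mul_le_mul_of_nonneg_left hQm (by positivity)

end Expansion

/-- `‖J v‖ ≤ ‖v‖`. [cite: Saffman1992, §12.4 eq. (2)] -/
theorem norm_lin_nsGrad_one_le (v : EuclideanSpace ℝ (Fin 3)) : ‖lin (nsGrad 1) v‖ ≤ ‖v‖ := by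
  have h2 := norm_sq_three v
  rw [lin_nsGrad_one]
  exact norm_vec3_le (norm_nonneg v) (by rw [h2]; nlinarith [sq_nonneg (v 2)])

/-- `‖N' v‖ ≤ ‖v‖`. [cite: Saffman1992, §12.4 eq. (2)] -/
theorem norm_lin_nsGradDeriv_le (v : EuclideanSpace ℝ (Fin 3)) : ‖lin nsGradDeriv v‖ ≤ ‖v‖ := by
  have h2 := norm_sq_three v
  rw [lin_nsGradDeriv]
  exact norm_vec3_le (norm_nonneg v) (by rw [h2]; nlinarith [sq_nonneg (v 2)])

/-- `‖κ'(s)‖ ≤ 1/2` and `‖κ''(s)‖ ≤ 1/2`. [cite: Saffman1992, §12.4 eq. (6)] -/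
theorem norm_tunedOrbitDeriv_le (s : ℝ) : ‖tunedOrbitDeriv s‖ ≤ 1 / 2 ∧ ‖tunedOrbitDeriv₂ s‖ ≤ 1 / 2 := by
  have h1 := sin_sq_add_cos_sq s
  have h3 := sqrt3_mul_self
  constructor
  · exact norm_vec3_le (by norm_num) (by nlinarith [sq_nonneg (cos s), sq_nonneg (sin s)])
  · exact norm_vec3_le (by norm_num) (by nlinarith [sq_nonneg (cos s), sq_nonneg (sin s), cos_sq_le_one s])

/-- `‖κ_α(s)‖² ≥ 1/4` (axial component). [cite: Saffman1992, §12.4 eq. (6)] -/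
theorem norm_tunedOrbit_sq_ge (α s : ℝ) : 1 / 4 ≤ ‖tunedOrbit α s‖ ^ 2 := by
  rw [norm_sq_three]; simp; nlinarith [sq_nonneg (tunedAmp α * cos s), sq_nonneg (α * tunedAmp α * sin s)]

/-- `‖κ_α(s)‖² ≤ 5/4` for `1 ≤ α ≤ 2` (`h² ≤ 3/4`, `(αh)² ≤ 243/256`). [cite: Saffman1992, §12.4 eq. (6)] -/
theorem norm_tunedOrbit_sq_le {α : ℝ} (hα1 : 1 ≤ α) (hα2 : α ≤ 2) (s : ℝ) :
    ‖tunedOrbit α s‖ ^ 2 ≤ 5 / 4 := by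
  have h3 := sqrt3_mul_self
  have e1 : tunedAmp α ^ 2 = 3 / 16 * (3 - α) ^ 2 := by
    unfold tunedAmp; linear_combination ((3 - α) ^ 2 / 16) * h3
  have e2 : (α * tunedAmp α) ^ 2 = 3 / 16 * (α * (3 - α)) ^ 2 := by
    unfold tunedAmp; linear_combination ((α * (3 - α)) ^ 2 / 16) * h3
  have hb1 : tunedAmp α ^ 2 ≤ 1 := by rw [e1]; nlinarith
  have hp0 : 0 ≤ α * (3 - α) := by nlinarith
  have hp1 : α * (3 - α) ≤ 9 / 4 := by nlinarith [sq_nonneg (α - 3 / 2)]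
  have hb2 : (α * tunedAmp α) ^ 2 ≤ 1 := by rw [e2]; nlinarith
  have hsc := sin_sq_add_cos_sq s
  rw [norm_sq_three]
  simp
  nlinarith [mul_le_mul_of_nonneg_right hb1 (sq_nonneg (cos s)),
    mul_le_mul_of_nonneg_right hb2 (sq_nonneg (sin s))]

/-- **A bound on the first-order operator**: `‖D(s) v‖ ≤ 7‖v‖`. [cite: Saffman1992, §12.4 eq. (5)] -/
theorem norm_firstOrderOp_le (s : ℝ) (v : EuclideanSpace ℝ (Fin 3)) : ‖firstOrderOp s v‖ ≤ 7 * ‖v‖ := by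
  obtain ⟨hk', -⟩ := norm_tunedOrbitDeriv_le s
  have hk₁ := norm_tunedOrbit_one s
  have hJ := norm_lin_nsGrad_one_le v
  have hN := norm_lin_nsGradDeriv_le v
  have hv := norm_nonneg v
  have ha₀ : |⟪tunedOrbit 1 s, lin (nsGrad 1) v⟫| ≤ ‖v‖ :=
    (abs_real_inner_le_norm _ _).trans (by rw [hk₁, one_mul]; exact hJ)
  have ha₁ : |⟪tunedOrbitDeriv s, lin (nsGrad 1) v⟫| ≤ 1 / 2 * ‖v‖ :=
    (abs_real_inner_le_norm _ _).trans (mul_le_mul hk' hJ (norm_nonneg _) (by norm_num))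
  have ha₂ : |⟪tunedOrbit 1 s, lin nsGradDeriv v⟫| ≤ ‖v‖ :=
    (abs_real_inner_le_norm _ _).trans (by rw [hk₁, one_mul]; exact hN)
  have hq : |⟪tunedOrbit 1 s, tunedOrbitDeriv s⟫| ≤ 1 / 2 :=
    (abs_real_inner_le_norm _ _).trans (by rw [hk₁, one_mul]; exact hk')
  have hcoef : |2 * (⟪tunedOrbitDeriv s, lin (nsGrad 1) v⟫ + ⟪tunedOrbit 1 s, lin nsGradDeriv v⟫ -
      2 * ⟪tunedOrbit 1 s, tunedOrbitDeriv s⟫ * ⟪tunedOrbit 1 s, lin (nsGrad 1) v⟫)| ≤ 5 * ‖v‖ := by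
    rw [abs_mul, abs_two]
    have h := abs_sub (⟪tunedOrbitDeriv s, lin (nsGrad 1) v⟫ + ⟪tunedOrbit 1 s, lin nsGradDeriv v⟫)
      (2 * ⟪tunedOrbit 1 s, tunedOrbitDeriv s⟫ * ⟪tunedOrbit 1 s, lin (nsGrad 1) v⟫)
    have h' := abs_add_le ⟪tunedOrbitDeriv s, lin (nsGrad 1) v⟫ ⟪tunedOrbit 1 s, lin nsGradDeriv v⟫
    have h'' : |2 * ⟪tunedOrbit 1 s, tunedOrbitDeriv s⟫ * ⟪tunedOrbit 1 s, lin (nsGrad 1) v⟫| ≤ ‖v‖ := by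
      rw [abs_mul, abs_mul, abs_two]
      nlinarith [abs_nonneg ⟪tunedOrbit 1 s, tunedOrbitDeriv s⟫,
        abs_nonneg ⟪tunedOrbit 1 s, lin (nsGrad 1) v⟫]
    linarith
  unfold firstOrderOp
  calc _ ≤ ‖-lin nsGradDeriv v + (2 * (⟪tunedOrbitDeriv s, lin (nsGrad 1) v⟫ +
        ⟪tunedOrbit 1 s, lin nsGradDeriv v⟫ - 2 * ⟪tunedOrbit 1 s, tunedOrbitDeriv s⟫ *
        ⟪tunedOrbit 1 s, lin (nsGrad 1) v⟫)) • tunedOrbit 1 s‖ +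
        ‖(2 * ⟪tunedOrbit 1 s, lin (nsGrad 1) v⟫) • tunedOrbitDeriv s‖ := norm_add_le _ _
    _ ≤ (‖v‖ + 5 * ‖v‖) + ‖v‖ := by
        refine add_le_add ((norm_add_le _ _).trans (add_le_add (by rwa [norm_neg]) ?_)) ?_
        · rw [norm_smul, hk₁, mul_one, Real.norm_eq_abs]; exact hcoef
        · rw [norm_smul, Real.norm_eq_abs, abs_mul, abs_two]
          nlinarith [abs_nonneg ⟪tunedOrbit 1 s, lin (nsGrad 1) v⟫, norm_nonneg (tunedOrbitDeriv s)]
    _ = 7 * ‖v‖ := by ring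

set_option maxHeartbeats 400000 in
/-- **The remainder of the first-order expansion of the coefficient operator**: for `1 ≤ α ≤ 2`
and all `s`, `v`,
`‖ampRHS (nsGrad α) 0 (κ_α s) v − ampRHS (nsGrad 1) 0 (κ₁ s) v − (α−1) D(s) v‖ ≤ 269 (α−1)² ‖v‖`.
(Elementary: the projector coefficient `2⟪κ, Nv⟫/|κ|²` and `κ` are expanded to first order with
explicit second-order remainders.) [cite: Saffman1992, §12.4 eq. (5)] -/
theorem norm_ampRHS_sub_sub_le {α : ℝ} (hα : 1 ≤ α) (hα2 : α ≤ 2) (s : ℝ)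
    (v : EuclideanSpace ℝ (Fin 3)) :
    ‖ampRHS (nsGrad α) 0 (tunedOrbit α s) v - ampRHS (nsGrad 1) 0 (tunedOrbit 1 s) v -
        (α - 1) • firstOrderOp s v‖ ≤ 269 * (α - 1) ^ 2 * ‖v‖ := by
  set η := α - 1 with hη
  have hη0 : 0 ≤ η := by rw [hη]; linarith
  have hη1 : η ≤ 1 := by rw [hη]; linarith
  have hαpos : 0 < α := by linarith
  -- the pieces
  set w := tunedOrbit α s with hw
  set w₀ := tunedOrbit 1 s with hw₀
  set w₁ := tunedOrbitDeriv s with hw₁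
  set w₂ := tunedOrbitDeriv₂ s with hw₂
  set n := lin (nsGrad α) v with hn
  set n₀ := lin (nsGrad 1) v with hn₀
  set n₁ := lin nsGradDeriv v with hn₁
  have hv := norm_nonneg v
  obtain ⟨hW₁, hW₂⟩ := norm_tunedOrbitDeriv_le s
  have hW₀ : ‖w₀‖ = 1 := norm_tunedOrbit_one s
  have hN₀ : ‖n₀‖ ≤ ‖v‖ := norm_lin_nsGrad_one_le v
  have hN₁ : ‖n₁‖ ≤ ‖v‖ := norm_lin_nsGradDeriv_le v
  -- expansions of `w` and `n`
  have hwexp : w - w₀ - η • w₁ = η ^ 2 • w₂ := by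
    rw [hw, tunedOrbit_expand α s]; abel
  have hwrem : ‖w - w₀ - η • w₁‖ ≤ 1 / 2 * η ^ 2 := by
    rw [hwexp, norm_smul, Real.norm_eq_abs, abs_of_nonneg (sq_nonneg η)]
    nlinarith only [sq_nonneg η, hW₂]
  have hW : ‖w‖ ≤ 2 := by
    have e : w = (w - w₀ - η • w₁) + w₀ + η • w₁ := by abel
    rw [e]
    calc _ ≤ ‖w - w₀ - η • w₁‖ + ‖w₀‖ + ‖η • w₁‖ := norm_add₃_le
      _ ≤ 1 / 2 * η ^ 2 + 1 + η * (1 / 2) := by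
          rw [hW₀, norm_smul, Real.norm_eq_abs, abs_of_nonneg hη0]
          exact add_le_add (add_le_add hwrem le_rfl) (mul_le_mul_of_nonneg_left hW₁ hη0)
      _ ≤ 2 := by nlinarith only [hη0, hη1]
  have hnexp : n - n₀ - η • n₁ = !₂[0, η ^ 2 / α * v 0, 0] := by
    rw [hn, lin_nsGrad_expand hαpos.ne' v]; abel
  have hnrem : ‖n - n₀ - η • n₁‖ ≤ ‖v‖ * η ^ 2 := by
    rw [hnexp]
    have hv0 := abs_apply_le_norm v 0
    have hc : η ^ 2 / α ≤ η ^ 2 := div_le_self (sq_nonneg η) hα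
    have hc0 : 0 ≤ η ^ 2 / α := div_nonneg (sq_nonneg η) hαpos.le
    refine norm_vec3_le (by positivity) ?_
    have h1 : (η ^ 2 / α * v 0) ^ 2 ≤ (‖v‖ * η ^ 2) ^ 2 := by
      rw [mul_pow, mul_pow]
      have := sq_abs (v 0)
      nlinarith only [this, sq_nonneg (v 0), pow_le_pow_left₀ hc0 hc 2,
        pow_le_pow_left₀ (abs_nonneg _) hv0 2, sq_nonneg (η ^ 2 / α), sq_nonneg (v 0), sq_nonneg ‖v‖]
    nlinarith only [h1]
  have hN : ‖n‖ ≤ 3 * ‖v‖ := by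
    have e : n = (n - n₀ - η • n₁) + n₀ + η • n₁ := by abel
    rw [e]
    calc _ ≤ ‖n - n₀ - η • n₁‖ + ‖n₀‖ + ‖η • n₁‖ := norm_add₃_le
      _ ≤ ‖v‖ * η ^ 2 + ‖v‖ + η * ‖v‖ := by
          rw [norm_smul, Real.norm_eq_abs, abs_of_nonneg hη0]
          exact add_le_add (add_le_add hnrem hN₀) (mul_le_mul_of_nonneg_left hN₁ hη0)
      _ ≤ 3 * ‖v‖ := by
          have hη2 : η ^ 2 ≤ 1 := by nlinarith only [hη0, hη1]
          have h1 := mul_le_mul_of_nonneg_left hη2 hv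
          have h2 := mul_le_mul_of_nonneg_right hη1 hv
          linarith only [h1, h2]
  -- `a = ⟪w, n⟫`
  have ha := inner_expand hη0 hη1 hwrem hnrem hW₀.le hW₁ hN hN₁
  have ha₀ : |⟪w₀, n₀⟫| ≤ ‖v‖ := (abs_real_inner_le_norm _ _).trans (by rw [hW₀, one_mul]; exact hN₀)
  have ha₁ : |⟪w₁, n₀⟫ + ⟪w₀, n₁⟫| ≤ 3 / 2 * ‖v‖ := by
    refine (abs_add_le _ _).trans ?_
    have h1 : |⟪w₁, n₀⟫| ≤ 1 / 2 * ‖v‖ :=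
      (abs_real_inner_le_norm _ _).trans (mul_le_mul hW₁ hN₀ (norm_nonneg _) (by norm_num))
    have h2 : |⟪w₀, n₁⟫| ≤ ‖v‖ := (abs_real_inner_le_norm _ _).trans (by rw [hW₀, one_mul]; exact hN₁)
    linarith only [h1, h2]
  -- `Q = ‖w‖²`
  have hQ' := inner_expand hη0 hη1 hwrem hwrem hW₀.le hW₁ hW hW₁
  have hQQ : ⟪w, w⟫ = ‖w‖ ^ 2 := real_inner_self_eq_norm_sq w
  have hQ₀ : ⟪w₀, w₀⟫ = 1 := by rw [real_inner_self_eq_norm_sq, hW₀, one_pow]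
  rw [hQQ, hQ₀] at hQ'
  have hQ : |‖w‖ ^ 2 - 1 - η * (⟪w₁, w₀⟫ + ⟪w₀, w₁⟫)| ≤ 2 * η ^ 2 := by
    refine hQ'.trans (le_of_eq ?_); ring
  have hq₁ : |⟪w₁, w₀⟫ + ⟪w₀, w₁⟫| ≤ 1 := by
    rw [real_inner_comm w₀ w₁, ← two_mul, abs_mul, abs_two]
    have := (abs_real_inner_le_norm w₀ w₁).trans (mul_le_mul hW₀.le hW₁ (norm_nonneg _) zero_le_one)
    linarith only [this]
  have hQm : 1 / 4 ≤ ‖w‖ ^ 2 := norm_tunedOrbit_sq_ge α s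
  have hQinv := inv_expand hη0 hη1 (by norm_num : (0:ℝ) < 1 / 4) hQm hQ hq₁ (by norm_num)
  have hQinv' : |(‖w‖ ^ 2)⁻¹ - 1 - η * -(⟪w₁, w₀⟫ + ⟪w₀, w₁⟫)| ≤ 20 * η ^ 2 :=
    hQinv.trans (le_of_eq (by norm_num))
  have hY : |(‖w‖ ^ 2)⁻¹| ≤ 4 := by
    rw [abs_of_pos (inv_pos.mpr (by linarith only [hQm]))]
    calc (‖w‖ ^ 2)⁻¹ ≤ (1 / 4)⁻¹ := inv_anti₀ (by norm_num) hQm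
      _ = 4 := by norm_num
  -- `b = a / Q`
  have hq₁' : |(-(⟪w₁, w₀⟫ + ⟪w₀, w₁⟫))| ≤ 1 := by rwa [abs_neg]
  have hb := mul_expand hη0 hη1 ha hQinv' ha₀ ha₁ hY hq₁'
  -- `g = 2 b`
  set a := ⟪w, n⟫ with hadef
  set a₀ := ⟪w₀, n₀⟫
  set a₁ := ⟪w₁, n₀⟫ + ⟪w₀, n₁⟫
  set q₁ := ⟪w₁, w₀⟫ + ⟪w₀, w₁⟫
  set Qi := (‖w‖ ^ 2)⁻¹
  have hg : |2 * a * Qi - 2 * a₀ - η * (2 * (a₁ - a₀ * q₁))| ≤ 131 * ‖v‖ * η ^ 2 := by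
    have e : 2 * a * Qi - 2 * a₀ - η * (2 * (a₁ - a₀ * q₁)) =
        2 * (a * Qi - a₀ * 1 - η * (a₁ * 1 + a₀ * -q₁)) := by ring
    rw [e, abs_mul, abs_two]
    linarith [hb]
  have hG₀ : |2 * a₀| ≤ 2 * ‖v‖ := by rw [abs_mul, abs_two]; linarith only [ha₀]
  have hG₁ : |2 * (a₁ - a₀ * q₁)| ≤ 5 * ‖v‖ := by
    rw [abs_mul, abs_two]
    have h := abs_sub a₁ (a₀ * q₁)
    have h' : |a₀ * q₁| ≤ ‖v‖ := by
      rw [abs_mul]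
      have := mul_le_mul ha₀ hq₁ (abs_nonneg _) hv
      linarith only [this]
    linarith only [h, h', ha₁]
  -- `g • w`
  have hgw := smul_expand hη0 hη1 hg hwrem hG₀ hG₁ hW hW₁
  -- identify the three operators
  have hC : ampRHS (nsGrad α) 0 w v = (2 * a * Qi) • w - n := by
    rw [ampRHS, zero_mul, zero_smul, sub_zero, hadef, hn, div_eq_mul_inv]
  have hC₀ : ampRHS (nsGrad 1) 0 w₀ v = (2 * a₀) • w₀ - n₀ := by
    rw [hw₀, ampRHS_one_eq]
  have hD : firstOrderOp s v = -n₁ + (2 * (a₁ - a₀ * q₁)) • w₀ + (2 * a₀) • w₁ := by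
    rw [firstOrderOp]
    have e : 2 * (⟪tunedOrbitDeriv s, lin (nsGrad 1) v⟫ + ⟪tunedOrbit 1 s, lin nsGradDeriv v⟫ -
        2 * ⟪tunedOrbit 1 s, tunedOrbitDeriv s⟫ * ⟪tunedOrbit 1 s, lin (nsGrad 1) v⟫) =
        2 * (a₁ - a₀ * q₁) := by
      simp only [a₁, a₀, q₁, hw₀, hw₁, hn₀, hn₁, real_inner_comm (tunedOrbit 1 s) (tunedOrbitDeriv s)]
      ring
    rw [e]
  rw [hC, hC₀, hD]
  have e : (2 * a * Qi) • w - n - ((2 * a₀) • w₀ - n₀) -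
      η • (-n₁ + (2 * (a₁ - a₀ * q₁)) • w₀ + (2 * a₀) • w₁) =
      ((2 * a * Qi) • w - (2 * a₀) • w₀ - η • ((2 * (a₁ - a₀ * q₁)) • w₀ + (2 * a₀) • w₁)) -
        (n - n₀ - η • n₁) := by module
  rw [e]
  calc _ ≤ ‖(2 * a * Qi) • w - (2 * a₀) • w₀ - η • ((2 * (a₁ - a₀ * q₁)) • w₀ + (2 * a₀) • w₁)‖ +
        ‖n - n₀ - η • n₁‖ := norm_sub_le _ _
    _ ≤ (131 * ‖v‖ * 2 + (2 * ‖v‖ + 5 * ‖v‖) * (1 / 2) + 5 * ‖v‖ * (1 / 2)) * η ^ 2 + ‖v‖ * η ^ 2 :=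
        add_le_add hgw hnrem
    _ = 269 * η ^ 2 * ‖v‖ := by ring

/-- **First-order closeness of the coefficient operators**: for `1 ≤ α ≤ 2`,
`‖ampRHS (nsGrad α) 0 (κ_α s) v − ampRHS (nsGrad 1) 0 (κ₁ s) v‖ ≤ 276 (α − 1) ‖v‖`.
[cite: Saffman1992, §12.4 eq. (5)] -/
theorem norm_ampRHS_sub_le {α : ℝ} (hα : 1 ≤ α) (hα2 : α ≤ 2) (s : ℝ) (v : EuclideanSpace ℝ (Fin 3)) :
    ‖ampRHS (nsGrad α) 0 (tunedOrbit α s) v - ampRHS (nsGrad 1) 0 (tunedOrbit 1 s) v‖ ≤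
      276 * (α - 1) * ‖v‖ := by
  have h := norm_ampRHS_sub_sub_le hα hα2 s v
  have hD := norm_firstOrderOp_le s v
  have hv := norm_nonneg v
  have hη0 : 0 ≤ α - 1 := by linarith
  have e : ampRHS (nsGrad α) 0 (tunedOrbit α s) v - ampRHS (nsGrad 1) 0 (tunedOrbit 1 s) v =
      (ampRHS (nsGrad α) 0 (tunedOrbit α s) v - ampRHS (nsGrad 1) 0 (tunedOrbit 1 s) v -
        (α - 1) • firstOrderOp s v) + (α - 1) • firstOrderOp s v := by abel
  rw [e]
  refine (norm_add_le _ _).trans ?_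
  rw [norm_smul, Real.norm_eq_abs, abs_of_nonneg hη0]
  have h2 : (α - 1) * ‖firstOrderOp s v‖ ≤ (α - 1) * (7 * ‖v‖) := mul_le_mul_of_nonneg_left hD hη0
  have h3 : (α - 1) ^ 2 * ‖v‖ ≤ (α - 1) * ‖v‖ := by
    have : (α - 1) ^ 2 ≤ α - 1 := by nlinarith
    exact mul_le_mul_of_nonneg_right this hv
  linarith

/-! ### §6 One Grönwall inequality: true solutions stay `O(α − 1)`-close to the base solutions -/

/-- The coefficient operator of the normalised system along the tuned orbit is continuous in
orbital time (so the tree's Floquet machinery applies). [cite: Saffman1992, §12.4 eq. (8)] -/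
theorem continuous_ampOp_tunedOrbit (α : ℝ) :
    Continuous fun s => ampOp (nsGrad α) 0 (tunedOrbit α s) :=
  continuous_ampOp_comp (continuous_tunedOrbit α) (tunedOrbit_ne_zero α)

/-- The Grönwall constant of the closeness estimate over one orbital period (a pure number).
[cite: Hartman2002, Ch. IV Lemma 1.1] -/
def closeConst : ℝ := 276 * gronwallBound 0 279 1 (2 * π)

/-- `0 ≤ closeConst`. [cite: Hartman2002, Ch. IV Lemma 1.1] -/
theorem closeConst_nonneg : 0 ≤ closeConst := by
  rw [closeConst, gronwallBound_of_K_ne_0 (by norm_num : (279 : ℝ) ≠ 0)]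
  have : 1 ≤ exp (279 * (2 * π)) := one_le_exp (by positivity)
  simp only [zero_mul, zero_add]
  positivity

/-- **Closeness over one period.** For `1 ≤ α ≤ 2`: if `x` solves the base system, `y` solves the
`α`-system, `y(0) = x(0)` and `‖x(s)‖ ≤ X` for all `s`, then
`‖y(s) − x(s)‖ ≤ closeConst · X · (α − 1)` on `[0, 2π]` (Grönwall with `‖C₁‖ ≤ 3`,
`‖C_α − C₁‖ ≤ 276(α−1)`). [cite: Hartman2002, Ch. IV Lemma 1.1] -/
theorem norm_sub_baseSol_le {α X : ℝ} (hα : 1 ≤ α) (hα2 : α ≤ 2)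
    {x y : ℝ → EuclideanSpace ℝ (Fin 3)}
    (hx : ∀ s, HasDerivAt x (ampRHS (nsGrad 1) 0 (tunedOrbit 1 s) (x s)) s)
    (hy : ∀ s, HasDerivAt y (ampRHS (nsGrad α) 0 (tunedOrbit α s) (y s)) s)
    (h0 : y 0 = x 0) (hX : ∀ s, ‖x s‖ ≤ X) {s : ℝ} (hs : s ∈ Icc 0 (2 * π)) :
    ‖y s - x s‖ ≤ closeConst * X * (α - 1) := by
  have hη0 : 0 ≤ α - 1 := by linarith
  have hX0 : 0 ≤ X := (norm_nonneg _).trans (hX 0)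
  set e : ℝ → EuclideanSpace ℝ (Fin 3) := fun s => y s - x s with he
  have hder : ∀ s, HasDerivAt e
      (ampRHS (nsGrad α) 0 (tunedOrbit α s) (y s) - ampRHS (nsGrad 1) 0 (tunedOrbit 1 s) (x s)) s :=
    fun s => (hy s).sub (hx s)
  have hcont : ContinuousOn e (Icc 0 (2 * π)) := fun s _ =>
    (hder s).continuousAt.continuousWithinAt
  have hbound : ∀ s ∈ Ico 0 (2 * π),
      ‖ampRHS (nsGrad α) 0 (tunedOrbit α s) (y s) - ampRHS (nsGrad 1) 0 (tunedOrbit 1 s) (x s)‖ ≤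
        279 * ‖e s‖ + 276 * (α - 1) * X := by
    intro s _
    have hsplit : ampRHS (nsGrad α) 0 (tunedOrbit α s) (y s) - ampRHS (nsGrad 1) 0 (tunedOrbit 1 s) (x s)
        = (ampRHS (nsGrad α) 0 (tunedOrbit α s) (y s) - ampRHS (nsGrad 1) 0 (tunedOrbit 1 s) (y s)) +
          ampRHS (nsGrad 1) 0 (tunedOrbit 1 s) (y s - x s) := by
      have hlin : ampRHS (nsGrad 1) 0 (tunedOrbit 1 s) (y s - x s) =
          ampRHS (nsGrad 1) 0 (tunedOrbit 1 s) (y s) - ampRHS (nsGrad 1) 0 (tunedOrbit 1 s) (x s) := by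
        simp only [← ampOp_apply, map_sub]
      rw [hlin]; abel
    rw [hsplit]
    refine (norm_add_le _ _).trans ?_
    have h1 := norm_ampRHS_sub_le hα hα2 s (y s)
    have h2 := norm_ampRHS_one_le s (y s - x s)
    have hy' : ‖y s‖ ≤ ‖e s‖ + X := by
      have : y s = e s + x s := by simp [he]
      rw [this]; exact (norm_add_le _ _).trans (add_le_add le_rfl (hX s))
    have h3 : 276 * (α - 1) * ‖y s‖ ≤ 276 * (α - 1) * (‖e s‖ + X) :=
      mul_le_mul_of_nonneg_left hy' (by positivity)
    have h4 : 276 * (α - 1) * ‖e s‖ ≤ 276 * ‖e s‖ := by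
      have : (α - 1) * ‖e s‖ ≤ 1 * ‖e s‖ := mul_le_mul_of_nonneg_right (by linarith) (norm_nonneg _)
      linarith
    simp only [he] at h2 ⊢
    linarith
  have h00 : ‖e 0‖ ≤ 0 := by simp [he, h0]
  have hG := norm_le_gronwallBound_of_norm_deriv_right_le hcont
    (fun s _ => (hder s).hasDerivWithinAt) h00 hbound s hs
  refine hG.trans ?_
  rw [gronwallBound_of_K_ne_0 (by norm_num : (279 : ℝ) ≠ 0), closeConst,
    gronwallBound_of_K_ne_0 (by norm_num : (279 : ℝ) ≠ 0)]
  simp only [zero_mul, zero_add, sub_zero]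
  have hexp : exp (279 * s) ≤ exp (279 * (2 * π)) := exp_le_exp.mpr (by nlinarith [hs.2])
  have hexp1 : 1 ≤ exp (279 * s) := one_le_exp (by nlinarith [hs.1])
  have hpos : 0 ≤ 276 * (α - 1) * X := by positivity
  calc 276 * (α - 1) * X / 279 * (exp (279 * s) - 1)
      ≤ 276 * (α - 1) * X / 279 * (exp (279 * (2 * π)) - 1) :=
        mul_le_mul_of_nonneg_left (by linarith) (by positivity)
    _ = 276 * (1 / 279 * (exp (279 * (2 * π)) - 1)) * X * (α - 1) := by ring

/-- **The true solutions through the frame** `p₁`, `p₂`, `k̂` (the tree's solution operator of the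
`α`-system applied to the data of the base solutions). [cite: Chicone2006, §2.4 (p. 202)] -/
def trueSol (α : ℝ) (x₀ : EuclideanSpace ℝ (Fin 3)) : ℝ → EuclideanSpace ℝ (Fin 3) :=
  Floquet.evolution (continuous_ampOp_tunedOrbit α) x₀

/-- The true solutions solve the `α`-system. [cite: Chicone2006, §2.4 (p. 202)] -/
theorem hasDerivAt_trueSol (α : ℝ) (x₀ : EuclideanSpace ℝ (Fin 3)) (s : ℝ) :
    HasDerivAt (trueSol α x₀) (ampRHS (nsGrad α) 0 (tunedOrbit α s) (trueSol α x₀ s)) s := by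
  have h := Floquet.hasDerivAt_evolution (continuous_ampOp_tunedOrbit α) x₀ s
  simp only [ampOp_apply] at h
  exact h

/-- Initial value of the true solutions. [cite: Chicone2006, §2.4 (p. 202)] -/
theorem trueSol_zero (α : ℝ) (x₀ : EuclideanSpace ℝ (Fin 3)) : trueSol α x₀ 0 = x₀ :=
  Floquet.evolution_zero _ x₀

/-- The true solutions are continuous. [cite: Chicone2006, §2.4 (p. 202)] -/
theorem continuous_trueSol (α : ℝ) (x₀ : EuclideanSpace ℝ (Fin 3)) : Continuous (trueSol α x₀) :=
  Floquet.continuous_evolution _ x₀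

/-- **The monodromy of the normalised system over one orbital period** acts on a datum as the true
solution at `s = 2π`. [cite: Chicone2006, §2.4 (p. 202)] -/
theorem ampMonodromy_tunedOrbit_apply (α : ℝ) (x₀ : EuclideanSpace ℝ (Fin 3)) :
    ampMonodromy (nsGrad α) 0 (continuous_tunedOrbit α) (tunedOrbit_ne_zero α) (2 * π) x₀ =
      trueSol α x₀ (2 * π) := by
  rw [← trueSol_zero α x₀, ampMonodromy_apply_eq _ _ _ (hasDerivAt_trueSol α x₀), trueSol_zero]

/-- The frame: `p₁ = (0, 1, 0)`. [cite: GodrecheManneville1998, §8.4 eq. (8.103)] -/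
def frame₁ : EuclideanSpace ℝ (Fin 3) := !₂[0, 1, 0]
/-- The frame: `p₂ = (1/2, 0, −√3/2)`. [cite: GodrecheManneville1998, §8.4 eq. (8.103)] -/
def frame₂ : EuclideanSpace ℝ (Fin 3) := !₂[1 / 2, 0, -(Real.sqrt 3 / 2)]
/-- The frame: `p₃ = k̂ = (√3/2, 0, 1/2) = κ₁(0)`. [cite: GodrecheManneville1998, §8.4 eq. (8.103)] -/
def frame₃ : EuclideanSpace ℝ (Fin 3) := !₂[Real.sqrt 3 / 2, 0, 1 / 2]

/-- The data of the base solutions are the frame vectors, and so are their values at `2π`.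
[cite: GodrecheManneville1998, §8.4 eqs. (8.101)–(8.103)] -/
theorem baseSol_frame :
    baseSol₁ 0 = frame₁ ∧ baseSol₂ 0 = frame₂ ∧ baseSol₃ 0 = frame₃ ∧
    baseSol₁ (2 * π) = frame₁ ∧ baseSol₂ (2 * π) = frame₂ ∧ baseSol₃ (2 * π) = frame₃ ∧
    adjSol₁ 0 = frame₁ ∧ adjSol₂ 0 = frame₂ ∧ adjSol₁ (2 * π) = frame₁ ∧ adjSol₂ (2 * π) = frame₂ := by
  obtain ⟨h1, h2, h3, h4, h5, h6⟩ := baseSol_zero_two_pi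
  obtain ⟨h7, h8, h9, h10⟩ := adjSol_zero_two_pi
  exact ⟨h1, h3, h5, h2, h4, h6, h7, h9, h8, h10⟩

/-- `κ₁(0) = k̂` and `κ_α(0) = k̂ + (α−1) κ'(0)`, `κ'(0) = (−√3/4, 0, 0)`.
[cite: Saffman1992, §12.4 eq. (6)] -/
theorem tunedOrbit_zero_eq (α : ℝ) :
    tunedOrbit α 0 = frame₃ + (α - 1) • !₂[-(Real.sqrt 3 / 4), 0, 0] := by
  rw [tunedOrbit_zero]
  ext i; fin_cases i <;> simp [frame₃, tunedAmp]; ring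

/-- **Closeness of the three true solutions to the base solutions on `[0, 2π]`.**
[cite: Hartman2002, Ch. IV Lemma 1.1] -/
theorem norm_trueSol_sub_baseSol_le {α : ℝ} (hα : 1 ≤ α) (hα2 : α ≤ 2) {s : ℝ} (hs : s ∈ Icc 0 (2 * π)) :
    ‖trueSol α frame₁ s - baseSol₁ s‖ ≤ closeConst * 1 * (α - 1) ∧
    ‖trueSol α frame₂ s - baseSol₂ s‖ ≤ closeConst * 1 * (α - 1) ∧
    ‖trueSol α frame₃ s - baseSol₃ s‖ ≤ closeConst * 4 * (α - 1) := by
  obtain ⟨h1, h2, h3, -⟩ := baseSol_frame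
  refine ⟨norm_sub_baseSol_le hα hα2 hasDerivAt_baseSol₁ (hasDerivAt_trueSol α _) (by rw [trueSol_zero, h1])
      (fun s => (norm_baseSol_le s).1) hs,
    norm_sub_baseSol_le hα hα2 hasDerivAt_baseSol₂ (hasDerivAt_trueSol α _) (by rw [trueSol_zero, h2])
      (fun s => (norm_baseSol_le s).2.1) hs,
    norm_sub_baseSol_le hα hα2 hasDerivAt_baseSol₃ (hasDerivAt_trueSol α _) (by rw [trueSol_zero, h3])
      (fun s => (norm_baseSol_le s).2.2) hs⟩

/-! ### §7 Adjoint pairing: the first-order coefficients of the monodromy as explicit integrals -/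

/-- **The pairing integrand** `f_ab(s) = ⟪ψ_a(s), D(s) x_b(s)⟫` collapses, for the two
off-diagonal pairs, to the polynomials of mean `9/16` below — this is where Waleffe's number
appears. [cite: GodrecheManneville1998, §8.4 eqs. (8.92)–(8.95)] -/
theorem pairing₁₂ (s : ℝ) :
    ⟪adjSol₁ s, firstOrderOp s (baseSol₂ s)⟫ = -(7 / 2) * cos s ^ 4 + 17 / 4 * cos s ^ 2 - 1 / 4 := by
  rw [firstOrderOp_apply, inner_three]
  have h1 := sin_sq_add_cos_sq s
  have h3 := sqrt3_mul_self
  simp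
  linear_combination (9 * cos s ^ 4 * sin s ^ 2 / 8 - 9 * cos s ^ 4 / 8 + 15 * cos s ^ 2 * sin s ^ 2
    / 16 + 65 * cos s ^ 2 / 16 - sin s ^ 2 / 8 - 1 / 4) * h1

/-- The pairing integrand `f₂₁`. [cite: GodrecheManneville1998, §8.4 eqs. (8.92)–(8.95)] -/
theorem pairing₂₁ (s : ℝ) :
    ⟪adjSol₂ s, firstOrderOp s (baseSol₁ s)⟫ =
      -(7 / 2) * cos s ^ 4 + 9 / 4 * cos s ^ 3 + 11 / 4 * cos s ^ 2 - 9 / 8 * cos s + 1 / 2 := by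
  rw [firstOrderOp_apply, inner_three]
  have h1 := sin_sq_add_cos_sq s
  have h3 := sqrt3_mul_self
  simp
  linear_combination (-(9 * cos s ^ 6 / 4) + 27 * cos s ^ 5 / 8 - 9 * cos s ^ 4 * sin s ^ 2 / 8 - 27 *
    cos s ^ 4 / 8 + 3 * cos s ^ 3 * Real.sqrt 3 ^ 2 / 8 + 27 * cos s ^ 3 * sin s ^ 2 / 16 + 27 * cos s ^
    3 / 16 - 3 * cos s ^ 2 * sin s ^ 2 / 16 + 9 * cos s ^ 2 / 4 - 3 * cos s * Real.sqrt 3 ^ 2 / 16 + 9 *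
    cos s * sin s ^ 2 / 32 - 9 * cos s / 16 + 1 / 2) * h1 + (cos s ^ 3 / 2 - 3 * cos s / 16) * h3

/-- The pairing integrand `f₁₁` (odd: mean zero). [cite: GodrecheManneville1998, §8.4 eqs. (8.92)–(8.95)] -/
theorem pairing₁₁ (s : ℝ) :
    ⟪adjSol₁ s, firstOrderOp s (baseSol₁ s)⟫ = -(7 / 2) * cos s ^ 3 * sin s + 1 / 4 * cos s * sin s := by
  rw [firstOrderOp_apply, inner_three]
  have h1 := sin_sq_add_cos_sq s
  have h3 := sqrt3_mul_self
  simp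
  linear_combination (-(9 * cos s ^ 5 * sin s / 4) - 9 * cos s ^ 3 * sin s ^ 3 / 8 - 9 * cos s ^ 3 *
    sin s / 4 - 3 * cos s * sin s ^ 3 / 16 + 3 * cos s * sin s / 16) * h1

/-- The pairing integrand `f₂₂` (odd: mean zero). [cite: GodrecheManneville1998, §8.4 eqs. (8.92)–(8.95)] -/
theorem pairing₂₂ (s : ℝ) :
    ⟪adjSol₂ s, firstOrderOp s (baseSol₂ s)⟫ =
      7 / 2 * cos s ^ 3 * sin s - 9 / 4 * cos s ^ 2 * sin s - 13 / 4 * cos s * sin s + 9 / 8 * sin s := by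
  rw [firstOrderOp_apply, inner_three]
  have h1 := sin_sq_add_cos_sq s
  have h3 := sqrt3_mul_self
  simp
  linear_combination (9 * cos s ^ 5 * sin s / 8 - 27 * cos s ^ 4 * sin s / 16 + 51 * cos s ^ 3 * sin s
    / 16 - 3 * cos s ^ 2 * Real.sqrt 3 ^ 2 * sin s / 8 - 45 * cos s ^ 2 * sin s / 32 - 11 * cos s * sin s
    / 4 + 5 * Real.sqrt 3 ^ 2 * sin s / 16 + 3 * sin s / 16) * h1 + (-(cos s ^ 2 * sin s / 2) + 5 *
    sin s / 16) * h3

/-- **`β₁₂ = ∫₀^{2π} f₁₂ = 9π/8`.** [cite: GodrecheManneville1998, §8.4 eqs. (8.92)–(8.95)] -/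
theorem integral_pairing₁₂ :
    ∫ s in (0 : ℝ)..2 * π, ⟪adjSol₁ s, firstOrderOp s (baseSol₂ s)⟫ = 9 * π / 8 := by
  simp_rw [pairing₁₂]
  have hF : ∀ s ∈ uIcc 0 (2 * π), HasDerivAt
      (fun s => 9 * s / 16 + 13 / 16 * (sin s * cos s) - 7 / 8 * (sin s * cos s ^ 3))
      (-(7 / 2) * cos s ^ 4 + 17 / 4 * cos s ^ 2 - 1 / 4) s := by
    intro s _
    have h := (((hasDerivAt_id s).const_mul (9 : ℝ)).div_const 16).add
      ((((hasDerivAt_sin s).mul (hasDerivAt_cos s)).const_mul (13 / 16 : ℝ)).sub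
      (((hasDerivAt_sin s).mul ((hasDerivAt_cos s).pow 3)).const_mul (7 / 8 : ℝ)))
    have e : (fun s => 9 * s / 16 + 13 / 16 * (sin s * cos s) - 7 / 8 * (sin s * cos s ^ 3)) =
        fun s => 9 * id s / 16 + (13 / 16 * (sin s * cos s) - 7 / 8 * (sin s * cos s ^ 3)) := by
      funext s; simp only [id]; ring
    rw [e]
    refine h.congr_deriv ?_
    have h1 := sin_sq_add_cos_sq s
    simp
    linear_combination (21 * cos s ^ 2 / 8 - 13 / 16) * h1
  rw [integral_eq_sub_of_hasDerivAt hF (Continuous.intervalIntegrable (by fun_prop) _ _)]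
  simp [sin_two_pi, cos_two_pi]
  ring

/-- **`β₂₁ = ∫₀^{2π} f₂₁ = 9π/8`.** [cite: GodrecheManneville1998, §8.4 eqs. (8.92)–(8.95)] -/
theorem integral_pairing₂₁ :
    ∫ s in (0 : ℝ)..2 * π, ⟪adjSol₂ s, firstOrderOp s (baseSol₁ s)⟫ = 9 * π / 8 := by
  simp_rw [pairing₂₁]
  have hF : ∀ s ∈ uIcc 0 (2 * π), HasDerivAt
      (fun s => 9 * s / 16 + 9 / 8 * sin s - 3 / 4 * sin s ^ 3 + 1 / 16 * (sin s * cos s) -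
        7 / 8 * (sin s * cos s ^ 3))
      (-(7 / 2) * cos s ^ 4 + 9 / 4 * cos s ^ 3 + 11 / 4 * cos s ^ 2 - 9 / 8 * cos s + 1 / 2) s := by
    intro s _
    have h := (((((hasDerivAt_id s).const_mul (9 : ℝ)).div_const 16).add
      ((hasDerivAt_sin s).const_mul (9 / 8 : ℝ))).sub (((hasDerivAt_sin s).pow 3).const_mul
      (3 / 4 : ℝ))).add
      (((((hasDerivAt_sin s).mul (hasDerivAt_cos s)).const_mul (1 / 16 : ℝ)).sub
      (((hasDerivAt_sin s).mul ((hasDerivAt_cos s).pow 3)).const_mul (7 / 8 : ℝ))))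
    have e : (fun s => 9 * s / 16 + 9 / 8 * sin s - 3 / 4 * sin s ^ 3 + 1 / 16 * (sin s * cos s) -
        7 / 8 * (sin s * cos s ^ 3)) = fun s => 9 * id s / 16 + 9 / 8 * sin s - 3 / 4 * sin s ^ 3 +
        (1 / 16 * (sin s * cos s) - 7 / 8 * (sin s * cos s ^ 3)) := by
      funext s; simp only [id]; ring
    rw [e]
    refine h.congr_deriv ?_
    have h1 := sin_sq_add_cos_sq s
    simp
    linear_combination (21 * cos s ^ 2 / 8 - 9 * cos s / 4 - 1 / 16) * h1
  rw [integral_eq_sub_of_hasDerivAt hF (Continuous.intervalIntegrable (by fun_prop) _ _)]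
  simp [sin_two_pi, cos_two_pi]
  ring

/-- `β₁₁ = ∫₀^{2π} f₁₁ = 0`. [cite: GodrecheManneville1998, §8.4 eqs. (8.92)–(8.95)] -/
theorem integral_pairing₁₁ :
    ∫ s in (0 : ℝ)..2 * π, ⟪adjSol₁ s, firstOrderOp s (baseSol₁ s)⟫ = 0 := by
  simp_rw [pairing₁₁]
  have hF : ∀ s ∈ uIcc 0 (2 * π), HasDerivAt (fun s => 7 / 8 * cos s ^ 4 - 1 / 8 * cos s ^ 2)
      (-(7 / 2) * cos s ^ 3 * sin s + 1 / 4 * cos s * sin s) s := by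
    intro s _
    have h := (((hasDerivAt_cos s).pow 4).const_mul (7 / 8 : ℝ)).sub
      (((hasDerivAt_cos s).pow 2).const_mul (1 / 8 : ℝ))
    refine h.congr_deriv ?_
    simp
    ring
  rw [integral_eq_sub_of_hasDerivAt hF (Continuous.intervalIntegrable (by fun_prop) _ _)]
  simp [cos_two_pi]

/-- `β₂₂ = ∫₀^{2π} f₂₂ = 0`. [cite: GodrecheManneville1998, §8.4 eqs. (8.92)–(8.95)] -/
theorem integral_pairing₂₂ :
    ∫ s in (0 : ℝ)..2 * π, ⟪adjSol₂ s, firstOrderOp s (baseSol₂ s)⟫ = 0 := by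
  simp_rw [pairing₂₂]
  have hF : ∀ s ∈ uIcc 0 (2 * π), HasDerivAt
      (fun s => -(7 / 8) * cos s ^ 4 + 3 / 4 * cos s ^ 3 + 13 / 8 * cos s ^ 2 - 9 / 8 * cos s)
      (7 / 2 * cos s ^ 3 * sin s - 9 / 4 * cos s ^ 2 * sin s - 13 / 4 * cos s * sin s + 9 / 8 * sin s)
      s := by
    intro s _
    have h := (((((hasDerivAt_cos s).pow 4).const_mul (-(7 / 8) : ℝ)).add
      (((hasDerivAt_cos s).pow 3).const_mul (3 / 4 : ℝ))).add
      (((hasDerivAt_cos s).pow 2).const_mul (13 / 8 : ℝ))).sub ((hasDerivAt_cos s).const_mul (9 / 8 : ℝ))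
    refine h.congr_deriv ?_
    simp
    ring
  rw [integral_eq_sub_of_hasDerivAt hF (Continuous.intervalIntegrable (by fun_prop) _ _)]
  simp [cos_two_pi]

/-- `D(s)` is linear: `D (u − v) = D u − D v`. [cite: Saffman1992, §12.4 eq. (5)] -/
theorem firstOrderOp_sub (s : ℝ) (u v : EuclideanSpace ℝ (Fin 3)) :
    firstOrderOp s (u - v) = firstOrderOp s u - firstOrderOp s v := by
  rw [firstOrderOp_apply, firstOrderOp_apply, firstOrderOp_apply]
  ext i; fin_cases i <;> simp <;> ring

/-- `s ↦ D(s) (y s)` is continuous for continuous `y`. [cite: Saffman1992, §12.4 eq. (5)] -/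
theorem continuous_firstOrderOp_comp {y : ℝ → EuclideanSpace ℝ (Fin 3)} (hy : Continuous y) :
    Continuous fun s => firstOrderOp s (y s) := by
  have h0 : Continuous fun s => y s 0 := (EuclideanSpace.proj (0 : Fin 3)).continuous.comp hy
  have h1 : Continuous fun s => y s 1 := (EuclideanSpace.proj (1 : Fin 3)).continuous.comp hy
  have e : (fun s => firstOrderOp s (y s)) = fun s =>
      (-(9 / 4) * cos s ^ 4 * y s 1 + 9 / 4 * cos s ^ 3 * sin s * y s 0 + 9 / 8 * cos s ^ 2 * y s 1 -
          21 / 8 * cos s * sin s * y s 0 + y s 1) • EuclideanSpace.single (0 : Fin 3) (1 : ℝ) +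
        (-(9 / 4) * cos s ^ 4 * y s 0 - 9 / 4 * cos s ^ 3 * sin s * y s 1 + 27 / 8 * cos s ^ 2 * y s 0 -
          3 / 8 * cos s * sin s * y s 1 - y s 0 / 8) • EuclideanSpace.single (1 : Fin 3) (1 : ℝ) +
        (Real.sqrt 3 * (-(3 / 4) * cos s ^ 3 * y s 1 + 3 / 4 * cos s ^ 2 * sin s * y s 0 +
          1 / 8 * cos s * y s 1 - 5 / 8 * sin s * y s 0)) • EuclideanSpace.single (2 : Fin 3) (1 : ℝ) := by
    funext s; rw [firstOrderOp_apply]; ext i; fin_cases i <;> simp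
  rw [e]
  fun_prop

/-- **The adjoint pairing identity.** For a solution `y` of the `α`-system and an adjoint base
solution `ψ` (one of `ψ₁`, `ψ₂`, through `p`):
`⟪p, y(2π)⟫ − ⟪p, y(0)⟫ = ∫₀^{2π} ⟪ψ(s), (C_α(s) − C₁(s)) y(s)⟫ ds` — the fundamental theorem of
calculus for `s ↦ ⟪ψ(s), y(s)⟫`, whose derivative loses the `C₁` part by the adjoint equation.
[cite: Chicone2006, §2.4 (adjoint system / variation of parameters)] -/
theorem inner_trueSol_two_pi_sub {α : ℝ} {ψ ψ' y : ℝ → EuclideanSpace ℝ (Fin 3)} {p : EuclideanSpace ℝ (Fin 3)}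
    (hψ : ∀ s, HasDerivAt ψ (ψ' s) s)
    (hadj : ∀ s v, ⟪ψ' s, v⟫ + ⟪ψ s, ampRHS (nsGrad 1) 0 (tunedOrbit 1 s) v⟫ = 0)
    (hψ0 : ψ 0 = p) (hψT : ψ (2 * π) = p)
    (hy : ∀ s, HasDerivAt y (ampRHS (nsGrad α) 0 (tunedOrbit α s) (y s)) s) :
    ⟪p, y (2 * π)⟫ - ⟪p, y 0⟫ = ∫ s in (0 : ℝ)..2 * π,
      ⟪ψ s, ampRHS (nsGrad α) 0 (tunedOrbit α s) (y s) - ampRHS (nsGrad 1) 0 (tunedOrbit 1 s) (y s)⟫ := by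
  have hyc : Continuous y := continuous_iff_continuousAt.mpr fun s => (hy s).continuousAt
  have hψc : Continuous ψ := continuous_iff_continuousAt.mpr fun s => (hψ s).continuousAt
  have hd : ∀ s, HasDerivAt (fun s => ⟪ψ s, y s⟫)
      ⟪ψ s, ampRHS (nsGrad α) 0 (tunedOrbit α s) (y s) - ampRHS (nsGrad 1) 0 (tunedOrbit 1 s) (y s)⟫ s := by
    intro s
    have h := (hψ s).inner ℝ (hy s)
    refine h.congr_deriv ?_
    have := hadj s (y s)
    rw [inner_sub_right]
    linarith
  have hcont : Continuous fun s =>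
      ⟪ψ s, ampRHS (nsGrad α) 0 (tunedOrbit α s) (y s) - ampRHS (nsGrad 1) 0 (tunedOrbit 1 s) (y s)⟫ := by
    refine hψc.inner ?_
    have hα := (continuous_ampOp_tunedOrbit α).clm_apply hyc
    have h1 := (continuous_ampOp_tunedOrbit 1).clm_apply hyc
    simp only [ampOp_apply] at hα h1
    exact hα.sub h1
  rw [integral_eq_sub_of_hasDerivAt (fun s _ => hd s) (hcont.intervalIntegrable _ _), hψ0, hψT]

/-- **First-order expansion of a pairing** `⟪p_a, y_b(2π)⟫`: with `x` the base solution through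
`y(0)` (`‖y − x‖ ≤ L(α−1)` on the period, `‖x‖ ≤ X`) and `ψ` the adjoint base solution through `p`
(`‖ψ‖ ≤ Ψ`),
`|⟪p, y(2π)⟫ − ⟪p, y(0)⟫ − (α−1) ∫₀^{2π} ⟪ψ, D x⟫| ≤ 2π Ψ (269 (X + L) + 7 L) (α−1)²`.
[cite: Chicone2006, §2.4] -/
theorem abs_inner_trueSol_sub_le {α X L Ψ : ℝ} (hα : 1 ≤ α) (hα2 : α ≤ 2)
    {ψ ψ' x y : ℝ → EuclideanSpace ℝ (Fin 3)} {p : EuclideanSpace ℝ (Fin 3)}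
    (hψ : ∀ s, HasDerivAt ψ (ψ' s) s)
    (hadj : ∀ s v, ⟪ψ' s, v⟫ + ⟪ψ s, ampRHS (nsGrad 1) 0 (tunedOrbit 1 s) v⟫ = 0)
    (hψ0 : ψ 0 = p) (hψT : ψ (2 * π) = p) (hΨ : ∀ s, ‖ψ s‖ ≤ Ψ)
    (hx : Continuous x) (hX : ∀ s, ‖x s‖ ≤ X)
    (hy : ∀ s, HasDerivAt y (ampRHS (nsGrad α) 0 (tunedOrbit α s) (y s)) s) (hLnn : 0 ≤ L)
    (hL : ∀ s ∈ Icc 0 (2 * π), ‖y s - x s‖ ≤ L * (α - 1)) :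
    |⟪p, y (2 * π)⟫ - ⟪p, y 0⟫ - (α - 1) * ∫ s in (0 : ℝ)..2 * π, ⟪ψ s, firstOrderOp s (x s)⟫| ≤
      2 * π * (Ψ * (269 * (X + L) + 7 * L)) * (α - 1) ^ 2 := by
  have hη0 : 0 ≤ α - 1 := by linarith
  have hX0 : 0 ≤ X := (norm_nonneg _).trans (hX 0)
  have hΨ0 : 0 ≤ Ψ := (norm_nonneg _).trans (hΨ 0)
  have hL0 : 0 ≤ L * (α - 1) := (norm_nonneg _).trans (hL 0 ⟨le_rfl, by positivity⟩)
  have hyc : Continuous y := continuous_iff_continuousAt.mpr fun s => (hy s).continuousAt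
  have hψc : Continuous ψ := continuous_iff_continuousAt.mpr fun s => (hψ s).continuousAt
  rw [inner_trueSol_two_pi_sub hψ hadj hψ0 hψT hy]
  set g : ℝ → ℝ := fun s =>
    ⟪ψ s, ampRHS (nsGrad α) 0 (tunedOrbit α s) (y s) - ampRHS (nsGrad 1) 0 (tunedOrbit 1 s) (y s)⟫ with hg
  set f : ℝ → ℝ := fun s => ⟪ψ s, firstOrderOp s (x s)⟫ with hf
  have hgc : Continuous g := by
    refine hψc.inner ?_
    have h₁ := (continuous_ampOp_tunedOrbit α).clm_apply hyc
    have h₂ := (continuous_ampOp_tunedOrbit 1).clm_apply hyc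
    simp only [ampOp_apply] at h₁ h₂
    exact h₁.sub h₂
  have hfc : Continuous f := hψc.inner (continuous_firstOrderOp_comp hx)
  have hsub : (∫ s in (0 : ℝ)..2 * π, g s) - (α - 1) * ∫ s in (0 : ℝ)..2 * π, f s =
      ∫ s in (0 : ℝ)..2 * π, (g s - (α - 1) * f s) := by
    rw [intervalIntegral.integral_sub (hgc.intervalIntegrable _ _)
      ((hfc.intervalIntegrable _ _).const_mul _), intervalIntegral.integral_const_mul]
  rw [hsub]
  have hpt : ∀ s ∈ Set.uIoc (0 : ℝ) (2 * π), ‖g s - (α - 1) * f s‖ ≤ Ψ * (269 * (X + L) + 7 * L) * (α - 1) ^ 2 := by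
    intro s hs
    have hs' : s ∈ Icc 0 (2 * π) := by
      rw [uIoc_of_le (by positivity)] at hs
      exact ⟨hs.1.le, hs.2⟩
    have e : g s - (α - 1) * f s = ⟪ψ s, (ampRHS (nsGrad α) 0 (tunedOrbit α s) (y s) -
        ampRHS (nsGrad 1) 0 (tunedOrbit 1 s) (y s) - (α - 1) • firstOrderOp s (y s)) +
        (α - 1) • firstOrderOp s (y s - x s)⟫ := by
      simp only [hg, hf, firstOrderOp_sub, inner_add_right, inner_sub_right, inner_smul_right]
      ring
    rw [e, Real.norm_eq_abs]
    refine (abs_real_inner_le_norm _ _).trans ?_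
    have h1 := norm_ampRHS_sub_sub_le hα hα2 s (y s)
    have h2 : ‖(α - 1) • firstOrderOp s (y s - x s)‖ ≤ (α - 1) * (7 * (L * (α - 1))) := by
      rw [norm_smul, Real.norm_eq_abs, abs_of_nonneg hη0]
      exact mul_le_mul_of_nonneg_left ((norm_firstOrderOp_le s _).trans
        (by nlinarith [hL s hs'])) hη0
    have hy' : ‖y s‖ ≤ X + L * (α - 1) := by
      have : y s = (y s - x s) + x s := by abel
      rw [this]; exact (norm_add_le _ _).trans (by linarith [hL s hs', hX s])
    have h3 : 269 * (α - 1) ^ 2 * ‖y s‖ ≤ 269 * (α - 1) ^ 2 * (X + L) := by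
      refine mul_le_mul_of_nonneg_left (hy'.trans ?_) (by positivity)
      nlinarith [hLnn, hα2]
    calc ‖ψ s‖ * ‖ampRHS (nsGrad α) 0 (tunedOrbit α s) (y s) - ampRHS (nsGrad 1) 0 (tunedOrbit 1 s) (y s)
          - (α - 1) • firstOrderOp s (y s) + (α - 1) • firstOrderOp s (y s - x s)‖
        ≤ Ψ * (269 * (α - 1) ^ 2 * (X + L) + (α - 1) * (7 * (L * (α - 1)))) :=
          mul_le_mul (hΨ s) ((norm_add_le _ _).trans (add_le_add (h1.trans h3) h2)) (norm_nonneg _) hΨ0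
      _ = Ψ * (269 * (X + L) + 7 * L) * (α - 1) ^ 2 := by ring
  have hI := intervalIntegral.norm_integral_le_of_norm_le_const hpt
  rw [Real.norm_eq_abs] at hI
  refine hI.trans (le_of_eq ?_)
  rw [sub_zero, abs_of_pos (by positivity)]
  ring

/-! ### §8 The `k̂`-row of the monodromy is second order (conservation of `⟪κ_α, v⟫`) -/

/-- Along the `α`-system `⟪κ_α(s), y(s)⟫` is conserved, so at `s = 2π`:
`⟪κ_α(0), y(2π)⟫ = ⟪κ_α(0), y(0)⟫`. [cite: Saffman1992, §12.4 eqs. (3)–(5)] -/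
theorem inner_tunedOrbit_trueSol_two_pi {α : ℝ} (hα : α ≠ 0) {y : ℝ → EuclideanSpace ℝ (Fin 3)}
    (hy : ∀ s, HasDerivAt y (ampRHS (nsGrad α) 0 (tunedOrbit α s) (y s)) s) :
    ⟪tunedOrbit α 0, y (2 * π)⟫ = ⟪tunedOrbit α 0, y 0⟫ := by
  have h := inner_eq_inner_zero (hasDerivAt_tunedOrbit hα) hy (2 * π)
  rwa [tunedOrbit_two_pi] at h

/-- **The `k̂`-row estimate**: with `x` the base solution through `y(0)` returning to `y(0)` at
`2π` and `‖y − x‖ ≤ L(α−1)` there, `|⟪k̂, y(2π)⟫ − ⟪k̂, y(0)⟫| ≤ (√3/4) L (α−1)²`.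
[cite: Saffman1992, §12.4 eqs. (3)–(6)] -/
theorem abs_inner_frame₃_trueSol_sub_le {α L : ℝ} (hα : 1 ≤ α) {x y : ℝ → EuclideanSpace ℝ (Fin 3)}
    (hy : ∀ s, HasDerivAt y (ampRHS (nsGrad α) 0 (tunedOrbit α s) (y s)) s)
    (hxT : x (2 * π) = y 0)
    (hL : ‖y (2 * π) - x (2 * π)‖ ≤ L * (α - 1)) :
    |⟪frame₃, y (2 * π)⟫ - ⟪frame₃, y 0⟫| ≤ Real.sqrt 3 / 4 * L * (α - 1) ^ 2 := by
  have hcons := inner_tunedOrbit_trueSol_two_pi (by linarith : α ≠ 0) hy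
  rw [tunedOrbit_zero_eq] at hcons
  simp only [inner_add_left, inner_smul_left, RCLike.conj_to_real] at hcons
  set d : EuclideanSpace ℝ (Fin 3) := !₂[-(Real.sqrt 3 / 4), 0, 0] with hd
  have e : ⟪frame₃, y (2 * π)⟫ - ⟪frame₃, y 0⟫ = -((α - 1) * ⟪d, y (2 * π) - x (2 * π)⟫) := by
    rw [inner_sub_right, hxT]; linarith
  rw [e, abs_neg, abs_mul, abs_of_nonneg (by linarith : 0 ≤ α - 1)]
  have hdn : ‖d‖ ≤ Real.sqrt 3 / 4 := norm_vec3_le (by positivity) (le_of_eq (by ring))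
  have := (abs_real_inner_le_norm d (y (2 * π) - x (2 * π))).trans
    (mul_le_mul hdn hL (norm_nonneg _) (by positivity))
  nlinarith [this]

/-! ### §9 First-order data give the second-order trace: the `3 × 3` algebra -/

/-- The inner products of the frame vectors. [cite: GodrecheManneville1998, §8.4 eq. (8.103)] -/
theorem inner_frame :
    ⟪frame₁, frame₁⟫ = (1 : ℝ) ∧ ⟪frame₂, frame₂⟫ = (1 : ℝ) ∧ ⟪frame₃, frame₃⟫ = (1 : ℝ) ∧
    ⟪frame₁, frame₂⟫ = (0 : ℝ) ∧ ⟪frame₂, frame₁⟫ = (0 : ℝ) ∧ ⟪frame₁, frame₃⟫ = (0 : ℝ) ∧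
    ⟪frame₃, frame₁⟫ = (0 : ℝ) ∧ ⟪frame₂, frame₃⟫ = (0 : ℝ) ∧ ⟪frame₃, frame₂⟫ = (0 : ℝ) := by
  have h3 := sqrt3_mul_self
  refine ⟨?_, ?_, ?_, ?_, ?_, ?_, ?_, ?_, ?_⟩ <;> rw [inner_three] <;> simp [frame₁, frame₂, frame₃] <;>
    nlinarith [h3]

/-- The frame vectors are unit vectors. [cite: GodrecheManneville1998, §8.4 eq. (8.103)] -/
theorem norm_frame : ‖frame₁‖ = 1 ∧ ‖frame₂‖ = 1 ∧ ‖frame₃‖ = 1 := by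
  obtain ⟨f11, f22, f33, -⟩ := inner_frame
  have h1 := real_inner_self_eq_norm_sq frame₁
  have h2 := real_inner_self_eq_norm_sq frame₂
  have h3 := real_inner_self_eq_norm_sq frame₃
  rw [f11] at h1; rw [f22] at h2; rw [f33] at h3
  refine ⟨?_, ?_, ?_⟩ <;>
    nlinarith [norm_nonneg frame₁, norm_nonneg frame₂, norm_nonneg frame₃]

/-- The frame `(p₁, p₂, k̂)` is orthonormal. [cite: GodrecheManneville1998, §8.4 eq. (8.103)] -/
theorem frame_orthonormal : Orthonormal ℝ ![frame₁, frame₂, frame₃] := by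
  obtain ⟨-, -, -, f12, f21, f13, f31, f23, f32⟩ := inner_frame
  obtain ⟨n1, n2, n3⟩ := norm_frame
  refine ⟨fun i => ?_, fun i j hij => ?_⟩
  · fin_cases i
    · exact n1
    · exact n2
    · exact n3
  · fin_cases i <;> fin_cases j <;> first | exact absurd rfl hij | simp [f12, f21, f13, f31, f23, f32]

/-- `|x y| ≤ X Y` from `|x| ≤ X`, `|y| ≤ Y`. [folklore] -/
private theorem abs_mul_le_of_le {x y X Y : ℝ} (hx : |x| ≤ X) (hy : |y| ≤ Y) : |x * y| ≤ X * Y :=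
  (abs_mul x y).le.trans (mul_le_mul hx hy (abs_nonneg _) ((abs_nonneg _).trans hx))

/-- The base solutions are continuous. [cite: GodrecheManneville1998, §8.4 eq. (8.70)] -/
theorem continuous_baseSol : Continuous baseSol₁ ∧ Continuous baseSol₂ ∧ Continuous baseSol₃ :=
  ⟨continuous_iff_continuousAt.mpr fun s => (hasDerivAt_baseSol₁ s).continuousAt,
    continuous_iff_continuousAt.mpr fun s => (hasDerivAt_baseSol₂ s).continuousAt,
    continuous_iff_continuousAt.mpr fun s => (hasDerivAt_baseSol₃ s).continuousAt⟩

/-- The frame as an orthonormal basis of `ℝ³`. [cite: GodrecheManneville1998, §8.4 eq. (8.103)] -/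
def frameBasis : OrthonormalBasis (Fin 3) ℝ (EuclideanSpace ℝ (Fin 3)) :=
  (basisOfOrthonormalOfCardEqFinrank frame_orthonormal (by simp)).toOrthonormalBasis
    (by rw [coe_basisOfOrthonormalOfCardEqFinrank]; exact frame_orthonormal)

/-- The frame basis vectors. [cite: GodrecheManneville1998, §8.4 eq. (8.103)] -/
theorem frameBasis_apply (i : Fin 3) : frameBasis i = ![frame₁, frame₂, frame₃] i := by
  rw [frameBasis]
  change ((basisOfOrthonormalOfCardEqFinrank frame_orthonormal _).toOrthonormalBasis _ : Fin 3 → _) i = _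
  rw [Module.Basis.coe_toOrthonormalBasis, coe_basisOfOrthonormalOfCardEqFinrank]

/-- **`e₂ = tr` for a volume-preserving map with the multiplier `1`.** If `T : ℝ³ → ℝ³` is linear
with `det T = 1` and `T y = y` for some `y ≠ 0`, then, with `m_ij = ⟪b_i, T b_j⟫` in an
orthonormal basis, the second invariant equals the trace:
`m₀₀m₁₁ + m₀₀m₂₂ + m₁₁m₂₂ − m₀₁m₁₀ − m₀₂m₂₀ − m₁₂m₂₁ = m₀₀ + m₁₁ + m₂₂` (the characteristic
polynomial is `(X − 1)(X² − τX + 1)`). [cite: Chicone2006, §2.4 (Hill's equation: product of the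
multipliers is `1`)] -/
theorem e₂_eq_trace_of_det_one_of_fixed (b : OrthonormalBasis (Fin 3) ℝ (EuclideanSpace ℝ (Fin 3)))
    {T : EuclideanSpace ℝ (Fin 3) →ₗ[ℝ] EuclideanSpace ℝ (Fin 3)} (hdet : LinearMap.det T = 1)
    (hfix : ∃ y, y ≠ 0 ∧ T y = y) :
    ⟪b 0, T (b 0)⟫ * ⟪b 1, T (b 1)⟫ + ⟪b 0, T (b 0)⟫ * ⟪b 2, T (b 2)⟫ + ⟪b 1, T (b 1)⟫ * ⟪b 2, T (b 2)⟫
      - ⟪b 0, T (b 1)⟫ * ⟪b 1, T (b 0)⟫ - ⟪b 0, T (b 2)⟫ * ⟪b 2, T (b 0)⟫ - ⟪b 1, T (b 2)⟫ * ⟪b 2, T (b 1)⟫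
      = ⟪b 0, T (b 0)⟫ + ⟪b 1, T (b 1)⟫ + ⟪b 2, T (b 2)⟫ := by
  classical
  set A := LinearMap.toMatrix b.toBasis b.toBasis T with hA
  have hAij : ∀ i j, A i j = ⟪b i, T (b j)⟫ := fun i j => by
    rw [hA, LinearMap.toMatrix_apply, b.coe_toBasis, b.coe_toBasis_repr_apply, b.repr_apply_apply]
  have h1 : A.det = 1 := by rw [hA, LinearMap.det_toMatrix]; exact hdet
  -- `det (T − id) = 0`
  obtain ⟨y, hy0, hy⟩ := hfix
  have hker : LinearMap.det (T - LinearMap.id) = 0 := by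
    rw [LinearMap.det_eq_zero_iff_ker_ne_bot]
    rw [Submodule.ne_bot_iff]
    exact ⟨y, by simp [hy], hy0⟩
  have h2 : (A - 1).det = 0 := by
    have : LinearMap.toMatrix b.toBasis b.toBasis (T - LinearMap.id) = A - 1 := by
      rw [map_sub, LinearMap.toMatrix_id]
    rw [← this, LinearMap.det_toMatrix]; exact hker
  rw [Matrix.det_fin_three] at h1 h2
  simp only [Matrix.sub_apply, Matrix.one_apply_eq, Matrix.one_apply_ne (by decide : (0 : Fin 3) ≠ 1),
    Matrix.one_apply_ne (by decide : (0 : Fin 3) ≠ 2), Matrix.one_apply_ne (by decide : (1 : Fin 3) ≠ 0),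
    Matrix.one_apply_ne (by decide : (1 : Fin 3) ≠ 2), Matrix.one_apply_ne (by decide : (2 : Fin 3) ≠ 0),
    Matrix.one_apply_ne (by decide : (2 : Fin 3) ≠ 1), sub_zero] at h2
  simp only [hAij] at h1 h2
  linear_combination h1 - h2

/-! ### §10 Assembly: the trace grows like `(α−1)² (9π/8)²`, a real multiplier `ρ` with
`log ρ ≥ (α−1)(9π/8) − O((α−1)²)`, and the transport to physical time -/

/-- **The monodromy of the normalised system** along the tuned orbit over one period.
[cite: Saffman1992, §12.4 eqs. (8)–(9)] -/
def tunedMonodromy (α : ℝ) : EuclideanSpace ℝ (Fin 3) →ₗ[ℝ] EuclideanSpace ℝ (Fin 3) :=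
  ampMonodromy (nsGrad α) 0 (continuous_tunedOrbit α) (tunedOrbit_ne_zero α) (2 * π)

/-- The monodromy acts as the true solution at `2π`. [cite: Chicone2006, §2.4 (p. 202)] -/
theorem tunedMonodromy_apply (α : ℝ) (x₀ : EuclideanSpace ℝ (Fin 3)) :
    tunedMonodromy α x₀ = trueSol α x₀ (2 * π) :=
  ampMonodromy_tunedOrbit_apply α x₀

/-- `det = 1` and the multiplier `1` for the normalised monodromy (`KelvinModeFloquet` §6 applied to
`(N_α, κ_α, 2π)`; `α ≠ 0`). [cite: Saffman1992, §12.4 eqs. (4)–(9)] -/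
theorem tunedMonodromy_det_one_and_fixed {α : ℝ} (hα : α ≠ 0) :
    LinearMap.det (tunedMonodromy α) = 1 ∧ ∃ y, y ≠ 0 ∧ tunedMonodromy α y = y := by
  have hkT : tunedOrbit α (2 * π) = tunedOrbit α 0 := tunedOrbit_two_pi α
  exact ⟨det_ampMonodromy_eq_one (nsGrad_trace α) _ (hasDerivAt_tunedOrbit hα) _
      (by positivity) (by rw [hkT]),
    exists_ampMonodromy_fixed _ (hasDerivAt_tunedOrbit hα) _ hkT⟩

/-- **The real-variable heart of §9–§10**: entries `m_ab` of a `3 × 3` matrix with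
`e₂(m) = tr(m)`, `m₁₁, m₂₂ = 1 + O(η²)`, `m₁₂, m₂₁ = ημ + O(η²)`, third row `O(η²)` off `1`, third
column `O(η)`, force `tr m − 3 ≥ η²(μ² − Kη)`. [folklore] -/
private theorem trace_sub_three_ge {m11 m12 m13 m21 m22 m23 m31 m32 m33 η μ C₁ C₂ C₃ : ℝ}
    (hη0 : 0 ≤ η) (hη1 : η ≤ 1) (hμ0 : 0 ≤ μ) (hC₁0 : 0 ≤ C₁) (hC₂0 : 0 ≤ C₂)
    (b11 : |m11 - 1| ≤ C₁ * η ^ 2) (b22 : |m22 - 1| ≤ C₁ * η ^ 2)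
    (b12 : |m12 - η * μ| ≤ C₁ * η ^ 2) (b21 : |m21 - η * μ| ≤ C₁ * η ^ 2)
    (b31 : |m31| ≤ C₂ * η ^ 2) (b32 : |m32| ≤ C₂ * η ^ 2) (b33 : |m33 - 1| ≤ C₂ * η ^ 2)
    (b13 : |m13| ≤ C₃ * η) (b23 : |m23| ≤ C₃ * η)
    (halg : m11 * m22 + m11 * m33 + m22 * m33 - m12 * m21 - m13 * m31 - m23 * m32 = m11 + m22 + m33) :
    η ^ 2 * (μ ^ 2 - (2 * μ * C₁ + 2 * C₁ ^ 2 + 2 * C₂ * C₃ + 2 * C₁ * C₂) * η) ≤ m11 + m22 + m33 - 3 := by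
  have p1 := abs_le.mp (abs_mul_le_of_le b13 b31)
  have p2 := abs_le.mp (abs_mul_le_of_le b23 b32)
  have p3 := abs_le.mp (abs_mul_le_of_le b11 b22)
  have p4 := abs_le.mp (abs_mul_le_of_le b11 b33)
  have p5 := abs_le.mp (abs_mul_le_of_le b22 b33)
  have p6 := abs_le.mp (abs_mul_le_of_le b12 b21)
  have q12 := abs_le.mp b12
  have q21 := abs_le.mp b21
  have key : η ^ 2 * μ ^ 2 - (2 * μ * C₁ * η ^ 3 + C₁ ^ 2 * η ^ 4) ≤ m12 * m21 := by
    have e : m12 * m21 = η ^ 2 * μ ^ 2 + η * μ * ((m12 - η * μ) + (m21 - η * μ)) +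
        (m12 - η * μ) * (m21 - η * μ) := by ring
    rw [e]
    have hημ : 0 ≤ η * μ := by positivity
    have hS : -(2 * C₁ * η ^ 2) ≤ (m12 - η * μ) + (m21 - η * μ) := by linarith only [q12.1, q21.1]
    have h2 := mul_le_mul_of_nonneg_left hS hημ
    linarith only [p6.1, h2]
  have hid : m11 + m22 + m33 - 3 = (m12 * m21 + m13 * m31 + m23 * m32)
      - ((m11 - 1) * (m22 - 1) + (m11 - 1) * (m33 - 1) + (m22 - 1) * (m33 - 1)) := by
    linear_combination halg
  rw [hid]
  have hη4 : η ^ 4 ≤ η ^ 3 := pow_le_pow_of_le_one hη0 hη1 (by norm_num : 3 ≤ 4)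
  have h4a := mul_le_mul_of_nonneg_left hη4 (sq_nonneg C₁)
  have h4b := mul_le_mul_of_nonneg_left hη4 (mul_nonneg hC₁0 hC₂0)
  linarith [key, p1.1, p2.1, p3.2, p4.2, p5.2, h4a, h4b]

set_option maxHeartbeats 1000000 in
/-- **The trace of the monodromy grows like `(α−1)² (9π/8)²**: there is `K ≥ 0` with
`tr M(α) − 3 ≥ (α−1)² ((9π/8)² − K (α−1))` for `1 ≤ α ≤ 2`. (First-order entries from §7–§8 fed into
`e₂(M − I) = −tr(M − I)` of §9.) [cite: GodrecheManneville1998, §8.4 eqs. (8.92)–(8.103)] -/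
theorem exists_trace_tunedMonodromy_ge :
    ∃ K : ℝ, 0 ≤ K ∧ ∀ α : ℝ, 1 ≤ α → α ≤ 2 →
      (α - 1) ^ 2 * ((9 * π / 8) ^ 2 - K * (α - 1)) ≤
        LinearMap.trace ℝ _ (tunedMonodromy α) - 3 := by
  obtain ⟨c, hc⟩ : ∃ c : ℝ, c = closeConst := ⟨_, rfl⟩
  have hc0 : 0 ≤ c := by rw [hc]; exact closeConst_nonneg
  obtain ⟨S, hS⟩ : ∃ S : ℝ, S = 269 * (1 + c * 1) + 7 * (c * 1) := ⟨_, rfl⟩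
  have hS0 : 0 ≤ S := by rw [hS]; positivity
  obtain ⟨C₁, hC₁⟩ : ∃ C₁ : ℝ, C₁ = 2 * π * (4 * S) := ⟨_, rfl⟩
  obtain ⟨C₂, hC₂⟩ : ∃ C₂ : ℝ, C₂ = Real.sqrt 3 / 4 * (c * 4) := ⟨_, rfl⟩
  obtain ⟨C₃, hC₃⟩ : ∃ C₃ : ℝ, C₃ = c * 4 := ⟨_, rfl⟩
  obtain ⟨μ, hμ⟩ : ∃ μ : ℝ, μ = 9 * π / 8 := ⟨_, rfl⟩
  have hμ0 : 0 ≤ μ := by rw [hμ]; positivity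
  have hC₁0 : 0 ≤ C₁ := by rw [hC₁]; positivity
  have hC₂0 : 0 ≤ C₂ := by rw [hC₂]; positivity
  have hC₃0 : 0 ≤ C₃ := by rw [hC₃]; positivity
  refine ⟨2 * μ * C₁ + 2 * C₁ ^ 2 + 2 * C₂ * C₃ + 2 * C₁ * C₂, by positivity, fun α hα hα2 => ?_⟩
  have hη0 : 0 ≤ α - 1 := by linarith
  have hη1 : α - 1 ≤ 1 := by linarith
  have hαne : α ≠ 0 := by linarith
  obtain ⟨hb0, hb0', hb0'', hb1, hb2, hb3, ha1, ha2, ha1', ha2'⟩ := baseSol_frame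
  have hy0 : ∀ x₀, trueSol α x₀ 0 = x₀ := trueSol_zero α
  have hclose := fun s (hs : s ∈ Icc 0 (2 * π)) => norm_trueSol_sub_baseSol_le hα hα2 hs
  have h2π : (2 * π) ∈ Icc 0 (2 * π) := ⟨by positivity, le_rfl⟩
  obtain ⟨f11, f22, f33, f12, f21, f13, f31, f23, f32⟩ := inner_frame
  obtain ⟨hn1, hn2, -⟩ := norm_frame
  have hcc : closeConst * 1 = c * 1 := by rw [hc]
  have hcc4 : closeConst * 4 = c * 4 := by rw [hc]
  -- (E1): the four `(a,b) ∈ {1,2}²` expansions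
  have E11 := abs_inner_trueSol_sub_le hα hα2 hasDerivAt_adjSol₁ adjSol₁_adjoint ha1 ha1'
    (fun s => (norm_adjSol_le s).1) continuous_baseSol.1 (fun s => (norm_baseSol_le s).1)
    (hasDerivAt_trueSol α frame₁) (by positivity : 0 ≤ c * 1) (fun s hs => hcc ▸ (hclose s hs).1)
  have E12 := abs_inner_trueSol_sub_le hα hα2 hasDerivAt_adjSol₁ adjSol₁_adjoint ha1 ha1'
    (fun s => (norm_adjSol_le s).1) continuous_baseSol.2.1 (fun s => (norm_baseSol_le s).2.1)
    (hasDerivAt_trueSol α frame₂) (by positivity : 0 ≤ c * 1) (fun s hs => hcc ▸ (hclose s hs).2.1)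
  have E21 := abs_inner_trueSol_sub_le hα hα2 hasDerivAt_adjSol₂ adjSol₂_adjoint ha2 ha2'
    (fun s => (norm_adjSol_le s).2) continuous_baseSol.1 (fun s => (norm_baseSol_le s).1)
    (hasDerivAt_trueSol α frame₁) (by positivity : 0 ≤ c * 1) (fun s hs => hcc ▸ (hclose s hs).1)
  have E22 := abs_inner_trueSol_sub_le hα hα2 hasDerivAt_adjSol₂ adjSol₂_adjoint ha2 ha2'
    (fun s => (norm_adjSol_le s).2) continuous_baseSol.2.1 (fun s => (norm_baseSol_le s).2.1)
    (hasDerivAt_trueSol α frame₂) (by positivity : 0 ≤ c * 1) (fun s hs => hcc ▸ (hclose s hs).2.1)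
  rw [integral_pairing₁₁, hy0, f11, mul_zero, sub_zero, ← hS] at E11
  rw [integral_pairing₁₂, hy0, f12, sub_zero, ← hμ, ← hS] at E12
  rw [integral_pairing₂₁, hy0, f21, sub_zero, ← hμ, ← hS] at E21
  rw [integral_pairing₂₂, hy0, f22, mul_zero, sub_zero, ← hS] at E22
  -- (E2): the `k̂`-row
  have E31 := abs_inner_frame₃_trueSol_sub_le (x := baseSol₁) (L := c * 1) hα
    (hasDerivAt_trueSol α frame₁) (by rw [hy0, hb1]) (hcc ▸ (hclose _ h2π).1)
  have E32 := abs_inner_frame₃_trueSol_sub_le (x := baseSol₂) (L := c * 1) hα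
    (hasDerivAt_trueSol α frame₂) (by rw [hy0, hb2]) (hcc ▸ (hclose _ h2π).2.1)
  have E33 := abs_inner_frame₃_trueSol_sub_le (x := baseSol₃) (L := c * 4) hα
    (hasDerivAt_trueSol α frame₃) (by rw [hy0, hb3]) (hcc4 ▸ (hclose _ h2π).2.2)
  rw [hy0, f31, sub_zero] at E31
  rw [hy0, f32, sub_zero] at E32
  rw [hy0, f33, ← hC₂] at E33
  -- (E3): the third column
  have E13 : |⟪frame₁, trueSol α frame₃ (2 * π)⟫| ≤ C₃ * (α - 1) := by
    have e : ⟪frame₁, trueSol α frame₃ (2 * π)⟫ = ⟪frame₁, trueSol α frame₃ (2 * π) - baseSol₃ (2 * π)⟫ := by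
      rw [inner_sub_right, hb3, f13, sub_zero]
    rw [e, hC₃, ← hcc4]
    refine (abs_real_inner_le_norm _ _).trans ?_
    rw [hn1, one_mul]; exact (hclose _ h2π).2.2
  have E23 : |⟪frame₂, trueSol α frame₃ (2 * π)⟫| ≤ C₃ * (α - 1) := by
    have e : ⟪frame₂, trueSol α frame₃ (2 * π)⟫ = ⟪frame₂, trueSol α frame₃ (2 * π) - baseSol₃ (2 * π)⟫ := by
      rw [inner_sub_right, hb3, f23, sub_zero]
    rw [e, hC₃, ← hcc4]
    refine (abs_real_inner_le_norm _ _).trans ?_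
    rw [hn2, one_mul]; exact (hclose _ h2π).2.2
  -- upgrade the constants to `C₁`, `C₂`
  have hup2 : 2 * π * (2 * S) * (α - 1) ^ 2 ≤ C₁ * (α - 1) ^ 2 := by
    rw [hC₁]; nlinarith [pi_pos, hS0, sq_nonneg (α - 1)]
  have hup4 : 2 * π * (4 * S) * (α - 1) ^ 2 = C₁ * (α - 1) ^ 2 := by rw [hC₁]
  have hup1 : Real.sqrt 3 / 4 * (c * 1) * (α - 1) ^ 2 ≤ C₂ * (α - 1) ^ 2 := by
    rw [hC₂]; nlinarith [sqrt3_pos, hc0, sq_nonneg (α - 1)]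
  -- the algebraic identity in the frame basis
  obtain ⟨hdet, hfix⟩ := tunedMonodromy_det_one_and_fixed hαne
  have halg := e₂_eq_trace_of_det_one_of_fixed frameBasis hdet hfix
  have htr : LinearMap.trace ℝ _ (tunedMonodromy α) = ∑ i, ⟪frameBasis i, tunedMonodromy α (frameBasis i)⟫ :=
    LinearMap.trace_eq_sum_inner _ frameBasis
  simp only [Fin.sum_univ_three, frameBasis_apply, Matrix.cons_val_zero, Matrix.cons_val_one,
    Matrix.cons_val_two, Matrix.head_cons, Matrix.tail_cons, tunedMonodromy_apply] at halg htr
  rw [htr, ← hμ]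
  exact trace_sub_three_ge hη0 hη1 hμ0 hC₁0 hC₂0 (E11.trans hup2) (E22.trans hup4.le)
    (E12.trans hup2) (E21.trans hup4.le) (E31.trans hup1) (E32.trans hup1) E33 E13 E23 halg

/-- `u − u² ≤ log(1 + u)` for `u ≥ 0`. [folklore] -/
private theorem sub_sq_le_log_one_add {u : ℝ} (hu : 0 ≤ u) : u - u ^ 2 ≤ Real.log (1 + u) := by
  have h := Real.one_sub_inv_le_log_of_pos (by linarith : 0 < 1 + u)
  have h1 : u - u ^ 2 ≤ 1 - (1 + u)⁻¹ := by
    have e : 1 - (1 + u)⁻¹ = u / (1 + u) := by field_simp; ring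
    rw [e, le_div_iff₀ (by linarith)]
    nlinarith [sq_nonneg u, mul_nonneg hu (sq_nonneg u)]
  linarith

/-- Smallness bookkeeping: `η (K₁/μ² + (K₁/μ + μ²) + 1) ≤ 1` gives `K₁ η ≤ μ² (1 − η)`. [folklore] -/
private theorem smallness_aux {K₁ μ η : ℝ} (hK₁0 : 0 ≤ K₁) (hμpos : 0 < μ) (hη0 : 0 < η)
    (hsmall : η * (K₁ / μ ^ 2 + (K₁ / μ + μ ^ 2) + 1) ≤ 1) : K₁ * η ≤ μ ^ 2 * (1 - η) := by
  have e : η * (K₁ / μ ^ 2 + (K₁ / μ + μ ^ 2) + 1) = η * (K₁ / μ ^ 2) + η * (K₁ / μ + μ ^ 2) + η := by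
    ring
  have h0 : 0 ≤ η * (K₁ / μ + μ ^ 2) := by positivity
  have h1 : η * (K₁ / μ ^ 2) ≤ 1 - η := by linarith
  have h2 : η * (K₁ / μ ^ 2) * μ ^ 2 = η * K₁ := by
    rw [mul_assoc, div_mul_cancel₀ K₁ (pow_ne_zero 2 hμpos.ne')]
  nlinarith [mul_le_mul_of_nonneg_right h1 (sq_nonneg μ)]

/-- The real-variable heart of the multiplier estimate: if `t ≥ η²(μ² − K₁η) > 0` and
`a = (|t+2| + √((t+2)² − 4))/2` then `log a ≥ ημ − (K₁/μ + μ²) η²`. [folklore] -/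
private theorem log_abs_multiplier_ge {K₁ μ η t a : ℝ} (hK₁0 : 0 ≤ K₁) (hμpos : 0 < μ) (hη0 : 0 < η)
    (hK₁η : K₁ * η ≤ μ ^ 2 * (1 - η)) (htpos : 0 < t) (htr : η ^ 2 * (μ ^ 2 - K₁ * η) ≤ t)
    (ha : a = (|t + 2| + Real.sqrt ((t + 2) ^ 2 - 4)) / 2) :
    η * μ - (K₁ / μ + μ ^ 2) * η ^ 2 ≤ Real.log a := by
  have hK₁η' : K₁ * η ≤ μ ^ 2 := by nlinarith [sq_nonneg μ]
  have hKdiv : K₁ * η / μ ≤ μ := by rw [div_le_iff₀ hμpos]; nlinarith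
  have hdiv0 : 0 ≤ K₁ * η / μ := by positivity
  obtain ⟨u, hu⟩ : ∃ u : ℝ, u = η * (μ - K₁ * η / μ) := ⟨_, rfl⟩
  have hu0 : 0 ≤ u := by rw [hu]; exact mul_nonneg hη0.le (by linarith)
  have huμ : u ≤ η * μ := by rw [hu]; nlinarith
  have h1 : (μ - K₁ * η / μ) ^ 2 ≤ μ ^ 2 - K₁ * η := by
    have e : (μ - K₁ * η / μ) ^ 2 = μ ^ 2 - 2 * (K₁ * η) + (K₁ * η) ^ 2 / μ ^ 2 := by
      field_simp
      ring
    have : (K₁ * η) ^ 2 / μ ^ 2 ≤ K₁ * η := by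
      rw [div_le_iff₀ (by positivity)]; nlinarith [mul_nonneg hK₁0 hη0.le]
    rw [e]; linarith
  have hu2t : u ^ 2 ≤ t :=
    calc u ^ 2 = η ^ 2 * (μ - K₁ * η / μ) ^ 2 := by rw [hu]; ring
      _ ≤ η ^ 2 * (μ ^ 2 - K₁ * η) := mul_le_mul_of_nonneg_left h1 (sq_nonneg η)
      _ ≤ t := htr
  have hsq : 2 * u ≤ Real.sqrt ((t + 2) ^ 2 - 4) := by
    have h2 : (2 * u) ^ 2 ≤ (t + 2) ^ 2 - 4 := by nlinarith
    calc 2 * u = Real.sqrt ((2 * u) ^ 2) := (Real.sqrt_sq (by positivity)).symm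
      _ ≤ _ := Real.sqrt_le_sqrt h2
  have hage : 1 + u ≤ a := by
    rw [ha, abs_of_pos (by linarith : 0 < t + 2)]; linarith
  have hlog : Real.log (1 + u) ≤ Real.log a := Real.log_le_log (by linarith) hage
  have hl2 := sub_sq_le_log_one_add hu0
  have hu2 : u ^ 2 ≤ (η * μ) ^ 2 := pow_le_pow_left₀ hu0 huμ 2
  have hueq : u = η * μ - K₁ / μ * η ^ 2 := by rw [hu]; ring
  have e2 : η * μ - (K₁ / μ + μ ^ 2) * η ^ 2 = (η * μ - K₁ / μ * η ^ 2) - (η * μ) ^ 2 := by ring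
  rw [e2, ← hueq]
  linarith

/-- **A real multiplier with `log ρ ≥ (α−1)(9π/8) − K(α−1)²`.** There is `K > 0` such that for
`1 < α ≤ 2` with `(α−1)K ≤ 1` the monodromy of the normalised system along the tuned orbit has a
real characteristic multiplier `ρ`, `|ρ| > 1`, with a real eigenvector, and
`log|ρ| ≥ (α−1)·9π/8 − K(α−1)²` — Waleffe's `σ = (9/16)ε` at leading order in orbital time
(`σ_s · 2π = log ρ`, `(α−1) ↔ ε/γ`). [cite: GodrecheManneville1998, §8.4 eqs. (8.92)–(8.103);
Saffman1992, §12.4 eq. (9); Chicone2006, §2.4] -/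
theorem exists_multiplier_log_ge :
    ∃ K : ℝ, 0 < K ∧ ∀ α : ℝ, 1 < α → α ≤ 2 → (α - 1) * K ≤ 1 →
      ∃ ρ : ℝ, ∃ x₀ : EuclideanSpace ℝ (Fin 3), x₀ ≠ 0 ∧ tunedMonodromy α x₀ = ρ • x₀ ∧ 1 < |ρ| ∧
        (α - 1) * (9 * π / 8) - K * (α - 1) ^ 2 ≤ Real.log |ρ| := by
  obtain ⟨K₁, hK₁0, hK₁⟩ := exists_trace_tunedMonodromy_ge
  obtain ⟨μ, hμ⟩ : ∃ μ : ℝ, μ = 9 * π / 8 := ⟨_, rfl⟩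
  have hμpos : 0 < μ := by rw [hμ]; positivity
  refine ⟨K₁ / μ ^ 2 + (K₁ / μ + μ ^ 2) + 1, by positivity, fun α hα hα2 hsmall => ?_⟩
  have hη0 : 0 < α - 1 := by linarith
  have hα0 : α ≠ 0 := by linarith
  have hK₁η := smallness_aux hK₁0 hμpos hη0 hsmall
  have htr := hK₁ α hα.le hα2
  rw [← hμ] at htr
  have htpos : 0 < LinearMap.trace ℝ _ (tunedMonodromy α) - 3 := by
    have h1 : 0 < μ ^ 2 - K₁ * (α - 1) := by nlinarith [pow_pos hμpos 2]
    have h2 : 0 < (α - 1) ^ 2 * (μ ^ 2 - K₁ * (α - 1)) := mul_pos (pow_pos hη0 2) h1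
    linarith
  have hτ : 2 < |LinearMap.trace ℝ _ (tunedMonodromy α) - 1| := by
    rw [abs_of_pos (by linarith)]; linarith
  obtain ⟨ρ, x₀, hx, heig, habs, hρ⟩ := exists_multiplier_of_trace_abs_eq (nsGrad_trace α)
    (continuous_tunedOrbit α) (hasDerivAt_tunedOrbit hα0) (tunedOrbit_ne_zero α)
    (by positivity : (0:ℝ) ≤ 2 * π) (tunedOrbit_two_pi α) hτ
  refine ⟨ρ, x₀, hx, heig, hρ, ?_⟩
  have habs' : |ρ| = (|LinearMap.trace ℝ _ (tunedMonodromy α) - 3 + 2| +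
      Real.sqrt ((LinearMap.trace ℝ _ (tunedMonodromy α) - 3 + 2) ^ 2 - 4)) / 2 := by
    rw [sub_add, show (3:ℝ) - 2 = 1 by norm_num]; exact habs
  clear heig habs
  have hmain := log_abs_multiplier_ge hK₁0 hμpos hη0 hK₁η htpos htr habs'
  clear habs'
  have hnn : 0 ≤ (K₁ / μ ^ 2 + 1) * (α - 1) ^ 2 := by positivity
  rw [← hμ]
  linarith

/-! ### §11 Transport to physical time: the lower half of the `9/16`-law -/

/-- `lin (c • M) x = c • lin M x`. [cite: MajdaBertozziCUP2002, §1.4 Prop. 1.5 eq. (1.24)] -/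
theorem lin_smul_matrix (c : ℝ) (M : Matrix (Fin 3) (Fin 3) ℝ) (x : EuclideanSpace ℝ (Fin 3)) :
    lin (c • M) x = c • lin M x := by
  ext i
  simp only [lin_apply, Matrix.smul_apply, smul_eq_mul, PiLp.smul_apply, Finset.mul_sum]
  refine Finset.sum_congr rfl fun j _ => ?_
  ring

/-- The inviscid amplitude right-hand side is linear in the velocity gradient:
`ampRHS (c • M) 0 k v = c • ampRHS M 0 k v` (time rescaling of (12.4.5)). [cite: Saffman1992, §12.4 eq. (5)] -/
theorem ampRHS_smul_matrix (c : ℝ) (M : Matrix (Fin 3) (Fin 3) ℝ) (k v : EuclideanSpace ℝ (Fin 3)) :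
    ampRHS (c • M) 0 k v = c • ampRHS M 0 k v := by
  simp only [ampRHS, lin_smul_matrix, real_inner_smul_right, zero_mul, zero_smul, sub_zero, smul_sub,
    smul_smul]
  congr 1
  ring

/-- **Saffman's aspect ratio for small positive strain**: for `0 < ε ≤ γ/2`, `α = aspect γ ε`
satisfies `1 < α ≤ 2` and `α − 1 ≤ 2ε/γ`. [cite: Saffman1992, §12.4 eq. (7)] -/
theorem aspect_bounds {γ ε : ℝ} (hγ : 0 < γ) (hε : 0 < ε) (hεγ : ε ≤ γ / 2) :
    1 < aspect γ ε ∧ aspect γ ε ≤ 2 ∧ aspect γ ε - 1 ≤ 2 * ε / γ := by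
  have h1 : 0 < γ - ε := by linarith
  set q := (γ + ε) / (γ - ε) with hq
  have hq1 : 1 < q := by rw [hq, lt_div_iff₀ h1]; linarith
  have hq4 : q ≤ 4 := by rw [hq, div_le_iff₀ h1]; linarith
  have hq0 : 0 ≤ q := by linarith
  have hα : aspect γ ε = Real.sqrt q := rfl
  have hlt : 1 < aspect γ ε := by
    rw [hα]; exact (Real.lt_sqrt (by norm_num)).mpr (by linarith)
  have hle : aspect γ ε ≤ 2 := by
    rw [hα, Real.sqrt_le_left (by norm_num)]; linarith
  refine ⟨hlt, hle, ?_⟩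
  have hsq : aspect γ ε ^ 2 = q := by rw [hα]; exact Real.sq_sqrt hq0
  have hq' : q - 1 = 2 * ε / (γ - ε) := by rw [hq]; field_simp; ring
  have hfrac : 2 * ε / (γ - ε) ≤ 2 * (2 * ε / γ) := by
    rw [div_le_iff₀ h1]
    have e : 2 * (2 * ε / γ) * (γ - ε) = 4 * ε * (γ - ε) / γ := by ring
    rw [e, le_div_iff₀ hγ]
    nlinarith
  -- `(α − 1)(α + 1) = q − 1` and `α + 1 ≥ 2`
  have ha1 : 0 ≤ aspect γ ε - 1 := by linarith
  have key : (aspect γ ε - 1) * (aspect γ ε + 1) ≤ 2 * (2 * ε / γ) := by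
    have e : (aspect γ ε - 1) * (aspect γ ε + 1) = aspect γ ε ^ 2 - 1 := by ring
    rw [e, hsq]; linarith
  have h2 : (aspect γ ε - 1) * 2 ≤ (aspect γ ε - 1) * (aspect γ ε + 1) :=
    mul_le_mul_of_nonneg_left (by linarith) ha1
  have e3 : 2 * (2 * ε / γ) = 2 * ε / γ * 2 := by ring
  nlinarith [key, h2, e3]

/-- **In orbital time the strain is `(α − 1)Ω = ε · 2α/(α+1)`**: `(α−1) Ω (α+1) = 2αε`
(`αΩ = γ + ε`, `(γ−ε)α = Ω`). [cite: Saffman1992, §12.4 eq. (7)] -/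
theorem aspect_sub_one_mul_orbitFrequency {γ ε : ℝ} (hε : |ε| < γ) :
    (aspect γ ε - 1) * orbitFrequency γ ε * (aspect γ ε + 1) = 2 * aspect γ ε * ε := by
  have e1 := sub_mul_aspect hε
  have e2 := aspect_mul_orbitFrequency hε
  linear_combination (aspect γ ε) * e2 + e1

/-- **The growing mode rides the tuned orbit.** For `γ > 0`, `δ > 0` there is `ε₀ ∈ (0, γ/2]`
such that for `0 < ε < ε₀` the strained vortex `gradMatrix γ ε` carries an inviscid Kelvin mode
ON the tuned resonant orbit `t ↦ κ_α(Ωt)` (`α = aspect γ ε`, `Ω = orbitFrequency γ ε`; inclination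
`cos θ = 1/2 + O(ε)`) whose amplitude grows at least like `c e^{(9/16 − δ) ε t}`, `c > 0` — the
Floquet mode of the real multiplier of `exists_multiplier_log_ge`, transported from orbital to
physical time (`σ_t = σ_s Ω`, `(α−1)Ω = ε · 2α/(α+1) ≥ ε`).
[cite: GodrecheManneville1998, §8.4 eqs. (8.92)–(8.103); Saffman1992, §12.4 eqs. (3)–(9)] -/
theorem exists_kelvinMode_on_tunedOrbit {γ δ : ℝ} (hγ : 0 < γ) (hδ : 0 < δ) :
    ∃ ε₀ : ℝ, 0 < ε₀ ∧ ε₀ ≤ γ / 2 ∧ ∀ ε : ℝ, 0 < ε → ε < ε₀ →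
      ∃ v : ℝ → EuclideanSpace ℝ (Fin 3),
        IsKelvinMode (gradMatrix γ ε) 0 (fun t => tunedOrbit (aspect γ ε) (orbitFrequency γ ε * t)) v ∧
          ∃ c : ℝ, 0 < c ∧ ∀ t : ℝ, 0 ≤ t → c * exp ((9 / 16 - δ) * ε * t) ≤ ‖v t‖ := by
  obtain ⟨K, hK, hmult⟩ := exists_multiplier_log_ge
  set m := min 1 (π * δ) with hm
  have hm0 : 0 < m := lt_min one_pos (by positivity)
  refine ⟨min (γ / 2) (γ * m / (4 * K)), lt_min (by positivity) (by positivity), min_le_left _ _,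
    fun ε hε hεlt => ?_⟩
  have hε2 : ε ≤ γ / 2 := (hεlt.trans_le (min_le_left _ _)).le
  have hεK : ε < γ * m / (4 * K) := hεlt.trans_le (min_le_right _ _)
  have hεabs : |ε| < γ := by rw [abs_of_pos hε]; linarith
  set α := aspect γ ε with hαdef
  set Ω := orbitFrequency γ ε with hΩdef
  have hΩ : 0 < Ω := orbitFrequency_pos hεabs
  obtain ⟨hα1, hα2, hηε⟩ := aspect_bounds hγ hε hε2
  have hα0 : α ≠ 0 := by linarith
  set η := α - 1 with hη
  have hη0 : 0 < η := by rw [hη]; linarith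
  -- smallness of `η`
  have hηm : η * K < m / 2 := by
    have h1 : η * K ≤ 2 * ε / γ * K := mul_le_mul_of_nonneg_right hηε hK.le
    have h2 : 2 * ε / γ * K < m / 2 := by
      rw [div_mul_eq_mul_div, div_lt_iff₀ hγ]
      rw [lt_div_iff₀ (by positivity)] at hεK
      linarith
    linarith
  have hη1 : η * K ≤ 1 := by linarith [min_le_left 1 (π * δ)]
  have hηδ : η * K ≤ π * δ := by linarith [min_le_right 1 (π * δ)]
  -- the multiplier and the growing mode in orbital time
  obtain ⟨ρ, x₀, hx, heig, hρ, hlog⟩ := hmult α hα1 hα2 hη1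
  obtain ⟨w, -, -, hkm, -, c, C, hc, -, hb⟩ := exists_kelvinMode_of_multiplier le_rfl
    (contDiff_tunedOrbit α) (hasDerivAt_tunedOrbit hα0) (tunedOrbit_ne_zero α) two_pi_pos
    (tunedOrbit_periodic α) hx heig hρ
  -- transport to physical time
  have hgrad : gradMatrix γ ε = Ω • nsGrad α := gradMatrix_eq_smul_nsGrad hεabs
  refine ⟨fun t => w (Ω * t), ⟨fun t => ?_, fun t => ?_, fun t => ?_⟩, c, hc, fun t ht => ?_⟩
  · have h := (hasDerivAt_tunedOrbit hα0 (Ω * t)).scomp t ((hasDerivAt_id t).const_mul Ω)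
    refine h.congr_deriv ?_
    rw [hgrad, Matrix.transpose_smul, lin_smul_matrix, mul_one, smul_neg]
  · have h := (hkm.hasDerivAt_amplitude (Ω * t)).scomp t ((hasDerivAt_id t).const_mul Ω)
    refine h.congr_deriv ?_
    rw [hgrad, ampRHS_smul_matrix, mul_one]
  · exact hkm.transversal (Ω * t)
  · -- the rate: `(9/16 − δ) ε ≤ (log|ρ|/2π) Ω`
    have hP := aspect_sub_one_mul_orbitFrequency hεabs
    rw [← hαdef, ← hΩdef, ← hη] at hP
    have hP1 : ε ≤ η * Ω := by nlinarith
    have hP2 : η * Ω ≤ 2 * ε := by nlinarith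
    have hrate : (9 / 16 - δ) * ε ≤ Real.log |ρ| / (2 * π) * Ω := by
      rw [div_mul_eq_mul_div, le_div_iff₀ two_pi_pos]
      have h1 : (η * (9 * π / 8) - K * η ^ 2) * Ω ≤ Real.log |ρ| * Ω :=
        mul_le_mul_of_nonneg_right hlog hΩ.le
      have h2 : (η * (9 * π / 8) - K * η ^ 2) * Ω =
          9 / 16 * (2 * π) * (η * Ω) - K * η * (η * Ω) := by ring
      have h3 : K * η * (η * Ω) ≤ K * η * (2 * ε) := mul_le_mul_of_nonneg_left hP2 (by positivity)
      have h4 : K * η * (2 * ε) ≤ π * δ * (2 * ε) := by nlinarith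
      nlinarith [pi_pos]
    have hbt := (hb (Ω * t) (by positivity)).1
    refine le_trans ?_ hbt
    refine mul_le_mul_of_nonneg_left (exp_le_exp.mpr ?_) hc.le
    have : (9 / 16 - δ) * ε * t ≤ Real.log |ρ| / (2 * π) * Ω * t := mul_le_mul_of_nonneg_right hrate ht
    linarith

/-- **The lower half of the `9/16`-law (Waleffe 1990), as a theorem.** For every rotation rate
`γ > 0` and every `δ > 0` there is `ε₀ > 0` such that for all strains `0 < ε < ε₀` the strained
vortex `gradMatrix γ ε` carries an inviscid Kelvin mode (Saffman (12.4.3)–(12.4.5): wave vector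
transported by the flow, amplitude equation, incompressibility) with `k 0 ≠ 0` whose amplitude grows
at least like `c e^{(9/16 − δ) ε t}` (`c > 0`) — the `∃`-clause of
`EllipticalInstability.NineSixteenthsLaw`. The mode rides the tuned resonant orbit (inclination
`cos θ = 1/2 + O(ε)`, Waleffe's `c = 1`) and is the Floquet mode of the real multiplier of
`exists_multiplier_log_ge`, transported from orbital to physical time
(`σ_t = σ_s Ω`, `(α−1)Ω = ε · 2α/(α+1) ≥ ε`). Honest scope: the matching UPPER clause with the
sharp constant (`σ_max ≤ (9/16 + δ)ε`) is not proved here; the tree has the ceiling `σ ≤ ε`.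
[cite: GodrecheManneville1998, §8.4 eqs. (8.92)–(8.103); Saffman1992, §12.4 eqs. (3)–(9) and
Fig. 12.4-1; Cambon2000RotatingFrameVortexStability, §3.2 eq. (3.2)] -/
theorem nineSixteenths_exists_half {γ δ : ℝ} (hγ : 0 < γ) (hδ : 0 < δ) :
    ∃ ε₀ : ℝ, 0 < ε₀ ∧ ∀ ε : ℝ, 0 < ε → ε < ε₀ →
      ∃ k v : ℝ → EuclideanSpace ℝ (Fin 3), IsKelvinMode (gradMatrix γ ε) 0 k v ∧ k 0 ≠ 0 ∧
        ∃ c : ℝ, 0 < c ∧ ∀ t : ℝ, 0 ≤ t → c * exp ((9 / 16 - δ) * ε * t) ≤ ‖v t‖ := by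
  obtain ⟨ε₀, hε₀, -, h⟩ := exists_kelvinMode_on_tunedOrbit hγ hδ
  refine ⟨ε₀, hε₀, fun ε hε hlt => ?_⟩
  obtain ⟨v, hkm, c, hc, hb⟩ := h ε hε hlt
  exact ⟨_, v, hkm, tunedOrbit_ne_zero _ _, c, hc, hb⟩

/-- **The `∃`-clause of `NineSixteenthsLaw`, verbatim.** [cite: Cambon2000RotatingFrameVortexStability,
§3.2 eq. (3.2); GodrecheManneville1998, §8.4 eqs. (8.92)–(8.103)] -/
theorem nineSixteenthsLaw_exists_clause :
    ∀ γ : ℝ, 0 < γ → ∀ δ : ℝ, 0 < δ → ∃ ε₀ : ℝ, 0 < ε₀ ∧ ∀ ε : ℝ, 0 < ε → ε < ε₀ →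
      ∃ k v : ℝ → EuclideanSpace ℝ (Fin 3), IsKelvinMode (gradMatrix γ ε) 0 k v ∧ k 0 ≠ 0 ∧
        ∃ c : ℝ, 0 < c ∧ ∀ t : ℝ, 0 ≤ t → c * exp ((9 / 16 - δ) * ε * t) ≤ ‖v t‖ :=
  fun _ hγ _ hδ => nineSixteenths_exists_half hγ hδ

/-- **The exponent curve reaches `(9/16 − δ)ε` — the lower half of the `9/16`-law in the
vocabulary of `EllipticalInstabilityFloquet`.** For `γ > 0` and `δ > 0` there is `ε₀ > 0` such
that for `0 < ε < ε₀` SOME inclination `θ` of Saffman's orbit family (12.4.6) has Floquet growth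
exponent `σ_F(γ, ε, θ) ≥ (9/16 − δ) ε` ("the growth rate" of (12.4.9), maximised over the
inclination, is at least Waleffe's `(9/16)ε` to leading order); together with
`kelvinFloquetExponent_le_strain` (`σ_F ≤ ε`) the maximal inviscid growth rate of the strained
vortex is pinned in `[(9/16 − δ)ε, ε]` for all small `ε`. Proof: the growing mode of
`nineSixteenths_exists_half` (with `δ/2`) against `IsKelvinMode.exists_norm_le_exp_of_forall_lt`.
[cite: Saffman1992, §12.4 eqs. (6), (9) and Fig. 12.4-1; Cambon2000RotatingFrameVortexStability,
§3.2 eq. (3.2); GodrecheManneville1998, §8.4 eqs. (8.92)–(8.103)] -/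
theorem exists_kelvinFloquetExponent_ge {γ δ : ℝ} (hγ : 0 < γ) (hδ : 0 < δ) :
    ∃ ε₀ : ℝ, 0 < ε₀ ∧ ∀ ε : ℝ, 0 < ε → ε < ε₀ →
      ∃ θ : ℝ, (9 / 16 - δ) * ε ≤ kelvinFloquetExponent γ ε 1 θ := by
  obtain ⟨ε₁, hε₁, h⟩ := nineSixteenths_exists_half hγ (half_pos hδ)
  refine ⟨min ε₁ γ, lt_min hε₁ hγ, fun ε hε hlt => ?_⟩
  have hε₁' : ε < ε₁ := hlt.trans_le (min_le_left _ _)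
  have hεabs : |ε| < γ := by rw [abs_of_pos hε]; exact hlt.trans_le (min_le_right _ _)
  obtain ⟨k, v, hkm, hk0, c, hc, hlow⟩ := h ε hε hε₁'
  by_contra hcon
  push Not at hcon
  obtain ⟨C, hC⟩ := hkm.exists_norm_le_exp_of_forall_lt hεabs hk0 hcon
  -- `c e^{(δ/2) ε t} ≤ C` for all `t ≥ 0`
  have key : ∀ t : ℝ, 0 ≤ t → c * exp (δ / 2 * ε * t) ≤ C := by
    intro t ht
    have h1 := (hlow t ht).trans (hC t ht)
    have e : (9 / 16 - δ / 2) * ε * t = δ / 2 * ε * t + (9 / 16 - δ) * ε * t := by ring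
    rw [e, exp_add, ← mul_assoc] at h1
    exact le_of_mul_le_mul_right h1 (exp_pos _)
  have hc0 : c ≠ 0 := hc.ne'
  have hδ0 : δ ≠ 0 := hδ.ne'
  have hε0 : ε ≠ 0 := hε.ne'
  obtain ⟨T, hT⟩ : ∃ T : ℝ, T = 2 * C / (c * (δ * ε)) := ⟨_, rfl⟩
  have hC0 : 0 < C := lt_of_lt_of_le (by positivity) (key 0 le_rfl)
  have hT0 : 0 ≤ T := by rw [hT]; positivity
  have h3 : δ / 2 * ε * T + 1 ≤ exp (δ / 2 * ε * T) := Real.add_one_le_exp _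
  have h4 : δ / 2 * ε * T = C / c := by
    rw [hT]
    field_simp
  have h5 : c * (C / c + 1) ≤ C :=
    calc c * (C / c + 1) = c * (δ / 2 * ε * T + 1) := by rw [h4]
      _ ≤ c * exp (δ / 2 * ε * T) := mul_le_mul_of_nonneg_left h3 hc.le
      _ ≤ C := key T hT0
  have h6 : c * (C / c + 1) = C + c := by
    rw [mul_add, mul_one, mul_div_cancel₀ C hc0]
  linarith

/-- **The small-strain window for the maximal inviscid growth rate, two-sided in the kernel**:
for `γ > 0`, `δ > 0` and all `0 < ε < ε₀(γ, δ)`: some inclination has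
`σ_F(γ, ε, θ) ≥ (9/16 − δ) ε` (this file) and every inclination has `σ_F(γ, ε, θ) ≤ ε`
(`kelvinFloquetExponent_le_strain`, the strain-rate ceiling). (Waleffe/Cambon (3.2):
`σ_max/ε → 9/16`; the sharp upper constant is not asserted.)
[cite: Cambon2000RotatingFrameVortexStability, §3.2 eq. (3.2); Saffman1992, §12.4 eq. (9) and
Fig. 12.4-1] -/
theorem kelvinFloquetExponent_window {γ δ : ℝ} (hγ : 0 < γ) (hδ : 0 < δ) :
    ∃ ε₀ : ℝ, 0 < ε₀ ∧ ∀ ε : ℝ, 0 < ε → ε < ε₀ →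
      (∃ θ : ℝ, (9 / 16 - δ) * ε ≤ kelvinFloquetExponent γ ε 1 θ) ∧
        ∀ θ : ℝ, kelvinFloquetExponent γ ε 1 θ ≤ ε := by
  obtain ⟨ε₁, hε₁, h⟩ := exists_kelvinFloquetExponent_ge hγ hδ
  refine ⟨min ε₁ γ, lt_min hε₁ hγ, fun ε hε hlt => ⟨h ε hε (hlt.trans_le (min_le_left _ _)), ?_⟩⟩
  have hεabs : |ε| < γ := by rw [abs_of_pos hε]; exact hlt.trans_le (min_le_right _ _)
  exact fun θ => kelvinFloquetExponent_le_strain hεabs hε.le one_ne_zero θ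

/-- For `0 < ε ≤ γ/2` the period-averaged squared wave number is at most `2 k₀²`
(`α² ≤ 3`, `⟨|k|²⟩ = k₀²(1 + (α²−1) sin²θ/2)`). [cite: Saffman1992, §12.4 eqs. (6)–(7) and p. 201] -/
theorem meanWavenumberSq_le_two_mul_sq {γ ε : ℝ} (hε : 0 < ε) (hεγ : ε ≤ γ / 2)
    (k₀ θ : ℝ) : meanWavenumberSq γ ε k₀ θ ≤ 2 * k₀ ^ 2 := by
  have h1 : 0 < γ - ε := by linarith
  have hα3 : aspect γ ε ^ 2 ≤ 3 := by
    rw [aspect, Real.sq_sqrt (div_nonneg (by linarith) h1.le), div_le_iff₀ h1]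
    linarith
  rw [meanWavenumberSq_eq]
  have hs : sin θ ^ 2 ≤ 1 := sin_sq_le_one θ
  have hs0 : 0 ≤ sin θ ^ 2 := sq_nonneg _
  have hin : (1 - sin θ ^ 2 / 2) + aspect γ ε ^ 2 * (sin θ ^ 2 / 2) ≤ 2 := by
    nlinarith [mul_le_mul_of_nonneg_right hα3 (by positivity : (0:ℝ) ≤ sin θ ^ 2 / 2)]
  nlinarith [sq_nonneg k₀, mul_le_mul_of_nonneg_left hin (sq_nonneg k₀)]

/-- **Viscous version of the lower half (Landman–Saffman shift).** For `γ > 0`, `δ > 0` and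
`0 < ε < ε₀(γ, δ)` there is ONE inclination `θ` such that for every viscosity `ν ≥ 0` and every
wave number `k₀ ≠ 0` the viscous Floquet growth exponent satisfies
`σ_F(γ, ε, ν, θ; k₀) ≥ (9/16 − δ) ε − 2 ν k₀²` (`σ_F(ν) = σ_F(0) − ν⟨|k|²⟩`,
`viscousKelvinFloquetExponent_eq`, and `⟨|k|²⟩ ≤ 2k₀²` for `ε ≤ γ/2`).
[cite: Saffman1992, §12.4 eq. (9) and p. 201 (after eq. (9)); LewekeLedizesWilliamson2016, §4.1;
Cambon2000RotatingFrameVortexStability, §3.2 eq. (3.2)] -/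
theorem exists_viscousKelvinFloquetExponent_ge {γ δ : ℝ} (hγ : 0 < γ) (hδ : 0 < δ) :
    ∃ ε₀ : ℝ, 0 < ε₀ ∧ ∀ ε : ℝ, 0 < ε → ε < ε₀ → ∃ θ : ℝ, ∀ ν k₀ : ℝ, 0 ≤ ν → k₀ ≠ 0 →
      (9 / 16 - δ) * ε - 2 * ν * k₀ ^ 2 ≤ viscousKelvinFloquetExponent γ ε ν k₀ θ := by
  obtain ⟨ε₁, hε₁, h⟩ := exists_kelvinFloquetExponent_ge hγ hδ
  refine ⟨min ε₁ (γ / 2), lt_min hε₁ (half_pos hγ), fun ε hε hlt => ?_⟩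
  obtain ⟨θ, hθ⟩ := h ε hε (hlt.trans_le (min_le_left _ _))
  have hε2 : ε ≤ γ / 2 := (hlt.trans_le (min_le_right _ _)).le
  have hεabs : |ε| < γ := by rw [abs_of_pos hε]; linarith
  refine ⟨θ, fun ν k₀ hν hk₀ => ?_⟩
  rw [viscousKelvinFloquetExponent_eq hεabs hk₀, kelvinFloquetExponent_eq_one hk₀]
  have hm := mul_le_mul_of_nonneg_left (meanWavenumberSq_le_two_mul_sq hε hε2 k₀ θ) hν
  linarith

/-- **The viscous threshold with Waleffe's constant ("LIVE" side).** For `γ > 0`, `0 < δ`,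
`0 < ε < ε₀(γ, δ)`, at the inclination of `exists_viscousKelvinFloquetExponent_ge`: whenever
`2 ν k₀² < (9/16 − δ) ε` the viscous Floquet growth exponent is POSITIVE — the strained vortex is
linearly unstable to viscous Kelvin modes of wave number `k₀` (a sufficient Reynolds-number
condition with explicit constants; the exact threshold is `ν < σ_F(0)/⟨|k|²⟩`,
`viscousKelvinFloquetExponent_pos_iff`). [cite: Saffman1992, §12.4 p. 201 (after eq. (9));
LewekeLedizesWilliamson2016, §4.1] -/
theorem exists_viscousKelvinFloquetExponent_pos {γ δ : ℝ} (hγ : 0 < γ) (hδ : 0 < δ) :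
    ∃ ε₀ : ℝ, 0 < ε₀ ∧ ∀ ε : ℝ, 0 < ε → ε < ε₀ → ∃ θ : ℝ, ∀ ν k₀ : ℝ, 0 ≤ ν → k₀ ≠ 0 →
      2 * ν * k₀ ^ 2 < (9 / 16 - δ) * ε → 0 < viscousKelvinFloquetExponent γ ε ν k₀ θ := by
  obtain ⟨ε₀, hε₀, h⟩ := exists_viscousKelvinFloquetExponent_ge hγ hδ
  refine ⟨ε₀, hε₀, fun ε hε hlt => ?_⟩
  obtain ⟨θ, hθ⟩ := h ε hε hlt
  exact ⟨θ, fun ν k₀ hν hk₀ hsmall => lt_of_lt_of_le (by linarith) (hθ ν k₀ hν hk₀)⟩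

/-- **What remains of the named fact.** `EllipticalInstability.NineSixteenthsLaw` (Waleffe's
`σ_max/ε → 9/16`, both clauses) FOLLOWS from a uniform upper bound on the exponent curve alone:
if for every `γ > 0`, `δ > 0` and all small `ε > 0` one has `σ_F(γ, ε, θ) < (9/16 + δ) ε` for
every inclination `θ`, then the `9/16`-law holds — the `∀`-clause by
`nineSixteenths_forall_half_of_exponent_lt` (every mode rides an orbit), the `∃`-clause
unconditionally by `nineSixteenths_exists_half` (this file). Nothing is asserted about the
hypothesis (it is the open, sharp-constant half of Waleffe's law: uniform Floquet perturbation
over all inclinations, including the `O(ε)` resonance band and the higher tongues).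
[cite: Cambon2000RotatingFrameVortexStability, §3.2 eq. (3.2); Saffman1992, §12.4 eqs. (6), (9);
GodrecheManneville1998, §8.4 eqs. (8.92)–(8.103)] -/
theorem nineSixteenthsLaw_of_exponent_lt
    (hσ : ∀ γ : ℝ, 0 < γ → ∀ δ : ℝ, 0 < δ → ∃ ε₀ : ℝ, 0 < ε₀ ∧ ∀ ε : ℝ, 0 < ε → ε < ε₀ →
      ∀ θ : ℝ, kelvinFloquetExponent γ ε 1 θ < (9 / 16 + δ) * ε) :
    NineSixteenthsLaw := by
  intro γ hγ δ hδ
  obtain ⟨ε₁, hε₁, h₁⟩ := hσ γ hγ δ hδ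
  obtain ⟨ε₂, hε₂, h₂⟩ := nineSixteenths_exists_half hγ hδ
  refine ⟨min ε₁ (min ε₂ γ), lt_min hε₁ (lt_min hε₂ hγ), fun ε hε hlt => ⟨?_, ?_⟩⟩
  · have hεabs : |ε| < γ := by
      rw [abs_of_pos hε]; exact hlt.trans_le ((min_le_right _ _).trans (min_le_right _ _))
    exact nineSixteenths_forall_half_of_exponent_lt hεabs
      (h₁ ε hε (hlt.trans_le (min_le_left _ _)))
  · exact h₂ ε hε (hlt.trans_le ((min_le_right _ _).trans (min_le_left _ _)))

/-- **The viscous growing mode (Landman–Saffman): an exact, exponentially growing VISCOUS Kelvin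
mode on the strained vortex whenever `(5/4) ν k₀² < (9/16 − δ) ε`.** For `γ > 0`, `δ > 0`,
`0 < ε < ε₀(γ, δ)`, every viscosity `ν ≥ 0` and every wave-number scale `k₀ > 0` there is a Kelvin
mode `(k, v)` of `gradMatrix γ ε` WITH viscosity `ν` (Saffman (12.4.3)–(12.4.5) with the `−ν|k|²v`
term), wave vector `k(t) = k₀ κ_α(Ωt)` on the tuned orbit (`k₀²/4 ≤ |k(t)|² ≤ (5/4) k₀²`), and
`‖v(t)‖ ≥ c e^{((9/16 − δ)ε − (5/4) ν k₀²) t}` for `t ≥ 0` (`c > 0`): the inviscid mode of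
`exists_kelvinMode_on_tunedOrbit` times the exact viscous factor `exp(−ν ∫₀ᵗ |k|²)`
(`IsKelvinMode.viscous`, "an exact solution remains in the presence of viscosity", Saffman p. 201),
with `∫₀ᵗ |k|² ≤ (5/4) k₀² t`. [cite: Saffman1992, §12.4 eqs. (3)–(6) and p. 201 (after eq. (9));
LewekeLedizesWilliamson2016, §4.1; GodrecheManneville1998, §8.4 eqs. (8.92)–(8.103)] -/
theorem exists_viscous_kelvinMode_on_tunedOrbit {γ δ : ℝ} (hγ : 0 < γ) (hδ : 0 < δ) :
    ∃ ε₀ : ℝ, 0 < ε₀ ∧ ∀ ε : ℝ, 0 < ε → ε < ε₀ → ∀ ν k₀ : ℝ, 0 ≤ ν → 0 < k₀ →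
      ∃ k v : ℝ → EuclideanSpace ℝ (Fin 3), IsKelvinMode (gradMatrix γ ε) ν k v ∧
        (∀ t : ℝ, k t = k₀ • tunedOrbit (aspect γ ε) (orbitFrequency γ ε * t)) ∧
        (∀ t : ℝ, k₀ ^ 2 / 4 ≤ ‖k t‖ ^ 2 ∧ ‖k t‖ ^ 2 ≤ 5 / 4 * k₀ ^ 2) ∧
        ∃ c : ℝ, 0 < c ∧ ∀ t : ℝ, 0 ≤ t →
          c * exp (((9 / 16 - δ) * ε - 5 / 4 * ν * k₀ ^ 2) * t) ≤ ‖v t‖ := by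
  obtain ⟨ε₀, hε₀, hε₀γ, h⟩ := exists_kelvinMode_on_tunedOrbit hγ hδ
  refine ⟨ε₀, hε₀, fun ε hε hlt ν k₀ hν hk₀ => ?_⟩
  obtain ⟨v, hkm, c, hc, hb⟩ := h ε hε hlt
  have hε2 : ε ≤ γ / 2 := by linarith
  obtain ⟨hα1, hα2, -⟩ := aspect_bounds hγ hε hε2
  -- the scaled wave vector on the tuned orbit
  have hkm' : IsKelvinMode (gradMatrix γ ε) 0
      (fun t => k₀ • tunedOrbit (aspect γ ε) (orbitFrequency γ ε * t)) v :=
    hkm.smul_wavevector hk₀.ne'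
  have hnk : ∀ t : ℝ, ‖k₀ • tunedOrbit (aspect γ ε) (orbitFrequency γ ε * t)‖ ^ 2 =
      k₀ ^ 2 * ‖tunedOrbit (aspect γ ε) (orbitFrequency γ ε * t)‖ ^ 2 := fun t => by
    rw [norm_smul, Real.norm_eq_abs, abs_of_pos hk₀, mul_pow]
  have hkb : ∀ t : ℝ, k₀ ^ 2 / 4 ≤ ‖k₀ • tunedOrbit (aspect γ ε) (orbitFrequency γ ε * t)‖ ^ 2 ∧
      ‖k₀ • tunedOrbit (aspect γ ε) (orbitFrequency γ ε * t)‖ ^ 2 ≤ 5 / 4 * k₀ ^ 2 := fun t => by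
    rw [hnk t]
    have h1 := norm_tunedOrbit_sq_ge (aspect γ ε) (orbitFrequency γ ε * t)
    have h2 := norm_tunedOrbit_sq_le hα1.le hα2 (orbitFrequency γ ε * t)
    have hk2 : 0 ≤ k₀ ^ 2 := sq_nonneg k₀
    constructor <;> nlinarith [mul_le_mul_of_nonneg_left h1 hk2, mul_le_mul_of_nonneg_left h2 hk2]
  -- a primitive of `|k|²`
  have hcont : Continuous fun s : ℝ => ‖k₀ • tunedOrbit (aspect γ ε) (orbitFrequency γ ε * s)‖ ^ 2 :=
    ((((continuous_tunedOrbit (aspect γ ε)).comp (continuous_const_mul (orbitFrequency γ ε))).const_smul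
      k₀).norm).pow 2
  have hEd : ∀ t : ℝ, HasDerivAt (fun u => ∫ s in (0:ℝ)..u,
      ‖k₀ • tunedOrbit (aspect γ ε) (orbitFrequency γ ε * s)‖ ^ 2)
      (‖k₀ • tunedOrbit (aspect γ ε) (orbitFrequency γ ε * t)‖ ^ 2) t := fun t =>
    (hcont.integral_hasStrictDerivAt 0 t).hasDerivAt
  refine ⟨_, _, hkm'.viscous hEd ν, fun t => rfl, hkb, c, hc, fun t ht => ?_⟩
  -- `∫₀ᵗ |k|² ≤ (5/4) k₀² t`
  have hEle : ∫ s in (0:ℝ)..t, ‖k₀ • tunedOrbit (aspect γ ε) (orbitFrequency γ ε * s)‖ ^ 2 ≤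
      5 / 4 * k₀ ^ 2 * t := by
    have h1 : ∫ s in (0:ℝ)..t, ‖k₀ • tunedOrbit (aspect γ ε) (orbitFrequency γ ε * s)‖ ^ 2 ≤
        ∫ _ in (0:ℝ)..t, (5 / 4 * k₀ ^ 2 : ℝ) :=
      intervalIntegral.integral_mono_on ht (hcont.intervalIntegrable 0 t) intervalIntegrable_const
        (fun s _ => (hkb s).2)
    rw [intervalIntegral.integral_const, smul_eq_mul] at h1
    linarith
  show c * exp (((9 / 16 - δ) * ε - 5 / 4 * ν * k₀ ^ 2) * t) ≤
    ‖exp (-(ν * ∫ s in (0:ℝ)..t, ‖k₀ • tunedOrbit (aspect γ ε) (orbitFrequency γ ε * s)‖ ^ 2)) • v t‖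
  rw [norm_smul, Real.norm_eq_abs, abs_of_pos (exp_pos _)]
  have h2 : exp (-(5 / 4 * ν * k₀ ^ 2 * t)) ≤
      exp (-(ν * ∫ s in (0:ℝ)..t, ‖k₀ • tunedOrbit (aspect γ ε) (orbitFrequency γ ε * s)‖ ^ 2)) :=
    exp_le_exp.mpr (by nlinarith [mul_le_mul_of_nonneg_left hEle hν])
  have h3 := hb t ht
  calc c * exp (((9 / 16 - δ) * ε - 5 / 4 * ν * k₀ ^ 2) * t)
      = exp (-(5 / 4 * ν * k₀ ^ 2 * t)) * (c * exp ((9 / 16 - δ) * ε * t)) := by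
        rw [show ((9 / 16 - δ) * ε - 5 / 4 * ν * k₀ ^ 2) * t =
          -(5 / 4 * ν * k₀ ^ 2 * t) + (9 / 16 - δ) * ε * t by ring, exp_add]; ring
    _ ≤ _ := mul_le_mul h2 h3 (by positivity) (exp_pos _).le

end EllipticalInstability

end Literature.Analysis.FluidPDE
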